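import Literature.Barriers.Schanuel.AxSchanuelFunctionalNotNumerical
import Literature.Barriers.Schanuel.AxiomsDoNotForceSchanuel
import Literature.Barriers.Schanuel.SchanuelPropertyNotFirstOrder
import Literature.Barriers.Schanuel.AlgebraicIndependenceOfLogarithms
import Literature.Barriers.Schanuel.LinearSubgroupMethodLimitProofs
import Literature.Barriers.Schanuel.LargeTranscendenceDegreeHolds
import Literature.Barriers.Schanuel.EFunctionValuesAtAlgebraicPointsMainProofs
import Literature.Barriers.Schanuel.NesterenkoModularScopeHolds
import Literature.Barriers.Schanuel.NesterenkoModularScopeConjecture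
import Literature.Barriers.Schanuel.PeriodConjectureOverQbarScope
import Literature.Barriers.Schanuel.SpecialisationCollapse
import Literature.Barriers.Schanuel.AxLocalDerivationsBlind
import Literature.Barriers.Schanuel.AxSchanuelFunctionalNotNumericalNarrow
import HarnessLib

/-!
# Schanuel — barrier catalogue (`Summits/Schanuel/BARRIERS.md`)

Generation 2 · compiled 2026-08-17 by `planner-barriers-Schanuel-l1-g2-0` (mode `barrier-catalogue`, unit `barriers-Schanuel-l1-g2`) · re-armed daily ·
supersedes generation 1 (2026-08-16, `planner-barriers-Schanuel-l1-0`). **Ids are stable:** every generation-1 id (B1–B9, L1–L2, R1–R2, S1–S4, C1–C10,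
N1.1–N7.4) keeps its meaning and text (amended only where a later audit landed, marked "AUDIT 2026-08-17"); generation 2 APPENDS B10–B12 (§1),
H1–H3 (§1′ strong-hypothesis registry), S5 + E1–E6 (§3 status snapshot and landed summit-equivalences), C11–C15 with N8.1–N12.3 (§4), the
strategist-census ledger and eleven new dead lines (§5), checklist items 13–18 (§6).
Summit `Schanuel` = `Literature.Periods.SchanuelConjecture` (single sub-problem `Schanuel/Schanuel`;
`Summits/Schanuel/Schanuel/Statement.lean`): for `ℚ`-linearly independent `z₁, …, zₙ ∈ ℂ`,
`trdeg_ℚ ℚ(z, e^z) ≥ n`. By `Iff.rfl` it is `Literature.SchanuelProperty ℂ` and `∀ n, Literature.NumberTheory.Transcendental.SchanuelRank n`.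

**What this file is.** Every refutation, negative lemma and no-go that has LANDED IN THE TREE for this summit, one entry each:
exact statement + declaration (or proposal), the class of routes / statements it kills, and the escaping hypothesis if any.
Its path is injected into every ideator / plan-novel / crux payload for Schanuel: a card, route or crux line whose mechanism
needs an entry below (even reworded) is dead on arrival; say in your BARRIERS section which entries apply and how the line
evades them (D-0021), and run the typing checklist of §6 over every crux signature.

**Sources compiled (all read 2026-08-17, tree at the hub's HEAD ≈ 18:10Z).**
* §1 `lean/Literature/Barriers/Schanuel/*.lean` — the 12 catalogue declarations carrying a `BARRIER (D-0021)` block (9 of generation 1 +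
  `SpecialisationCollapseBarrier`, `AxLocalDerivationsBlind`, `AxSchanuelFunctionalNotNumericalNarrow`), all DISCHARGED in tree (`*_holds`, sorry-free),
  + 2 refuted printed renderings; the 2026-08-17 audits of B1 (`…RankProofs.lean`), B5 (`NesterenkoModularScopeSeries{,Holds}.lean`) and B7 are folded in.
* §1′ `lean/Literature/StrongHypotheses/Schanuel.lean` + `lean/Summits/Schanuel/StrongHypotheses.lean` (D-0034 registry of strong hypotheses `H ⇒ S` /
  equivalent criteria `E ↔ S` that the tribunal kernel probes against every new crux).
* §2 `ledger negatives --problem Schanuel` (2 refuted statement items, unchanged since generation 1) = `Summits/Schanuel/Schanuel/Theorems/*Refutation.lean`.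
* §3 the headers of all 47 `Summits/Schanuel/Schanuel/Theses/*.lean` (19 closed · 26 open · 1 draft · 1 done) and the landed summit-equivalence theorems.
* §4 `Summits/Schanuel/Schanuel/Theorems/<Crux>/Negative/*.lean` — 83 gate-landed negative-lemma files over 15 crux directories (10 files / 5 directories new).
* §5 `Summits/Schanuel/Schanuel/Cruxes/<Crux>/Disproof.lean` — 15 standing-disprover workfiles (3 new: `TateLocusGPCOne`, `NomeTransfer`, `NomeHygiene`;
  farm-elaborated, NOT gate-landed: cite the theorem name and re-check before relying on it), 19 strategist censuses `Cruxes/<Crux>/STRATEGY-CENSUS.md`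
  and the `Lines/*-dead.md` / `*-blocked.md` verdicts newer than generation 1.
* NOT available at compile time: `run/shared/priority/refutations.json` (payload `negatives_index`; the directory does not exist on this hub) and the verb
  `ledger negatives-list` (does not exist; `ledger negatives` used). Nothing else was skipped.

**Legend.** `PROVED` = sorry-free theorem in tree · `NAMED FACT` = `def … : Prop` with cite tag, used as hypothesis ·
`COND(X)` = proved implication from `X` · *kills* = statements / technique classes excluded · *escape* = hypothesis, regime or
object outside the entry's reach · *threatens* = open routes (as of 2026-08-17) whose BARRIERS section must answer the entry.
Item ids `stmt-Schanuel-NNNN` are ledger statement items; `route-Schanuel-<Slug>` are routes.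

---

## 0. One-line index

| id | declaration / item | status | kills (one line) |
|---|---|---|---|
| B1 | `Literature.Barriers.Schanuel.AlgebraicIndependenceOfLogarithms` | PROVED (strength marker) | any proof of `Schanuel` proves `AlgIndepLogarithms` (two alg. independent logs, `e^{π²}` transcendental, `r = s` for log-matrices); Gel'fond–Schneider–Baker / LST output only LINEAR independence or half the structural rank |
| B2 | `…LinearSubgroupMethodLimit` (Roy 1995 Thm 3.4) | PROVED | LST via `ℚ`-linear (local) embeddings never meets its rank hypothesis on matrices built from 3 `ℚ̄`-free numbers: cannot prove four exponentials / `AlgIndepLogarithms` on degree-`≥ 2` surfaces in `K³` |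
| B3 | `…LargeTranscendenceDegree` (Diaz 1989 = LNM 1752 Ch. 14 Thm 2.7) | PROVED | Gel'fond–Schneider in several variables reaches `t ≈ dℓ/(ℓ+d)` and needs the Technical Hypothesis for `t ≥ 3`; Schanuel wants `dℓ` |
| B4 | `…EFunctionValuesAtAlgebraicPoints` (Siegel–Shidlovskii) | PROVED | `E`-function method transfers independence only at ALGEBRAIC arguments; `e+π, eπ, e^e, π^e` believed non-`E`-values |
| B5 | `…NesterenkoModularScope` (Nesterenko 1996 Thm 1.1) | PROVED | modular method gives `trdeg ℚ(q,P(q),Q(q),R(q)) ≥ 3` at ONE `q`; `(e, π)` not among its outputs |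
| B6 | `…PeriodConjectureOverQbarScope` | PROVED (non-implication conjectural) | period conjectures over `ℚ̄` reach the countable `𝓛 = exp⁻¹(ℚ̄) ∌ 1`; toric GPC over `ℚ̄` ⟺ `AlgIndepLogarithms`; `(1, 2πi)` out of scope |
| B7 | `…AxSchanuelFunctionalNotNumerical` | PROVED | Ax/Kirby weak SP holds in EVERY exponential field ⇒ functional transcendence alone cannot give SP; E-derivations vanish on `ecl ∅ ∋ e, π, log 2`; residue = SP on countable `ecl ∅` |
| B8 | `…AxiomsDoNotForceSchanuel` | PROVED mechanism + COND(`baysKirby2018_modelsWithoutSchanuel`) | Zilber's other axioms + quasiminimality/categoricity do not force SP (`𝔹_P` models); kernel relation `P(exp 1, τ)=0` kills SP |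
| B9 | `…SchanuelPropertyNotFirstOrder` | PROVED | SP is not first-order: ultrapower `ℂ^ℕ/𝒰 ≡ ℂ_exp` violates SP; Strong Schanuel Conjecture FALSE; no transfer/compactness proof |
| L1 | `…not_smallTrdeg_thm_2_9` | PROVED | the first rendering `smallTrdeg_thm_2_9` of LNM 1752 Ch.14 Thm 2.9 (no `d, ℓ ≥ 1`) is FALSE at `d = ℓ = 0`; use `smallTrdeg_thm_2_9_pos` |
| L2 | `…NesterenkoConjecture_1_11_false` | PROVED | Nesterenko's Conjecture 1.11 VERBATIM is false at `τ = ρ` (`Q(q) = E₄(ρ) = 0`); use `NesterenkoConjecture_1_11_corrected` |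
| R1 | `stmt-Schanuel-6844` `PolarPhantoms.PolarSchanuel` | REFUTED (substantive) | exp-free "cheap exact certificates on Roy boxes at every trdeg `< n` point" dies by specialisation collapse (`π ↦ 0`) |
| R2 | `stmt-Schanuel-6846` `PolarPhantoms.PhantomsAreTraceless` | REFUTED (substantive) | specialisation phantoms with a trace at `y=(1,e), α=(e,1)`; `s₀ < t₀+t₁` in Roy's window |
| S1–S4 | route closures: `EclCore` (reduction-proved), `ToricPeriods` (absorbed), `Zilber` (not-a-thesis), 15 D-0027 retirements | CLOSED | reformulations `X ⟺ Schanuel` / `X ⊇ Schanuel` are not theses; assemblies must conclude the Statement |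
| C1 | crux `RoyThesis`/`RoyThesisTyped` (`stmt-0078/0463`) + `SchanuelTwo` (`stmt-0069`) | negative lemmas | every hypothesis of Roy's criterion load-bearing; conclusion `n` sharp; diagonal-rung ladder = costume; `∃ᶠ N` weakening calibrated |
| C2 | support `RoySmallValueDirichletGap` (`stmt-1050`) | negative lemmas | edge `ν = 2+β−τ` cannot be lowered; `η ≠ 0`, `1 ≤ τ`, `∀ᶠ D`, count `3⌊D^τ⌋` all load-bearing; windows of scales insufficient; Darboux criterion |
| C3 | crux `ApproximationProperty` (`stmt-6117`) | negative lemmas | `1 ≤ t`, `trdeg ≤ t` load-bearing; constant not uniform in `θ`; scale-exponent form false (Liouville); exponent sharp; lever `OrbitClusterBound` needs injectivity + spanning, `c₀ ≤ 1` |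
| C4 | support `EPiSimultaneousType` (`stmt-6118`) / `…Ev` (`stmt-14975`) | negative lemmas | window `1/2 ≤ a < 1` (≥1/2 modulo AP2 / Bugeaud; unconditional in degree aspect); height clause, common-field clause load-bearing; no uniform-in-point shape |
| C5 | support `KhovanskiiApproxType` (`stmt-6116`) / crux `…Ev` (`stmt-14972`) | negative lemmas | `2 ≤ n`, `LinearIndependent`, Khovanskii system load-bearing; `a < 1/n` sharpening FALSE at `n=2` (conjugation trick); constants not uniform; Dirichlet floors `A ≥ 1`, `μ ≥ m` |
| C6 | crux `AclSubsetLogFreeCore` (`stmt-0968`) | negative lemmas | finiteness, parameter-freeness, `exp`-closure load-bearing; branch indiscernibility FALSE (Kummer parity); countable variant / `Def_∅(ℝ)` SC-false; (A) ⟺ `acl(∅)=C_EA` ⟺ `dcl(∅)⊆C_EA`; not soft |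
| C7 | crux `MinimalCounterexampleInAcl` (`stmt-0969`) | negative lemmas | `trdeg < n` (not `≤`), LI, first-failure hypotheses load-bearing in every stub; crux ⟸ Schanuel (irrefutable short of a counterexample); open content = first-failure sparsity |
| C8–C10 | cruxes `SchanuelOnLogFreeCore` (`0970`), `SparsityTwo` (`0971`), `SchanuelTwo` (`0069`) | workfile findings | all three are theorems OF Schanuel (no unconditional kill); refuted strengthenings and tightness recorded |
| B10 | `…SpecialisationCollapseBarrier` (gen 2) | PROVED | every exp-free "certificate at all points of trdeg `< n`" thesis on Roy's box whose certificate notion is specialisable (W2a) and refutes small rational value-columns (W2b) is FALSE for every `n ≥ 2` (place `X ↦ 0` at `y = (π^{j+1})`, `α = (1+π^{j+1})`); the only door in tree (archimedean certificates) is Roy's criterion = the summit |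
| B11 | `…AxLocalDerivationsBlind` (gen 2) | PROVED | at a FIRST FAILURE of Schanuel every derivation of `ℂ` exponential on the tuple kills the tuple: Ax's Theorem 3 instantiated at the counterexample itself (any derivations) is vacuous — closes B7's escape (b) |
| B12 | `…AxSchanuelFunctionalNotNumericalNarrow` (gen 2; narrows B7) | PROVED | B7 bars exactly the exponential-field-UNIFORM arguments (`FunctionalDerivationOfSchanuel ↔ ∀ F, SP F`) and Ax at the four classical pairs for ALL derivations; functional transcendence + differential algebra + arithmetic (Nesterenko) PROVE residue points (`(πi, π)`), so those tags are not barred as ingredients |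
| H1–H3 | strong-hypothesis registry (`Literature/StrongHypotheses/Schanuel.lean`) | landed bridges | `ZilberConjecture → Schanuel`, `ToricPeriodConjecture ↔ Schanuel`, `RoyCriterionAll ↔ Schanuel`: a crux implied cheaply by one of these is flagged by the tribunal kernel (T1); a crux equal to one is the summit or more |
| S5 / E1–E6 | status snapshot 2026-08-17 + landed equivalences `X ↔ Schanuel` | structural | `PiFreeOverLWField ∧ RelSchanuelOverPiLWField ↔ S`, `RankLeTrdeg ↔ S`, `RoyThesisTyped ↔ S`, `ComputableSchanuel`-with-supports `↔ S`, `NomeTransferWithoutEnvelope ↔ S`, `RecursiveSchanuel`/`OffPrimeLogSector` residual conjuncts: joint splits equivalent to S must NAME the attacked conjunct and declare the residual |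
| C11 | crux `TateLocusGPCOne` (`stmt-17406`, route `TateNomes`) | negative lemmas | = André's GPC for the non-CM Tate 1-motive point by point (`dim G_mot = 5`, no slack): non-quadratic `τ`, `Im τ > 0` (convergence!), and each of the six generators load-bearing; `6 ≤` false; CM value is exactly 3 |
| C12 | crux `NomeHygiene` (`stmt-17298`, PROVED) | negative lemmas | `k = 0` (no enlargement) FALSE by the cubic trap; `k ≤ 2` FALSE (`n = 0` needs 3); LI and the `exp`-algebraic option load-bearing; shift coincidences along an ALGEBRAIC direction are not finite |
| C13 | crux `NomeTransfer` (`stmt-17405`, PROVED) | negative lemmas | threshold `n + k + 3m` of the bookkeeping core is SHARP (Nesterenko at `q = 1/2`); envelope hypothesis dropped ⇒ literally Schanuel; any sharpening of the constant must use modular relations among `P, Q, R` |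
| C14 | crux `CountingGapHigher` (`stmt-16237`, route `RelationCounting`) | negative lemma | Jacobian criterion: a counted point (`k+2` integer relations with `ℂ`-independent gradients, trdeg defect) REFUTES Schanuel, so `Schanuel ⟹ crux` (counted sets empty): kill criterion (i) is settled negative, the crux is irrefutable short of `¬SC` |
| C15 | crux `TwistedSymmetry` (`stmt-17222`, route `TwistedConjugacy`, draft) | negative lemmas | any twist `σ(e^z) = e^{μσz}` is forced (`σ(2πi) = 2πi/μ`, `σ e = e^μ`, fixes `e^π`), is neither `id` nor `conj`, is discontinuous and NON-MEASURABLE; `μ` a root of unity trivialises it: Denis's continuous char-`p` twist has no tame char-0 analogue |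

---

## 1. Literature barriers (technique-class no-goes; `lean/Literature/Barriers/Schanuel/`)

All twelve catalogue declarations below (the nine of generation 1 and B10–B12 appended after L2) are `def <Name> : Prop` carrying the `BARRIER (D-0021)` block in their docstring (the gate indexes
barriers by that declaration) and each has a sorry-free discharge `*_holds` in tree. Cite them as `Literature.Barriers.Schanuel.<Name>`.
Three groups: **strength markers / scope of the classical methods** (B1–B6: what a century of transcendence methods outputs, and why the
summit lies beyond each output), **soft-method no-goes** (B7–B9: functional, axiomatic, first-order derivations of the Schanuel property are
refuted by explicit models), **refuted printed renderings** (L1–L2: traps when citing); generation 2 adds the **harvested refutation** B10 (R1 as a theorem for every rank), the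
**first-failure no-go** B11 and the **narrowing** B12 of B7, plus the strong-hypothesis registry §1′.

### B1 · `AlgebraicIndependenceOfLogarithms` — Schanuel contains the conjecture of algebraic independence of logarithms; the Gel'fond–Schneider–Baker method and the linear subgroup theorem deliver linear independence / half the structural rank
* **Decl / file / status.** `Literature.Barriers.Schanuel.AlgebraicIndependenceOfLogarithms := Schanuel → AlgIndepLogarithms`
  (`AlgebraicIndependenceOfLogarithms.lean`), PROVED (`algebraicIndependenceOfLogarithms_holds = algIndepLogarithms_of_schanuel`).
  `AlgIndepLogarithms` := `ℚ`-linearly independent logarithms of algebraic numbers (finite families) are algebraically independent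
  [Waldschmidt2005 Conj. 1.1; Pila2022 Conj. 13.5] — OPEN.
* **Exact content.** Any proof of the summit proves `AlgIndepLogarithms`, hence: two algebraically independent elements of
  `𝓛 = exp⁻¹(ℚ̄)` (`algebraicIndependent_piI_log_two_of_algIndepLogarithms`: `πi ⊥ log 2`; "it is not even known whether there exist two
  elements of `L` algebraically independent", Roy 1992 p. 22), the transcendence of `e^{π²}` (`transcendental_exp_pi_sq_of_algIndepLogarithms`;
  open, Waldschmidt 2005 §8.1), `structuralRank M = rank M` for every matrix over `𝓛` (`algIndepLogarithms_predicts_rank_eq_structuralRank`),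
  in particular the four exponentials conjecture. The technique class whose OUTPUT is `ℚ̄`-linear independence (Baker, tree fact
  `Literature.NumberTheory.Transcendental.baker`) or rank lower bounds `r ≤ s ≤ 2r` (`roy1992_strongSixExponentials`,
  `roy1995_structuralRank_le_two_mul_rank`, named facts) stops short: "Corollary 1.3 gives the best upper bound one can expect to deduce from
  Theorem 1.2 … since this theorem says nothing about the elements of `M_{2r,2r}(𝓛)` of rank `r`" (Roy 1995 §1 Rem. (ii)).
* **Kills.** Routes that would obtain the summit (or `AlgIndepLogarithms`, four exponentials, `e^{π²}`) as a CONSEQUENCE of linear forms in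
  logarithms / six-exponentials / LST rank bounds alone. A route whose cruxes are all of linear-independence or half-rank shape cannot close.
* **Escape / evasions known.** None published for two algebraically independent logarithms. Partial: strong six exponentials, quadratic
  relations via LST (Waldschmidt 2005 Thm 2.11, Cor. 2.12–2.14), Diaz's conjugation examples; reformulations: Roy's `X(𝓛)` / `4 × 4`
  skew-symmetric reduction (Roy 1995 Conj. 2.6), Roy's arithmetic criterion `Literature.NumberTheory.Transcendental.Roy2001_iff` (PROVED
  equivalence, the basis of route `RoyCriterion`); analogues proved elsewhere: Ax (functional), Papanikolas (Drinfeld modules).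
* **Scope caveats.** No impossibility THEOREM for the class is printed — this is a strength marker (state of the art), the formal no-go for the
  linear-embedding method being B2. `AlgIndepLogarithms` is stated for finite families over `ℚ`.
* **Threatens.** Cited (evasion claimed) by 21 of the 23 open routes — every route except `CyclotomicRigidity`, `GaussianStokesSector`. Any new
  route must say where its two algebraically independent logarithms (or its non-linear output) come from.

### B2 · `LinearSubgroupMethodLimit` — Roy's no-go for the linear subgroup theorem via linear embeddings (Roy 1995 Thm 3.4)
* **Decl / file / status.** `Literature.Barriers.Schanuel.LinearSubgroupMethodLimit := roy1995_thm_3_4` (`LinearSubgroupMethodLimit.lean`),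
  PROVED (`linearSubgroupMethodLimit_holds`, Roy's proof formalised in `LinearSubgroupMethodLimitProofs.lean`; also
  `waldschmidt1981_linearSubgroup_matrix_holds` in `…Holds.lean` from the tree's Waldschmidt 1981 Thm 2.1).
* **Exact content.** A `d × ℓ` matrix with entries in the `ℚ`-span of three `ℚ̄`-linearly independent numbers and `ℚ`-independent rows and
  columns has `4r ≥ d + ℓ`, hence `r(d+ℓ) ≥ dℓ` (`not_lstHypothesis_of_roy1995_thm_3_4`, unconditional `not_lstHypothesis`): the entrance
  condition `LSTHypothesis d ℓ r := r(d+ℓ) < dℓ` of Waldschmidt's Theorem 1.2 (`waldschmidt1981_linearSubgroup_matrix`) is NEVER met by the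
  image of a point of `X(𝓛)` under a `ℚ`-linear local embedding `X → M_{d,ℓ}(r)` when `X ⊆ K³` is a homogeneous surface of degree `≥ 2`.
* **Kills.** A proof BY THIS METHOD (LST + linear embeddings into determinantal varieties) of `AlgIndepLogarithms` on any such surface, in
  particular of the four exponentials conjecture (`X = {xy = z²}`); "this method … cannot lead to a proof of the four exponentials
  conjecture" (Roy 1995 §3.2 p. 65).
* **Escape.** Apply transcendence machinery to `X` directly (Roy 1995 Thm 4.1: auxiliary exponential polynomial small on `X(𝓛)` — "calls for
  a zero estimate which would be sufficiently precise"); Grassmannian cones `G(k, V)`, `dim V ≥ k+2`, where the embedding method succeeds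
  (Thm 2.1) reducing everything to `4 × 4` skew-symmetric matrices of rank `≤ 2` (Conj. 2.6); methods using derivatives (Gel'fond–Baker),
  Roy's later small-value estimates; `Roy2001_iff`.
* **Scope caveats.** Concerns Theorem 1.2 + linear local embeddings + homogeneous surfaces in `K³` only.
* **Threatens.** `LogPatterns` (PatternG2/LogSector), `GeodesicRealLogs` (RealGP3, FlatLatticeLogs), `MatrixCoefficients` (MatrixCoefficientThree,
  SparseVanishing), `ToricSector`, `DilateIntersection`, `PowerMapCalibration`, `AdelicLogSector`, `BenfordTowers`, `CapacityLadder`,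
  `AlgIndepMethod`, `MisiurewiczField`, `SheetDescent`, `RoyCriterion` (13 open routes cite it).

### B3 · `LargeTranscendenceDegree` — beyond trdeg 2 the several-variables Gel'fond–Schneider method reaches `≈ dℓ/(ℓ+d)` and needs the Technical Hypothesis (Diaz 1989 = LNM 1752 Ch. 14 Thm 2.7)
* **Decl / file / status.** `Literature.Barriers.Schanuel.LargeTranscendenceDegree` (alias `diaz1989_largeTrdeg`; `LargeTranscendenceDegree.lean`),
  PROVED (`LargeTranscendenceDegree_holds`, `LargeTranscendenceDegreeHolds.lean`, via `largeTranscendenceDegree_of_nesterenko` and the tree's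
  discharges of LNM 1752 Ch. 3 Props 4.4/4.11/4.13 — Philippon criterion + zero estimate + Diaz Thms 1, 2).
* **Exact content.** For `x : Fin d → ℂ`, `y : Fin ℓ → ℂ` `ℚ`-linearly independent, BOTH satisfying `TechnicalHypothesis` (a measure of linear
  independence), `ℓ + d < dℓ`: `[dℓ/(ℓ+d)] ≤ trdeg ℚ(e^{xᵢyⱼ})`, `[d(ℓ+1)/(ℓ+d)] ≤ trdeg ℚ(x, e^{xᵢyⱼ})`, `⌈dℓ/(ℓ+d)⌉ ≤ trdeg ℚ(x, y, e^{xᵢyⱼ})`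
  (fields `gridField ⊆ gridField₁ ⊆ gridField₂`). Unconditional frontier: `smallTrdeg_thm_2_9_pos` (Thm 2.9, PROVED: `t₂ ≥ 2` for `dℓ > ℓ+d`;
  `smallTrdeg_thm_2_9_two_two` for `d = ℓ = 2` with two algebraic exponentials) — "the only known results which do not require a Technical
  Hypothesis". The method's own conjectural target is `WaldschmidtConjecture_2_3` (OPEN; it already implies the four exponentials conjecture,
  `fourExponentialsConjecture_of_waldschmidtConjecture_2_3`), against the summit's `t₂ ≥ dℓ` on the same data (`cartesianSchanuel_of_schanuel`,
  `waldschmidtConjecture_2_3_of_schanuel`).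
* **Kills.** The several-variables route to the summit (thesis `CartesianSchanuelThesis` of `AlgIndepMethod`/`CapacityLadder`, `t₂ ≥ dℓ`) beyond
  the printed reach: any crux claiming `t ≥ 3` WITHOUT a technical hypothesis, or an exponent above `dℓ/(ℓ+d)`, by auxiliary function + zero
  estimate + criterion, claims more than the method has ever delivered; the Gel'fond–Schneider ladder `log α, α^β, …, α^{β^{d−1}}` is reached
  only up to `[(d+1)/2]` (Cor. 2.8).
* **Escape.** Tijdeman-type sharper analytic zero estimates removed (T.H.) for SMALL trdeg; Brownawell's effective Nullstellensatz weakens (T.H.);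
  "much sharper estimates are valid for concrete applications" (algebraic `xᵢ = β^{i−1}`); the conjecture on simultaneous approximation "is the
  missing link for large transcendence degree" (Waldschmidt 2004) — the lever of route `DiophantineDichotomy`; `Roy2001_iff`.
* **Scope caveats.** No printed impossibility theorem; nothing excludes a new zero estimate removing (T.H.). Stated for generated fields
  (general `K ⊇` by `trdeg_mono`). Do NOT cite `smallTrdeg_thm_2_9` (L1).
* **Threatens.** `AlgIndepMethod` (GelfondDiazLadderFull `stmt-0085`, AlgindepLadderLe3OfDiaz `stmt-0426`, LargeTrdegWithoutTH `stmt-10491`,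
  CartesianSchanuelThesis `stmt-0089`), `CapacityLadder` (SchanuelOnNumberFieldLines/QuadraticLines `stmt-12134/12135`, ETowerAlgIndep `stmt-12136`),
  `DiophantineCore` (THOnExpAlgebraic `stmt-3815`, SchanuelUnderTH `stmt-3816`), `DilateIntersection`, `CoprimeExpPolynomials`, `DiophantineDichotomy`,
  `PowerMapCalibration`, `RoyCriterion` and 9 more (17 open routes cite it).

### B4 · `EFunctionValuesAtAlgebraicPoints` — the `E`-function method lives at algebraic arguments (Siegel–Shidlovskii)
* **Decl / file / status.** `Literature.Barriers.Schanuel.EFunctionValuesAtAlgebraicPoints := siegelShidlovskii_algIndep`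
  (`EFunctionValuesAtAlgebraicPoints.lean`), PROVED (`EFunctionValuesAtAlgebraicPoints_holds`, `…MainProofs.lean`, through
  `shidlovskii_rankBound_holds` = Rivoal Thm 5.20 and `siegelShidlovskii_algIndep_of_rankBound`; ~30 supporting files `EFunctionValuesAtAlgebraicPoints*.lean`).
* **Exact content.** For strict `E`-functions `F₁, …, Fₙ` (`IsStrictEFunction`) with `Y′ = AY`, `A ∈ M_n(ℚ̄(z))`, and `(z, F₁, …, Fₙ)` algebraically
  independent over `ℚ̄`, the values at an ALGEBRAIC `α` with `αT(α) ≠ 0` are algebraically independent over `ℚ̄` (Rivoal 2024 Thm 5.10 = Baker Thm 11.1).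
  `exp_one_mem_eValues`: the method proves Hermite / Lindemann–Weierstrass (`α = 1`). The summit implies the transcendence of `e + π`, `eπ`, `e^e`
  and the independence of `e, e^e` (`transcendental_exp_add_pi_of_schanuel`, `…_exp_mul_pi_…`, `algebraicIndependent_exp_expExp_of_schanuel`), numbers
  printed as believed NOT to be `E`- or `G`-values at algebraic points (conjectural named statements `ExpAddPiNotEValue`, `ExpMulPiNotEValue`,
  `ExpExpNotEValue`, `PiPowExpNotEValue`).
* **Kills.** Instances of the summit with non-algebraic arguments — `x = (1, πi)` (`e ⊥ π`, `e+π`, `eπ`), `x = (1, e)` (`e ⊥ e^e`), `π^e` — as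
  outputs of Siegel–Shidlovskii / Beukers–André refinements ("il est donc malheureusement probable qu'aucun des théorèmes diophantiens cités ici
  … ne s'applique à ces nombres", Rivoal 2024 p. 226). What it reaches: the algebraic-argument (Lindemann–Weierstrass) layer of Schanuel.
* **Escape.** `G`-functions for `ζ(5)`, `G`, `Γ(1/5)⁵` (values at algebraic points); Thm 5.11-type disjunctions ("`γ` or `δ` is transcendental");
  anti-`E`-functions / Stokes data (route `GaussianStokesSector`'s bet) are outside the formalised class but must supply their own transfer theorem.
* **Scope caveats.** The exclusion of `e+π, eπ, e^e, π^e` from `E`-values is a printed BELIEF, not a theorem; only the `E`-half is formalised.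
* **Threatens.** `GaussianStokesSector` (PiFreeOverGaussianEValues `stmt-13739`, MixedTripleIndependent `stmt-13740`, AntiEValueTranscendental
  `stmt-13747`), `CyclotomicRigidity` (LWWithPi `stmt-5986`), `ExceptionalSubspaces`/`GaussianStokesSector` (PiFreeOverLWField `stmt-9545`,
  RelSchanuelOverPiLWField `stmt-9548`), `CoprimeExpPolynomials`, `DiophantineCore`, `DiophantineDichotomy`, `ToricSector`, `RoyCriterion`.

### B5 · `NesterenkoModularScope` — the modular method outputs `trdeg ℚ(q, P(q), Q(q), R(q)) ≥ 3` at a single point; `(e, π)` is printed as out of reach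
* **Decl / file / status.** `Literature.Barriers.Schanuel.NesterenkoModularScope := nesterenko1996_thm_1_1` (`NesterenkoModularScope.lean`),
  PROVED (`NesterenkoModularScope_holds`, `NesterenkoModularScopeHolds.lean`; ~70 supporting files: Ramanujan system, multiplicity estimate,
  Ch. 3 §4 elimination toolkit, Ch. 10 Prop. 3.6 transfer; both printed routes on the core {P4.4, P4.11, P4.13}, `…Routes.lean`). Consequences
  in tree: `Literature.NumberTheory.Transcendental.nesterenko` (`π, e^π, Γ(1/4)` alg. independent), `algebraicIndependent_pi_exp_pi`.
* **Exact content.** For every `q` with `0 < |q| < 1`, `trdeg ℚ(q, P(q), Q(q), R(q)) ≥ 3` (Ramanujan's `P, Q, R = E₂, E₄, E₆`). Corollaries at CM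
  points only: `π, e^{π√d}` (Cor. 1.7), `π, e^π, Γ(1/4)` (Cor. 1.2). `expOnePiAlgebraicIndependent_of_schanuel`: the summit gives `e ⊥ π`
  (`Literature.NumberTheory.Transcendental.ExpOnePiAlgebraicIndependent`, OPEN: "even the very simple consequence that `e` and `π` are
  algebraically independent is unknown", Bays–Kirby 2018 §1.1).
* **Kills.** Consequences of the summit outside that one-point output claimed FROM the modular method: `e ⊥ π`; four algebraically independent
  numbers among `τ, q, P, Q, R` for non-CM `τ` (`NesterenkoConjecture_1_11`, OPEN — and its VERBATIM printed form is false, L2); the four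
  exponentials conjecture by `j` ("A method to solve these conjectures remains to be found!", LNM 1752 Ch. 2 §4).
* **Escape.** Philippon's `K`-functions, the Mahler-type method (transcendence of `J(q)`), approximation properties in place of criteria (Ch. 4 §4 —
  route `DiophantineDichotomy`), Bertrand's `θ(τ, z)` conjecture merging modular and exponential sides, (CDB) ⟹ (C4EW); `Roy2001_iff`.
* **Scope caveats.** No printed impossibility theorem; nothing excludes a modular/`K`-function argument at other points or with more functions.
* **Threatens.** `AlgIndepMethod`, `CapacityLadder`, `CoprimeExpPolynomials`, `DiophantineCore`, `GaussianStokesSector`, `RoyCriterion` (route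
  `DiophantineDichotomy`'s support `EPiRace`/`EPiSimultaneousType` is the `(e, π)` instance itself, §4 C4).

### B6 · `PeriodConjectureOverQbarScope` — the period conjectures over `ℚ̄` reach `𝓛`, not `e`
* **Decl / file / status.** `Literature.Barriers.Schanuel.PeriodConjectureOverQbarScope` (`PeriodConjectureOverQbarScope.lean`), PROVED
  (`periodConjectureOverQbarScope_holds`; toric proofs in `ToricPeriodConjectureQbarProofs.lean`).
* **Exact content (conjunction).** (i) `ToricPeriodConjectureQbar` (Grothendieck's period conjecture for all toric 1-motives over all algebraic
  `k ⊆ ℚ̄`) ⟺ `AlgIndepLogarithms` (`toricPeriodConjectureQbar_iff_algIndepLogarithms`); (ii) their periods lie in `𝓛 = logQSpan = exp⁻¹(ℚ̄)`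
  (`periodSet_subset_logQSpan`); (iii) `𝓛` is countable; (iv) `(1, 2πi)` is `ℚ`-free but `1 ∉ 𝓛` (Hermite: `one_not_mem_logQSpan`,
  `not_forall_one_twoPiI_mem_logQSpan`); (v) `ExpTranscendentalOverPeriodField → ExpOneNotPeriod`; (vi) over ARBITRARY `k ⊆ ℂ` the same conjecture
  for the same motives ⟺ Schanuel (tree `Literature.NumberTheory.Transcendental.toricPeriodConjecture_iff_schanuel_holds`, André `(?!)`, Bertolin Cor. 1.3).
* **Kills.** Deriving the summit — already `e ⊥ π` — from the period conjectures over `ℚ̄` (Grothendieck / Kontsevich–Zagier) or theorems toward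
  them: that sector is exactly `AlgIndepLogarithms`, a statement about the countable `𝓛 ∌ 1`; "these conjectures (conjecturally) do not imply SC
  as, conjecturally, `e` is not a period" (Pila 2022 §13.6).
* **Escape.** André's generalised period conjecture `(?!)` over arbitrary `k` (= Schanuel for 1-motives without abelian part — but then it IS the
  summit: route `ToricPeriods` was closed `absorbed`, S2); exponential periods / exponential motives (Fresán), for which `e^α` is a period — "A period
  conjecture in the style of `(??)` may hold for them."
* **Scope caveats.** The non-implication itself is conjectural (conditional on `ExpOneNotPeriod`, open); proved is the toric bookkeeping (i)–(iv), (vi).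
* **Threatens.** `AdelicLogSector` (p-adic periods; TransferModP `stmt-7088`), `BenfordTowers`, `LogPatterns`, `GeodesicRealLogs`, `GaussianStokesSector`,
  `MatrixCoefficients`, `RoyCriterion`.

### B7 · `AxSchanuelFunctionalNotNumerical` — Ax–Schanuel is a theorem of EVERY exponential field; functional transcendence does not force the Schanuel property and is silent on `ecl(∅) ∋ e, π, log 2`
* **Decl / file / status.** `Literature.Barriers.Schanuel.AxSchanuelFunctionalNotNumerical` (`AxSchanuelFunctionalNotNumerical.lean`), PROVED
  (`axSchanuelFunctionalNotNumerical_holds`; on top of the tree's PROOFS of Ax 1971 Thm 3 `Literature.NumberTheory.Transcendental.ax_schanuel_holds`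
  (via Rosenlicht) and Kirby 2010 Thms 1.1–1.2, Prop. 7.2).
* **Exact content (conjunction).** (i) Kirby's weak SP (`δ(x̄/C) ≥ 0` over `ecl`-closed `C`) holds in every exponential field of char 0
  (`Kirby2010_weakSchanuel_holds_type0`); (ii) hence the explicit class `FunctionalDerivationOfSchanuel` ("weak SP ⟹ SP") is REFUTED
  (`not_functionalDerivationOfSchanuel`, witness: trivial `exp = 1` on `ℚ`), and so is its enlargement by all of Zilber's other axioms
  `FunctionalSoftDerivationOfSchanuel` (`not_functionalSoftDerivationOfSchanuel`, COND(`baysKirby2018_modelsWithoutSchanuel`)); (iii) every E-derivation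
  vanishes on `ecl ∅` (`eDerivation_apply_eq_zero_of_mem_ecl_empty`), so Ax's hypothesis "`ℚ`-linearly independent modulo the constants" FAILS for any
  tuple meeting `ecl ∅` (`not_isQLinearIndependentMod_of_mem_ecl_empty`); (iv) the residue of the summit is exactly SP restricted to tuples from
  `ecl ∅` (tree `Periods.schanuelConjecture_iff_ecl_empty_holds`, Kirby Prop. 7.2) — over a COUNTABLE set (`ecl_empty_countable`); (v) which contains
  the classical open pairs `(1, πi)`, `(1, e)`, `(log 2, √2 log 2)`, `(πi, log 2)` (`classicalPairs_mem_ecl_empty`).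
* **Kills.** Any argument deriving `SchanuelProperty ℂ` (or `e ⊥ π`, `e ⊥ e^e`, `log 2 ⊥ 2^{√2}`, `π ⊥ log 2`) from Ax–Schanuel / o-minimal functional
  transcendence / predimension arguments ALONE; any use of Ax's Theorem 3 with `Δ` a family of E-derivations on a tuple meeting `ecl ∅`. The closed
  route `EclCore` recorded the same reduction as its thesis (S1).
* **Escape.** Numerical Schanuel statements at exponentially TRANSCENDENTAL parameters: `baysKirbyWilkie2010_thm_1_2` (named fact: `td(exp x̄, exp(λx̄)/λ) ≥ n`
  for `λ ∉ ecl ∅`), generic powers (Pila 2022 p. 96) — "one does not know any explicit `λ`"; properties of `ℂ_exp` beyond Thm 1.2 + Zilber's axioms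
  1, 2, 4, 5 + quasiminimality: ARCHIMEDEAN / ANALYTIC structure, arithmetic of specific elements of `ecl ∅`; Ax's theorem with arbitrary (non-E-)
  derivations satisfying `D zᵢ = zᵢ D yᵢ` on the tuple only is NOT excluded.
* **Scope caveats.** No printed meta-theorem on "functional methods" in general; refuted are exactly the two explicit classes and the E-derivation
  instances of Ax's hypothesis.
* **Threatens.** `RigidCore` (SchanuelOnLogFreeCore `stmt-0970`: the barrier applies to it verbatim — `eDerivation_apply_eq_zero_of_mem_core` in its
  Disproof.lean; MinimalCounterexampleInAcl `stmt-0969` lives inside `ecl ∅` by `firstFailure_mem_ecl`), `ExpMordellWeil` (exponential-derivations /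
  Ax–Schanuel / unit theorem: TransversalFiniteRank `stmt-3487`, ExpMordellWeilFG `stmt-3489`), `SheetDescent` (o-minimal counting, Ax–Schanuel:
  SlidingRigidity `stmt-13674`), `MisiurewiczField`, `DiophantineCore` (linear-form separation ON `ecl`), `CyclotomicRigidity`, `RecursiveCore`,
  `ArithmeticalComplexity`, `PowerMapCalibration`, `BenfordTowers`, `CapacityLadder`, `MatrixCoefficients`, `RoyCriterion`.

### B8 · `AxiomsDoNotForceSchanuel` — Zilber's other axioms, categoricity and quasiminimality do not force the Schanuel property (Bays–Kirby 2018 §9.2)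
* **Decl / file / status.** `Literature.Barriers.Schanuel.AxiomsDoNotForceSchanuel` (`AxiomsDoNotForceSchanuel.lean`), `axiomsDoNotForceSchanuel_holds`
  PROVED as a conjunction of (i) the unconditional MECHANISM and (ii) an implication from the single named fact
  `baysKirby2018_modelsWithoutSchanuel` (Bays–Kirby Thm 1.7 + Thm 8.2 + §9.2; reduced in `AxiomsDoNotForceSchanuelProofs.lean` to the `𝕄(F_base)`
  construction over the §9.2 base built inside `ℂ`; faithfulness of `IsAdmissibleRelation` settled in `AxiomsDoNotForceSchanuelGenericZero.lean`).
* **Exact content.** (i) In every exponential field of char 0, a kernel element `τ` (`exp τ = 1`), transcendental and algebraically dependent with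
  `exp 1` via some `P ≠ 0`, makes SP fail (`not_schanuelProperty_of_kernel_relation`). (ii) For every admissible `P` Bays–Kirby's quasiminimal field
  `𝔹_P` of cardinality `𝔠` satisfies axioms 1, 2, 4 (Kirby's linear-independence form `IsLinIndepExpAlgClosed`), 5, CCP, quasiminimality and
  `P(exp 1, τ) = 0`; hence the explicit class `SoftDerivationOfSchanuel` (SP of `ℂ_exp` from: ELA-field of size `𝔠`, standard kernel, EAC in the
  linear-independence form, CCP, quasiminimality / categoricity) is REFUTED (`not_softDerivationOfSchanuel`, `exists_isSoftZilberField_not_schanuelProperty`,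
  `not_forall_isSoftZilberField_schanuelProperty`).
* **Kills.** Route `Zilber` as a PROOF of the summit (closed not-a-thesis, S3): establishing EAC/SEAC, CCP, standard kernel, quasiminimality for `ℂ_exp`
  does not yield SP; "prove SC easily by showing `ℂ_exp ≅ 𝔹` because `𝔹` is categorical" — no: `ℂ_exp ≅ 𝔹 ⟺ Schanuel ∧ SEAC` (Bays–Kirby Thm 1.4)
  and quasiminimality already follows from EAC (`Literature.NumberTheory.Transcendental.isQuasiminimal_of_isExpAlgClosed`). Specialised to rank 2:
  `SchanuelTwo` fails in a soft Zilber field (`exists_isSoftZilberField_not_schanuelTwoIn`, §5 C10).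
* **Escape.** Properties of `ℂ_exp` beyond the axiom list: analytic / archimedean structure; SP restricted to `ecl ∅`; the GENERICITY form of strong
  EAC (`Literature.IsStronglyExpAlgClosed ℂ`) is not formally refuted (Kirby's equivalence of the two forms uses SP, which fails in `𝔹_P`); relative /
  generic Schanuel over a closed base from Ax.
* **Scope caveats.** The printed no-go sentence is informal ("soft methods which ignore transcendental number theory and analytic considerations cannot
  hope to work"); conjunct (ii) is conditional on the named fact (amalgamation + excellence, §§3–8, not formalised).
* **Threatens.** `RigidCore` (AclSubsetLogFreeCore `stmt-0968`: its line `eac-extends-core-automorphisms` works under `IsZilberField ℂ`, whose doubling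
  base hypothesis at the empty tuple IS `SchanuelProperty ℂ` — `isStrong_doublingBase_nil_iff_schanuelProperty`, §4 C6), `CyclotomicRigidity`
  (TowerStrong `stmt-5989`, GalExtTower `stmt-5985`), `ExceptionalSubspaces` (KMOTwoExistential `stmt-9549`), `RecursiveCore`, `ExpMordellWeil`,
  `ArithmeticalComplexity`, `PowerMapCalibration`, `CapacityLadder`, `RoyCriterion`.

### B9 · `SchanuelPropertyNotFirstOrder` — the Schanuel property is not first-order; the Strong Schanuel Conjecture is false (Kirby–Zilber 2014 §2.1; Kirby 2018 §3)
* **Decl / file / status.** `Literature.Barriers.Schanuel.SchanuelPropertyNotFirstOrder` (`SchanuelPropertyNotFirstOrder.lean`), PROVED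
  (`schanuelPropertyNotFirstOrder_holds`; Mathlib first-order semantics, language `Language.expRing = (+, ·, −, 0, 1, exp)`).
* **Exact content (conjunction).** (i) `¬ StrongSchanuelConjecture` (`not_strongSchanuelConjecture`): not every exponential field elementarily equivalent
  to `ℂ_exp` has SP; (ii) the ultrapower `ℂ^ℕ/𝒰` is elementarily equivalent to `ℂ_exp` (Łoś, `ultrapower_elementarilyEquivalent`) and violates SP
  (`not_schanuelProperty_ultrapower_complex`); (iii) mechanism in every exponential field: a transcendental kernel MULTIPLIER `r ∈ Z(F)` and a non-zero
  kernel element `t` give the `ℚ`-free kernel triple `(rt, r²t, r³t)` of trdeg `≤ 2` (`not_schanuelProperty_of_transcendental_kernelMultiplier`, `kzTuple`);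
  (iv) under the summit, SP separates two elementarily equivalent exponential fields and no `expRing`-theory axiomatises it
  (`not_axiomatisable_of_schanuel`); (v) the same from Zilber's existence theorem (`not_axiomatisable_of_exists_isZilberField`).
* **Kills.** The strengthening SSC of the summit (REFUTED); any derivation of SP from first-order properties of `ℂ_exp` alone — transfer to / from
  elementarily equivalent or non-standard models, compactness, a first-order reading of Zilber's axiom 3; should the summit hold, any first-order
  characterisation of it.
* **Escape.** `L_{ω₁,ω}(Q)` axiomatisation (Kirby–Zilber); the relative "strong kernel" axiom 3′ `Δ_F(x̄) = td(x̄, exp x̄/ker) − ldim_ℚ(x̄/ker) ≥ 0`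
  (first-order iff CIT); SC "over the kernel" ⟺ SC for `ℂ_exp` because the kernel is cyclic with transcendental generator — but not in other fields.
* **Scope caveats.** Only the language `(+, ·, −, 0, 1, exp)`; nothing about `L_{ω₁,ω}(Q)`, o-minimal / real versions, or transfer of OTHER properties;
  (iv) conditional on the summit, (v) on `Literature.NumberTheory.Transcendental.exists_isZilberField_of_aleph0_lt`; the family `{rⁿt}` truncated to `n ≤ 3`.
* **Threatens.** `ArithmeticalComplexity` (ComputableSchanuel `stmt-4023`, DecidableCoreRelations `stmt-4025` — quantifier-complexity / arithmetisation
  lines must not pass through a first-order theory of `ℂ_exp`), `RigidCore` (definability cruxes `stmt-0968/0969`: `acl`/`dcl` are first-order objects,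
  but the cruxes use the STANDARD model only — fine, as long as no transfer is invoked), `CyclotomicRigidity`, `ExceptionalSubspaces`, `RecursiveCore`,
  `MisiurewiczField`, `CapacityLadder`, `RoyCriterion`.

### L1 · `not_smallTrdeg_thm_2_9` — refuted RENDERING (do not cite `smallTrdeg_thm_2_9`)
* `Literature.Barriers.Schanuel.not_smallTrdeg_thm_2_9 : ¬ smallTrdeg_thm_2_9` (`LargeTranscendenceDegree.lean`, PROVED; witness
  `smallTrdeg_thm_2_9_counterexample`): the first rendering of LNM 1752 Ch. 14 Thm 2.9 omitted the printed `d, ℓ ≥ 1` and is FALSE at `d = ℓ = 0`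
  (`trdeg_gridField_zero`). **Use** `smallTrdeg_thm_2_9_pos` (PROVED in tree, `…SmallTrdegProofs.lean`) and `smallTrdeg_thm_2_9_two_two`.
  Kills: nothing mathematical — a typing trap for routes importing the deprecated name (`DilateIntersection`, `GelfondTowers` cited `smallTrdeg`).

### L2 · `NesterenkoConjecture_1_11_false` — Nesterenko's Conjecture 1.11 is false AS PRINTED
* `Literature.Barriers.Schanuel.NesterenkoConjecture_1_11_false` (`NesterenkoModularScopeConjecture.lean`, PROVED): at `τ = ρ = e^{2πi/3}` the hypothesis
  holds trivially (`ρ` algebraic, `Q(e^{2πiρ}) = E₄(ρ) = 0`, so `trdeg ℚ(ρ, q, P, 0, R) ≤ 3`) while the printed conclusion "`q, P(q), Q(q)` algebraically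
  independent" fails. **Use** `NesterenkoConjecture_1_11_corrected` (OPEN conjecture; `nesterenkoConjecture_1_11_corrected_of_verbatim`,
  `three_le_trdeg_adjoin_of_thm_1_1`). Kills: conditional bridges "`NesterenkoConjecture_1_11 → …`" are bridges from `False`-adjacent text — restate on the
  corrected form; any crux quantifying over all `τ` with "`Q(q)` independent" must exclude the `SL₂(ℤ)`-orbits of `ρ` (and of `i` for `R`).

### AUDIT 2026-08-17 addenda to generation-1 entries (B1, B5, B7) — landed after generation 1, same declarations
* **B1 (`AlgebraicIndependenceOfLogarithms`) — structural rank.** `AlgebraicIndependenceOfLogarithmsRankProofs.lean` (PROVED): Roy's STRUCTURAL rank of a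
  matrix of logarithms (generic rank of the rational pencil `∑ mⱼ Lⱼ`) equals Waldschmidt's definition (`structuralRank_eq_iSup_rank_of_eq_sum_smul`,
  `structuralRank_eq_rank_iff_of_eq_sum_smul`), `AlgIndepLogarithms` predicts `rank = structural rank` (`algIndepLogarithms_predicts_rank_eq_structuralRank_holds`,
  `structuralRank_le_rank_of_algIndepLogarithms`) and so does Schanuel (`structuralRank_eq_rank_of_schanuel`). The converse "`r = s` for all log-matrices ⟹
  Conj. 1.1" is printed ONLY for HOMOGENEOUS varieties (Roy 1995 Cor. 3.2 / Remark p. 65 = Waldschmidt's Conj. 1.11): a route typed through the `ℚ`/`𝓛`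
  structural rank carries the homogeneous part of `AlgIndepLogarithms` and nothing inhomogeneous. Kills: "prove `r = s`, conclude algebraic independence of
  logarithms" without a homogenisation step. Escape: homogeneous algebraic relations, or an explicit inhomogeneous supplement.
* **B5 (`NesterenkoModularScope`) — WHY THREE, and why one point.** `NesterenkoModularScopeSeries{,Holds}.lean` (PROVED; Nesterenko–Philippon LNM 1752 Ch. 3):
  the criterion Thm 2.1 with Lemma 2.2's auxiliary sequence (`NesterenkoPhilippon2001_ch3_lemma_2_2_holds`: `λ(N) = N⁴`, `τ(N) = γ₀ N log² N`, so `λ/τ³ → ∞`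
  but not `λ/τ⁴`) outputs exactly `3 = #{z, P, Q, R} − 1`; the exponent `4` is the diagonal multiplicity of the Ramanujan system
  (`ramanujan_diagonal_multiplicity`, `ramanujan_multiplicity_max_pow_four`). TIGHTNESS, kernel-checked: a `k = 3` sequence (`λ/τ⁴ → ∞`) forces `trdeg ≥ 4`
  (`four_le_trdeg_of_sequence`), hence NO such sequence exists at any point with an algebraic coordinate (`not_exists_sequence_of_isAlgebraic`), at every
  algebraic `q` (`not_exists_sequence_of_isAlgebraic_q`, `trdeg_adjoin_ramanujanPoint_le_three_of_isAlgebraic{_q}`) and at `q₀ = e^{−2π}` (`R(q₀) = 0`,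
  `trdeg_adjoin_ramanujanPoint_exp_neg_two_pi`, `not_exists_sequence_exp_neg_two_pi`: behind `π, e^π, Γ(1/4)` the method's three IS the truth).
  Kills: "a fourth algebraically independent number at a transcendental non-CM `q` by an auxiliary construction valid for all `0 < |q| < 1`" (Lemmas 3.1–3.4
  are uniform in `q`; any `k = 3` input must FAIL at algebraic `q`); no addition theorem for `j` replaces the multi-orbit of the exponential method; (CDB)
  stays open. Threatens (new): `TateNomes` (`TateLocusGPC{,One}`, `MultiNomeNesterenko` — the route's own BARRIERS section concedes OUTPUT and bets on SCOPE),
  `SingularModulusScaling` (CM input at infinitely many singular moduli; it never invokes the one-nome output).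
* **B7 (`AxSchanuelFunctionalNotNumerical`) — see B11 (closes escape (b): Ax at the counterexample with arbitrary derivations) and B12 (narrows the refuted
  class to exponential-field-uniform arguments; residue points `ℚ̄`-tuples and `(πi, π)` are PROVED).**

### B10 · `SpecialisationCollapseBarrier` — exp-free certificate theses on Roy's box die by specialisation collapse, for every rank `n ≥ 2` (generation 2; harvests R1)
* **Decl / file / status.** `Literature.Barriers.Schanuel.SpecialisationCollapseBarrier` (`SpecialisationCollapse.lean`), PROVED (`specialisationCollapseBarrier_holds`,
  from `not_expFreeCertificateThesis_of_specialisable_of_refutesSmall`; inputs: `transcendental_pi_holds`, Roy's unconditional auxiliary polynomials at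
  `y' = 0` `Literature.NumberTheory.Transcendental.royHypothesis_exp'`, Roy 2001 §5 (2°)).
* **Exact content.** `∀ n ≥ 2, ∀ Cert : CertPred n, Specialisable Cert → RefutesSmall Cert → ¬ ExpFreeCertificateThesis n Cert`: for a certificate notion on
  the box values `(k, m) ↦ (D^k P)(∑ mⱼyⱼ, ∏ αⱼ^{mⱼ})` over Roy's box (`deg_{X₀} ≤ N^{t₀}`, `deg_{X₁} ≤ N^{t₁}`, height `≤ e^N`, window `RoyAdmissible`) that is
  (W2a) SPECIALISABLE — a certificate for `(V_{k,m}(ω))`, `ω` transcendental, `V_{k,m} ∈ ℚ[X]`, is one for `(V_{k,m}(0))` — and (W2b) REFUTES SMALL rational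
  columns `|w_k| ≤ e^{−N^u}` on `k ≤ N^{s₀}`, the thesis "at every point of `trdeg ℚ(y, α) < n` (`y` `ℚ`-free, `αⱼ ≠ 0`) some admissible parameter set certifies
  the whole box for infinitely many `N`" is FALSE. Witness: `yⱼ = π^{j+1}`, `αⱼ = 1 + π^{j+1}` (`trdeg = 1 < n`); the place `X ↦ 0` collapses the multi-orbit
  `(m·y, α^m)` onto the exponential point `(0, e⁰)`, where Roy's `P_N` are small (`not_frequently_cert_of_collapse` covers EVERY polynomial point with
  `Y(0) = 0`, `A(0) = 1`: multiplicative independence of `α`, `αⱼe^{−yⱼ} ∉ μ_∞`, "no algebraic coordinate" all keep the witness). Instance: `cheapExactCert`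
  (`cheapExactCert_specialisable`, `cheapExactCert_refutesSmall`, `not_expFreeCertificateThesis_cheapExactCert` = R1 rank by rank).
* **Kills.** Every exp-free "for all points of `trdeg < n`" certificate / exactness / phantom thesis in Roy's window with a certificate notion in the class
  (route `PolarPhantoms` R1 and any re-filing with extra hypotheses on the point that keep the collapsing polynomial points in scope); technique classes
  transference · polar-body · exact-certificate · cheap-rational-certificate · tracelessness · exp-free-roy-box-statements · transcendence-criterion-at-points ·
  roy-box-exactness.
* **Escape / the only door in tree.** Certificate notions violating (W2a) or (W2b): the ARCHIMEDEAN certificate (`archimedeanCert`: cheap complex `c` with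
  `|∑ c·v| ≥ 1`) satisfies (W2b) (`archimedeanCert_refutesSmall`) but NOT (W2a) (`not_specialisable_archimedeanCert`) — and its thesis is DEFINITIONALLY the
  `∃`-parameter contrapositive of Roy's criterion (`expFreeCertificateThesis_archimedeanCert_iff`, `…_of_royCriterion`), i.e. route `RoyCriterion` = the summit
  at rank `n` (`Roy2001_iff`); restricting to exponential points `α = exp ∘ y` evades the witness and IS Schanuel at rank `n`. Not covered: theses over point
  classes excluding every collapsing polynomial point (e.g. all coordinates algebraic), `n = 1`, and R2-shaped statements (`∀ᶠ N` over functionals on the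
  monomial box — killed separately by the place `e ↦ 0`, §2 R2).
* **Threatens.** `RoyCriterion` and `PowerMapCalibration` (`RoyConjectureTwo` = `stmt-0078`) only in the sense that the door leads back to them; any revival of
  the moot `PolarPhantoms` items (`CheapCertificates`, `TraceZeroEstimate`, `PolarLindemann`); certificate-by-dual-witness cards on Roy boxes.

### B11 · `AxLocalDerivationsBlind` — at a first failure of Schanuel, Ax's theorem is vacuous for EVERY family of derivations exponential on the tuple (generation 2; closes B7 escape (b))
* **Decl / file / status.** `Literature.Barriers.Schanuel.AxLocalDerivationsBlind` (`AxLocalDerivationsBlind.lean`), PROVED (`axLocalDerivationsBlind_holds`;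
  Kirby 2010 Prop. 4.7, Lemma 4.8, Thm 5.1, Prop. 7.2; Ax 1971 Thm 3 — all from tree proofs).
* **Exact content.** `∀ n x, LinearIndependent ℚ x → trdeg ℚ(x, eˣ) < n → (∀ r < n, SchanuelRank r) → ∀ m (D : Fin m → Derivation ℤ ℂ ℂ),
  (∀ j i, D j (e^{xᵢ}) = e^{xᵢ} · D j (xᵢ)) → ∀ j i, D j (xᵢ) = 0`. Ingredients (PROVED renderings, stronger than the printed E-derivation forms): a FIRST
  FAILURE (least failing rank) is a non-degenerate Khovanskii point of its own `ℚ`-locus (`firstFailure_exists_khovanskiiSystem`: Khovanskii dichotomy + Ax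
  with rank term + minimality = Kirby Prop. 7.2 read pointwise), and at a non-degenerate Khovanskii point the Jacobian argument of Prop. 4.7 kills every
  derivation exponential on the tuple (`derivation_apply_eq_zero_of_khovanskiiSystem` — uses only the chain rule and the `n` relations). Corollaries:
  `firstFailure_mem_constantSubring`, `not_isQLinearIndependentMod_of_firstFailure` (Ax's hypothesis FAILS at the tuple), `firstFailure_rank_eq_zero` (the rank
  term is `0`), `exists_firstFailure_of_not_schanuelProperty` / `not_schanuelProperty_imp_ax_hypothesis_fails` (first failures exist iff SP fails).
* **Kills.** Proof-by-contradiction lines "take a minimal counterexample `x`, build derivations `D` with `D e^{xᵢ} = e^{xᵢ} D xᵢ` (E-derivations, derivations of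
  `ℚ(x, eˣ)`, of any intermediate field, arbitrary derivations of `ℂ` restricted to the tuple), apply Ax's Theorem 3 / the predimension inequality AT `x`":
  the hypothesis `IsQLinearIndependentMod D x` is false and the rank term vanishes, whatever `D`. This is the escape B7 left open ("Ax's theorem with
  arbitrary (non-E-) derivations satisfying `D zᵢ = zᵢ D yᵢ` on the tuple only is NOT excluded") — now excluded at the first failure.
* **Escape.** Ax / Ax–Schanuel at OTHER tuples — sub-tuples (need not be first failures), extensions `(x, w)`, locus mates, positive-dimensional families
  through `x` — where the isolated non-degenerate Khovanskii point leaves an UNLIKELY-INTERSECTION FINITENESS question, not a functional-transcendence one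
  (route `RigidCore`, crux `MinimalCounterexampleInAcl` C7); generic / exponentially transcendental parameters (`baysKirbyWilkie2010_thm_1_2`, never coordinates of
  a first failure by `firstFailure_mem_constantSubring`); other differential fields (power series, function fields: Ax–Schanuel proper); non-derivation input
  (archimedean / analytic structure, arithmetic of specific numbers).
* **Scope caveats.** Printed: Prop. 4.7 for E-derivations of partial E-domains, Prop. 7.2 for essential counterexamples; the tuple-local all-derivations form
  and the first-failure form are this file's proved renderings. First failures are not known to exist (their existence ⟺ `¬ SchanuelProperty ℂ`).
* **Threatens.** `RigidCore` (`MinimalCounterexampleInAcl` 0969 / `…GeThree` 14744: every line must use Ax AWAY from the tuple — its dead lines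
  `kernel-arithmetic-selection`, `span-growth-dichotomy`, `sweep-below-rank` all ended in finiteness residues, §5), `RelationCounting` (`FirstFailurePresentation`
  `stmt-16240`, `CountingGap*`: the Jacobian criterion N11.1 is the same mechanism), `ExpMordellWeil` (exponential derivations / unit theorem), `SheetDescent`,
  `RecursiveCore`, `CoprimeExpPolynomials` (Ritt-theoretic derivations), and every crux-ideate card of type "Ax at the minimal counterexample".

### B12 · `AxSchanuelFunctionalNotNumericalNarrow` — what B7 does and does not bar: exponential-field-uniform arguments are refuted; functional transcendence and differential algebra as INGREDIENTS are not (generation 2; narrows B7)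
* **Decl / file / status.** `Literature.Barriers.Schanuel.AxSchanuelFunctionalNotNumericalNarrow` (`AxSchanuelFunctionalNotNumericalNarrow.lean`), PROVED
  (`axSchanuelFunctionalNotNumericalNarrow_holds`: B7's discharge + `functionalDerivationOfSchanuel_iff_forall_schanuelProperty` + the all-derivations
  computation + tree Lindemann–Weierstrass + tree Nesterenko).
* **Exact content (conjunction).** (i) B7 verbatim; (ii) the refuted class is EXACTLY the class of arguments valid in every exponential field of characteristic
  zero: `FunctionalDerivationOfSchanuel ↔ ∀ F [Field F] [CharZero F] [ExponentialRing F], SchanuelProperty F`; (iii) at the four classical pairs Ax's hypothesis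
  fails for ALL finite families of derivations of `ℂ` (not only E-derivations): `¬ IsQLinearIndependentMod D (1, πi)`, `¬ … (1, e)`, and — granted Ax's relation
  at the coordinate — `¬ … (log 2, √2 log 2)`, `¬ … (πi, log 2)` (`classicalPairs_not_isQLinearIndependentMod_allDerivations`, from
  `not_isQLinearIndependentMod_of_isAlgebraic` / `…_of_exp_rel`: a derivation kills `ℚ̄`, and `D e^y = e^y D y` with `e^y ∈ ℚ̄ˣ` forces `D y = 0`); (iv) the
  residue `SP|ecl ∅` has PROVED points: every algebraic tuple (`schanuel_residue_algebraic_holds` = Lindemann–Weierstrass, with `algebraic_tuple_mem_ecl_empty`)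
  and `(πi, π)` (`schanuel_residue_piI_pi_holds` = Nesterenko, with `piI_pi_tuple_mem_ecl_empty`, `algebraicIndependent_pi_cexp_pi`).
* **Kills.** As B7, sharpened: any derivation of `SchanuelProperty ℂ` or of `e ⊥ π`, `e ⊥ e^e`, `log 2 ⊥ 2^{√2}`, `π ⊥ log 2` from statements true in ALL
  exponential fields of characteristic zero (weak SP, `ecl`-pregeometry, Zilber's axioms 1, 2, 4, 5, CCP, quasiminimality); any instantiation of Ax's Theorem 3
  AT the four classical pairs, whatever the derivations.
* **What it explicitly does NOT bar (escapes, with proved instances).** (1) functional independence (Mahler) + an algebraic differential system (Ramanujan) +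
  arithmetic of Taylor coefficients ⇒ numerical independence ON `ecl ∅` (Nesterenko 1996; Philippon's K-functions) — the residue at `(πi, π)`; (2)
  Siegel–Shidlovskii / Lindemann–Weierstrass — the residue on algebraic tuples; (3) generic parameters (`baysKirbyWilkie2010_thm_1_2`); (4) o-minimal point
  counting (an ARCHIMEDEAN property of `ℂ_exp` restricted to `ℝ`, absent from general E-fields; Wilkie-type bounds). B7's tags `functional-transcendence`,
  `differential-algebra`, `hrushovski-delta`, `generic-points` are covered ONLY inside exponential-field-uniform arguments; a route using them together with
  arithmetic / archimedean structure of `ℂ_exp` is outside every refuted class. Nothing is decided about `(1, πi)`, `(1, e)`, `(log 2, √2 log 2)`, `(πi, log 2)`.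
* **Threatens.** The same routes as B7; it mainly DISARMS over-broad barrier objections: refuters must not grade a route `barrier` for using Ax–Schanuel or
  multiplicity estimates as an ingredient next to a named non-soft input (`TateNomes`, `RelationCounting`, `SingularModulusScaling`, `TwistedConjugacy` all
  name one).

## 1′. Strong-hypothesis registry (D-0034; `Literature/StrongHypotheses/Schanuel.lean`, bridges `Summits/Schanuel/StrongHypotheses.lean`) — generation 2

Not barriers but DOMINATORS: the tribunal kernel (T1) probes every load-bearing crux `C` of a new route for a cheap `H → C` with `H` registered here; a hit
means "`C` is a consequence of a known strong hypothesis" (informational for a consequence of `S`, fatal if `C` was sold as weaker than `S` but is one of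
the equivalent criteria in costume). All three bridges are LANDED one-liners over tree theorems; no `sorry`, no axiom.
* **H1 · `Literature.NumberTheory.Transcendental.ZilberConjecture` — strictly stronger.** Bridge `Summit.Schanuel.StrongHypotheses.zilberConjecture_imp_schanuel :
  ZilberConjecture → Schanuel` (over `ZilberConjecture.schanuelConjecture`; `ZilberConjecture ↔ Schanuel ∧ SEAC`, Bays–Kirby 2018 Thm 1.4 in tree). A crux
  implied by Zilber's conjecture and not known from `S` alone is Zilber-strength (S3, C6 `stub_zilber`, C15 `TwistedSymmetry`).
* **H2 · `Literature.NumberTheory.Transcendental.ToricPeriodConjecture` — equivalent.** Bridge `…toricPeriodConjecture_iff_schanuel : ToricPeriodConjecture ↔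
  Schanuel` (Bertolin 2002 Cor. 1.3, `toricPeriodConjecture_iff_schanuel_holds`; S2). Over `ℚ̄` it is `AlgIndepLogarithms` (B6).
* **H3 · `Literature.StrongHypotheses.Schanuel.RoyCriterionAll` (`= ∀ l, RoyCriterion l`, NEW decl) — equivalent.** Bridge `…royCriterionAll_iff_schanuel :
  RoyCriterionAll ↔ Schanuel` (rank by rank over the discharged `Roy2001_iff_holds`; C1: `RoyThesisTyped` is this statement).
* **Deliberately NOT registered** (recorded in the registry docstring): the REFUTED `StrongSchanuelConjecture` (B9; would poison every probe); statements WEAKER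
  than `S` (`FourExponentialsConjecture`, `StrongFourExponentialsConjecture`, `WaldschmidtConjecture_2_3`, `GelfondExpLogConjecture`, `PiExpAlgebraicIndependence`,
  `AlgIndepLogarithms`, `ThreeLogarithmsConjecture`, `ToricPeriodConjectureQbar`, `ExpOnePiAlgebraicIndependent`, `ExpOneAddPiIrrational`, `ExpOneMulPiIrrational`,
  `GelfondPowerTowerConjectureReal`, SP of `ℝ_exp` and its model-theoretic consequences, the E-function non-value statements of B4); INCOMPARABLE ones (CIT,
  quasiminimality); NOT TYPEABLE yet (André's GPC for all 1-motives / Bertolin's elliptico-toric conjecture — the natural dominator of `TateLocusGPC{,One}`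
  C11 —, the exponential period conjecture of Fresán–Jossen, Zilber's uniform SC). A route leaning on one of the untypeable dominators must file it as its own
  `@[conjecture]` item or open as a `--conditional-bridge`.

---

## 2. Refuted route statements (`ledger negatives --problem Schanuel`; gate-landed `*Refutation.lean`)

Both refutations of the summit to date killed route `PolarPhantoms` (technique class: transcendence-criterion-at-points / Roy-box exactness;
closed `refuted` 2026-08-15T22:50Z, "route's own pre-registered kill criterion met"). A refuted statement can never be re-wanted: the gate refuses
a statement equal to one, and a near-restatement is churn.

Generation 2 (2026-08-17): `ledger negatives --problem Schanuel` UNCHANGED — still exactly these two items; R1 is now also a Literature THEOREM for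
every rank `n ≥ 2` (B10 `SpecialisationCollapseBarrier`), so re-filings at higher rank or with extra point hypotheses are dead too.

### R1 · `PolarPhantoms.PolarSchanuel` — `stmt-Schanuel-6844` (route TARGET) — REFUTED, class substantive
* **Refuting theorem.** `Summit.Schanuel.Schanuel.Theorems.PolarPhantomsPolarSchanuel_refuted : ¬ …PolarPhantoms.PolarSchanuel`
  (`Theorems/PolarPhantomsPolarSchanuelRefutation.lean`, commit `703fb88c`, 2026-08-15).
* **Refuted statement (exact).** `∀ n (y α : Fin n → ℂ), LinearIndependent ℚ y → (∀ j, α j ≠ 0) → trdeg ℚ(y, α) < n → ∃ s₀ s₁ t₀ t₁ u, RoyAdmissible … ∧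
  ∃ᶠ N, ∀ P ≠ 0` in Roy's box (`degreeOf 0 ≤ N^{t₀}`, `degreeOf 1 ≤ N^{t₁}`, `mvPolyHeight P ≤ e^N`) `∃ c : ℕ → (Fin n → ℕ) → ℚ` with `Σ|c| < exp(N^u)` and
  `Σ c_{k,m} (D^k P)(m·y, α^m) = z ∈ ℤ ∖ {0}` — "at every point with `y` `ℚ`-free, `α ∈ (ℂˣ)ⁿ`, `trdeg < n`, some admissible parameter set gives CHEAP EXACT
  CERTIFICATES on Roy's box for infinitely many `N`".
* **Witness.** `n = 2`, `y = (π, π²)`, `α = (1 + π, 1 − π)` (trdeg 1; `α` multiplicatively independent, `α_j e^{−y_j}` not a root of unity): the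
  specialisation `π ↦ 0` of `ℤ[π]` collapses the whole multi-orbit `(m·y, α^m)` onto the exponential point `(0, e⁰)`, where Roy's own auxiliary
  polynomials (`royHypothesis_exp'`, unconditional) have all box values `≤ e^{−N^u}`; a rational certificate survives specialisation (transcendence of
  `π`), so `|z| ≤ ‖c‖₁ e^{−N^u} < 1`. Works verbatim for every transcendental `ω` and every polynomial point `y = Y(ω)`, `α = A(ω)` with `Y(0) = 0`, `A(0) = 1`.
* **Kills (class).** Exp-free "∀ points of trdeg `< n`" certificate / exactness statements on Roy boxes in Roy's window (`s₀ < t₀ + t₁`: single jets are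
  Thue–Siegel): non-existence of cheap or exact rational certificates is INHERITED from every specialisation of the point. No cheap repair: every
  hypothesis excluding the witnesses (tried: `α` mult. independent; `α_j e^{−y_j} ∉ μ_∞`; no rational/algebraic coordinate pair) keeps them, while
  restricting to exponential points `α = exp ∘ y` makes X Schanuel itself (`PolarGlue`).
* **Escape.** None at route level (route closed). Barrier candidate recorded by the refuter: **specialisation collapse**.

### R2 · `PolarPhantoms.PhantomsAreTraceless` — `stmt-Schanuel-6846` (crux) — REFUTED, class substantive
* **Refuting theorem.** `Summit.Schanuel.Schanuel.Theorems.PolarPhantomsPhantomsAreTraceless_refuted` (`Theorems/PolarPhantomsPhantomsAreTracelessRefutation.lean`,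
  commit `7e2444ac`, 2026-08-15).
* **Refuted statement (exact).** Same scope (`y` `ℚ`-free, `α ∈ (ℂˣ)ⁿ`, `trdeg ℚ(y, α) < n`) ⟹ `∃` admissible parameters, `∀ᶠ N`, every family
  `θ : ℕ → ℕ → (ℂ →ₗ[ℚ] ℚ)` on the box `a ≤ N^{t₀}, b ≤ N^{t₁}` with `Σ_{a,b} θ_{ab}((D^k X₀^a X₁^b)(m·y, α^m)) = 0` for all `(k, m)` in Roy's range has
  `θ_{ab}(1) = 0` — "phantoms are traceless" (NTP(n) in intrinsic `θ`-form, exp-free).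
* **Witness.** `n = 2`, `y = (1, e)`, `α = (e, 1)`: `λ₀ =` "constant term in `e`" is a ring homomorphism on `ℚ[e]`; under `e ↦ 0` the multi-orbit
  collapses onto `{(0,1)} ∪ ℕ_{≥1} × {0}`, `X₁^b ∣ D^k(X₀^a X₁^b)` kills `b ≥ 1`, leaving `⌊N^{s₀}⌋ + 1` equations in `(⌊N^{t₀}⌋+1)⌊N^{t₁}⌋` unknowns; Roy's
  window forces `s₀ < t₀ + t₁`, so a non-zero `z` exists for EVERY admissible parameter set and all large `N`: a phantom WITH a trace. Also
  `α = (ξ, ξ)`, `(ξ, 2ξ)` (torsion-free, multiplicatively independent).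
* **Kills (class).** Roy-box exactness / tracelessness at any point whose coordinate ring admits a PLACE collapsing the multi-orbit to finitely many
  points (barrier candidate: **specialisation phantoms**). The same witness kills the `P`-wise pivot and, with Siegel's lemma for the height, the
  target R1.
* **Escape.** "All `α_j` algebraic" misses the witness but makes the crux unusable at `α = exp ∘ y` in `closes`; "only `α = exp ∘ y`" is Schanuel-equivalent.

---

## 3. Route-level structural closures (not refutations; recorded so nobody re-files them)

### S1 · `route-Schanuel-EclCore` — CLOSED `reduction-proved` (2026-08-15)
X = "Schanuel on `ℚ`-independent tuples in `ecl ∅`"; `X ⟺ Schanuel` is the Literature theorem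
`Literature.NumberTheory.Transcendental.schanuelConjecture_iff_ecl_empty_holds` (Kirby 2010 Prop. 7.2 from Ax). Zero cruxes remain, the
remaining content IS the summit (cone guardrail). **Lesson:** Kirby's localisation to `ecl ∅` is a proved bookkeeping step (use it freely as
support: `firstFailure_mem_ecl`, `RoyThesisTyped.crux_iff_reduced`), never a thesis.

### S2 · `route-Schanuel-ToricPeriods` — CLOSED `absorbed` (2026-08-15)
André's generalised period conjecture for toric 1-motives ⟺ Schanuel is machine-checked
(`Literature.NumberTheory.Transcendental.toricPeriodConjecture_iff_schanuel_holds`, Bertolin 2002 Cor. 1.3); over `ℚ̄` it is `AlgIndepLogarithms` (B6).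
**Lesson:** a motivic costume of the summit is not a route; a period-conjecture route needs a crux that is NOT equivalent to Schanuel (e.g. a
theorem toward `(?!)` for a specific non-toric motive, or exponential motives with their own period conjecture).

### S3 · `route-Schanuel-Zilber` — CLOSED `not-a-thesis` (2026-08-15)
X = `ZilberConjecture = IsZilberField ℂ` CONTAINS the summit as a conjunct (`zilberConjecture_iff_schanuelConjecture_and_isStronglyExpAlgClosed`),
and by B8 the other conjuncts do not imply it. **Lesson:** "prove Zilber's conjecture" is Schanuel + SEAC; the axiomatic side can only
contribute through non-soft input (B7/B8 escapes) — cf. the live crux `AclSubsetLogFreeCore` (C6), which is NOT a conjunct of Zilber's axioms.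

### S4 · D-0027 §2.1 retirements (2026-08-15, operator audit "routes that do not decide the summit are removed") — 15 routes
`BilinearExp` (assembly concluded `CurveMeetsBilinExp`), `ClusterRankDrop` (`LargeTrdegNoTH`), `ExceptionalLines`, `ExpGaussMap` (`AntiLagrange`),
`GelfondTowers` (`GelfondRealTowers`), `GeodesicLengthsGP3` (a GP3 real-log statement), `GridCapacity` (`KneserCapacityBound ∧ ExtremalGridsDilate ∧
THFreeFloorOnProgressions`), `KFunctionRigidity` (`DifferentialKReach`), `MisiurewiczAndreOort` (`DAOExp`), `ModulusFirst` (`FinitenessTwo`), `MoebiusRung`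
(`Target`), `PellOrbitShapiro` (`TwoFrequencyFiniteness`), `SheetCounting` (`SheetSparsityTwo`), `StokesConstantPi` (`ExpOnePiAlgebraicIndependent`),
`ToricSparse` (`ToricSchanuelTwo`) — all closed `retired: not-a-thesis: assembly does not conclude the sub-problem Statement`; several were re-opened as
conforming routes (`MisiurewiczField`, `GeodesicRealLogs`, `SheetDescent`, `GaussianStokesSector`, `CapacityLadder`, `ToricSector`, `RecursiveCore`).
**Lesson (structural no-go):** a route whose `closes` reaches only an analogue / intermediate statement (`e ⊥ π`, rank-2 Schanuel, a finiteness
statement) is retired; intermediate targets belong in `LADDER.md` or as cruxes of a route whose glue reaches `Schanuel`.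

### S5 · Status snapshot 2026-08-17 (no new route closures since generation 1; recorded so seats see what moved)
* **Theses files: 47** — closed 19 (unchanged: the 3 closures S1–S3, `PolarPhantoms` refuted, the 15 retirements S4) · open 26 · draft 1 · done 1.
  NEW since generation 1: `RelationCounting` (open 08-16, o-minimal relation counting + width amplification; cruxes `CountingGapHigher` 16237,
  `CountingGapPair` 16238, `Amplification` 16239, support `FirstFailurePresentation` 16240), `SingularModulusScaling` (open 08-16, G-functions / CM
  singular moduli / Bombieri global relations; cruxes `CMBoundedDegreeFreeness` 17191, `ExpLogBoundedDegree` 17192, shared `RelSchanuelOverPiLWField` 9548,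
  `PiFreeOverLWField` 9545), `TwistedConjugacy` (DRAFT 08-16, twisted outer automorphism / Denis char-`p` transfer; cruxes `TwistedSymmetry` 17222,
  `RelSchanuelOverTowerPi` 17223, `TwistImpliesTowerPi` 17225 + six supports), `TateNomes` (open 08-17, André's GPC on the Tate locus + Nesterenko;
  cruxes `TateLocusGPC` 17404, `NomeHygiene` 17298 PROVED, `NomeTransfer` 17405 PROVED, `TateLocusGPCOne` 17406, supports `EPiOfTateOne` 17301,
  `MultiNomeNesterenko` 17407), `SurplusLinkage` (open 08-17T18:09Z, surplus `a + b ≥ n` ∧ height-free Baker over `L = ℚ(e^z)^{alg}` ∧ residual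
  `NonlinearLinkage`; cruxes 18993–18995). `ExceptionalSubspaces` is `done` (supports 9550–9557 proved; its cruxes 9545–9549 remain open and are shared).
* **Proved cruxes (closed `proved`) to build on, not re-file:** `NomeHygiene` (`Theorems/TateNomesNomeHygiene.lean` `NomeHygiene_proof`, line
  `integer_shift_rebase`), `NomeTransfer` (`Theorems/TateNomesNomeTransfer.lean` `NomeTransfer_of`, line `trdeg-bookkeeping`), the glue
  `MinimalCounterexampleInAclOfSparsityTwo` 14765, `ApproximationPropertyDegOne`, and the supports listed in the route files' `_holds` links.
* **Strategist re-audits (2026-08-17) binned these cruxes RESTATED / summit-strength** — see E1–E6 and the census ledger of §5: `RoyThesisTyped` 0463,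
  `RankLeTrdeg` 3486, `ComputableSchanuel` 4023, `TwistedSymmetry` 17222 (Zilber-strength), `TateLocusGPC{,One}` 17404/17406 (GPC-strength),
  `SchanuelOnLogFreeCore` 0970, `SchanuelTwo` 0069 (contains `e ⊥ π`; every sector split leaves it in the residue).

### E1–E6 · Landed (or farm-checked) summit-equivalences and conjunct splits — the BC2 / T1 ledger (generation 2)
A crux `X` with `X ↔ Schanuel` kernel-checked is the summit in costume unless its OWN decomposition passes one level down (BC2 "restated is a redirect");
a conjunct split `C₁ ∧ C₂ ↔ S` must NAME the attacked conjunct and declare the other `residual` (tribunal, D-0033). Known instances: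
* **E1 · sector exactness (LANDED).** `Summit.Schanuel.Schanuel.Theorems.RigidCore.SectorExactness.schanuel_iff_piFree_and_relSchanuel :
  Schanuel ↔ GaussianStokesSector.PiFreeOverLWField ∧ GaussianStokesSector.RelSchanuelOverPiLWField` (`Theorems/RigidCoreSchanuelOnLogFreeCoreSectorExactness.lean`).
  Consequence: the pair (9545, 9548) shared by `ExceptionalSubspaces` / `GaussianStokesSector` / `SingularModulusScaling` is JOINTLY the summit; each of those
  routes must say which conjunct it attacks (`SingularModulusScaling`: the sector `ℚ̄ ⊕ ℚπi`, conceding `RelSchanuelOverPiLWField`; strategist verdicts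
  `no-strategy` / `no-decomposition` on both pieces individually, §5).
* **E2 · the general sector split (LANDED, Literature).** `Literature.NumberTheory.Transcendental.schanuel_of_sector_split_set (S : Set ℂ)` : (Schanuel INSIDE
  `span_ℚ S`, exp-free form) → (Schanuel RELATIVE to `ℚ(S)` for tuples independent modulo `span S`) → `∀ n, SchanuelRank n` (`SchanuelSectorSplit.lean`,
  Kirby-style adapted bases). Every "sector ∧ off-sector" route (`LogPatterns`, `MatrixCoefficients`, `ExpMordellWeil`, `AdelicLogSector`, `BenfordTowers`,
  `GeodesicRealLogs`, `ToricSector`, `MisiurewiczField`, `RecursiveCore`, `ExceptionalSubspaces`, `GaussianStokesSector`, `SingularModulusScaling`) is an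
  instance: the two conjuncts are jointly `≥ S`, the off-sector conjunct is usually a residual of summit type (`OffPrimeLogSector` 7090 census: "the RESIDUAL
  CONJUNCT of `S` complementary to `PrimeLogSector`, not a line of attack"; `OffLogSector` 4311; `RelSchanuelOverPiLWField` 9548), and the sector conjunct is
  where the route's content must live (`LogSector` 4310 = `AlgIndepLogarithms` B1; `RealLogSector` 11767 is DOMINATED by it:
  `Cruxes/RealLogSector/Calibration.lean` `realLogSector_of_algIndepLogarithms`).
* **E3 · `RankLeTrdeg ↔ Schanuel` (farm-checked workfile `Cruxes/RankLeTrdeg/Split.lean`, rc 0, 0 sorry):** `rankLeTrdeg_of_schanuel` and the route's `closes`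
  (`K := ℚ(z, e^z)`); delivered redirect `rankLeTrdeg_of_subs : LogSector → OffLogSector → RankLeTrdeg` over E2 (route edit `--split` pending a final cycle).
* **E4 · `RoyThesisTyped ↔ Schanuel` (LANDED as H3 / `Roy2001_iff_holds`, rank by rank AND point by point; C1).** Census verdict `no-strategy-short-of-summit`.
* **E5 · `ComputableSchanuel` (4023, route `ArithmeticalComplexity`):** `S → X` by restriction; `X → S` is the route's own `closes` over the two transcendence-free
  supports `CoreComputable` 4027, `KirbyCoreReduction` 4028 (bookkeeping over the LANDED `schanuelConjecture_iff_ecl_empty_holds`, S1) — census verdict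
  NO-DECOMPOSITION (`Cruxes/ComputableSchanuel/Census4023.lean`): the summit in computable dress.
* **E6 · hypothesis-drops that are literally the summit (farm-checked, `Cruxes/NomeTransfer/Disproof.lean`):** `nomeTransferWithoutEnvelope_iff_schanuel`
  (drop the envelope bound from `NomeTransfer`, take `k = 0`), `schanuel_of_nomeTransferWithoutSpan : RichNomeTuples 4 → … → Schanuel`,
  `schanuel_of_nomeTransferWithoutAdmissible : RichNomeTuples 5 → … → Schanuel`; and the consequence direction for `RecursiveSchanuel` 12193
  (`Cruxes/RecursiveSchanuel/StrategyCensus.lean`: `crux_of_schanuel` PROVED, `cruxAtRank_two_iff_schanuelTwo`, `algIndepLogarithms_of_crux`; `C → S` probes fail —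
  a consequence of `S` at least as strong as `SchanuelTwo ∧ AlgIndepLogarithms`).

---

## 4. Crux-level negative lemmas (`Summits/Schanuel/Schanuel/Theorems/<Crux>/Negative/*.lean`, gate-landed, sorry-free)

Decls live in namespace `Summit.Schanuel.Schanuel.Theorems.<Crux>.Negative` (or as printed). Each entry: what is proved · what it kills (a weakening,
strengthening, mutation or line of the crux) · the escaping hypothesis = what any proof of the crux must USE. "Load-bearing `H`" below always means
the kernel-checked theorem `<crux with H deleted, verbatim otherwise> → False`.

### C1 · Roy's criterion — target `RoyThesis` (`stmt-Schanuel-0078`) = crux `RoyThesisTyped` (`stmt-Schanuel-0463`) `= ∀ n, RoyCriterion n`; route `RoyCriterion` (also `PowerMapCalibration` wants `stmt-0078` as `RoyConjectureTwo`)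
Crux: for `y : Fin n → ℂ` `ℚ`-linearly independent, `α ∈ (ℂˣ)ⁿ`, an admissible window `RoyAdmissible s₀ s₁ t₀ t₁ u` (`max(1,t₀,2t₁) < min(s₀,2s₁)`,
`max(s₀, s₁+t₁) < u < (1+t₀+t₁)/2`) and `RoyHypothesis y α …` (for all large `N` a non-zero `P_N ∈ ℤ[X₀,X₁]`, partial degrees `≤ N^{t₀}, N^{t₁}`, height
`≤ e^N`, with `|(D^k P_N)(m·y, α^m)| ≤ exp(−N^u)` for `k ≤ N^{s₀}`, `mⱼ ≤ N^{s₁}`, `D = ∂₀ + X₁∂₁`) ⟹ `n ≤ trdeg ℚ(y, α)`. Equivalent to the summit rank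
by rank (`Literature.NumberTheory.Transcendental.Roy2001_iff_holds`); ranks 0, 1 PROVED (`RoyCriterionRankOne`, Hermite–Lindemann). Dirs:
`Theorems/RoyThesis/Negative/`, `Theorems/RoyThesisTyped/Negative/`; workfiles `Cruxes/RoyThesis/Disproof.lean`, `Cruxes/RoyThesisTyped/Disproof.lean`.

* **N1.1 `royThesis_false_without_linearIndependent`** (`RoyThesis/Negative/LoadBearing.lean`; stronger `royThesis_withoutLinearIndependent_fails`: fails at
  EVERY rank `n ≥ 1` and EVERY admissible tuple). Witness `y = 0`, `α = e⁰ = 1`, hypothesis by the in-tree Thue–Siegel auxiliary polynomial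
  `royHypothesis_exp'`, `trdeg ℚ(0, 1) = 0`. Kills: LI-free versions. Escape: `LinearIndependent ℚ y` — and not merely injectivity
  (`crux_false_with_injective_for_linearIndependent`, Disproof: `y = (1, 2)`, `α = (e, e²)`).
* **N1.2 `royThesis_false_without_units`** (ibid.). Witness `(y, α) = (1, 0)`, `P_N = X₁ · R_N` (`X₁ ∣ D^k(X₁ R_N)`), `royHypothesis_one_zero`. Kills:
  dropping `α_j ≠ 0`. Escape: `∀ j, α j ≠ 0`.
* **N1.3 `royThesis_false_without_window1`**, a fortiori **`royThesis_false_without_admissible`** (ibid.). Witness `(1, 1)`, `(s₀,s₁,t₀,t₁,u) = (1/2,1,10,1,3)`,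
  `P_N = (X₁ − 1)^{⌊√N⌋+1}` with EXACT zeros (`royHypothesis_one_one`). Kills: windows missing `max(1, t₀, 2t₁) < min(s₀, 2s₁)`. Escape: Roy's window (1).
  Calibration (Disproof): the excess `u`-inequalities of (1) carry NO truth content — the crux on Theorem 1's wider window is still ⟺ Schanuel
  (`cruxWideWindow_iff_schanuel`).
* **N1.4 `royThesis_conclusion_sharp`** (ibid.; Disproof `not_cruxSucc`). `(y, α) = (1, e)` satisfies the hypothesis at every admissible tuple and
  `trdeg ℚ(1, e) ≤ 1 < 2`. Kills: strengthening the conclusion to `n + 1 ≤ trdeg`.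
* **N1.5 `royCriterion_false_with_derivative_exponent_lt_one`** (`RoyThesisTyped/Negative/DerivativeExponent.lean`). Decouple the derivative range
  `k ≤ N^{s}` from the window: for EVERY `0 ≤ s < 1` the decoupled criterion is FALSE (window with `t₁ > s`, point `(1, 1)`, `P_N = (X₁ − 1)^{⌊N^s⌋+1}`);
  by Roy's Prop. 3 it is TRUE given Schanuel for `s > max(1, t₀, 2t₁)`; rank one unconditionally for `max(1,t₀,2t₁) < min(s, 2s₁) < u`
  (`RoyThesisTyped.royCriterion_one_derivExp`). Kills: "cheaper" criteria with fewer derivatives. Escape: the coupled `s = s₀`.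
* **N1.6 `RoyThesisTyped.crux_iff_diagonalRungs`** (`…/LadderDiagonal.lean`, LINE-DEATH certificate for line `liouville-window-ladder` =
  `Sketch-ideator1-r1`): the conjunction of the DIAGONAL rungs "no `ℚ`-free `y : Fin l → ℂ`, `α ∈ (ℂˣ)^l` with `trdeg ℚ(y, α) = l − 1` exactly satisfying
  `RoyHypothesis` in an admissible window" (`l ≥ 1`) is EQUIVALENT to the crux (off-diagonal rungs follow from the lower rank via Roy Thm 1 `(b)⇒(a)` =
  `royThm1BtoA_holds`). Kills: trdeg-ladder decompositions of Roy's criterion — their one non-bookkeeping stub restates the crux (COSTUME).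
* **N1.7 `RoyThesisTyped.not_royCriterion_of_le`, `crux_iff_frequently`, `crux_iff_eventually`** (`…/RankStructure.lean`). Counterexample ranks form
  an UP-SET (`SchanuelRank (l+1) → SchanuelRank l` by adjoining a `ℚ`-free algebraic integer, `exists_isIntegral_not_mem_span`); the crux equals "Roy's
  criterion for infinitely many ranks" and "for all large ranks". Kills: "prove it for a cofinal / eventual set of ranks" as a weakening — it is not
  one; no rank can be skipped. Also `crux_iff_reduced`: crux ⟺ Schanuel for `ℚ`-free tuples of rank `≥ 2` from the countable `ecl ∅` with a
  transcendental coordinate (`exists_transcendental_of_counterexample`, Lindemann–Weierstrass layer `schanuelRank_of_isAlgebraic`).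
* **N1.8 `RoyThesisTyped.not_royHypothesis_one_two`** (`…/UniformityCalibration.lean`). NON-VACUITY: at the algebraic point `(1, 2)` the hypothesis
  FAILS for every admissible window (Roy Thm 1 `(b)⇒(a)` + Hermite), while it holds on the graph of `exp` (`royHypothesis_exp'`). So the crux is
  neither vacuous nor trivially false.
* **N1.9 `∃ᶠ N` calibration** (ibid.): off the circle `|αe^{−y}| = 1` even the `∃ᶠ N` weakening of condition (b) fails at every large scale
  (`not_frequently_conditionB_of_norm_ne_one`; `frequentlyVariantRankOne_of_norm_ne_one`); on the circle a finite irrationality measure of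
  `arg(αe^{−y})/2π` kills it too (`not_frequently_conditionB_of_irrationalityMeasure`); hence the `∃ᶠ N` mutation of Roy's criterion in rank one is
  TRUE MODULO Baker's inhomogeneous theorem (`frequentlyVariantRankOne_of_baker`, hypothesis inline, not in tree). Kills: hopes that `∀ᶠ N → ∃ᶠ N` is a
  cheap falsifier in rank one. (Contrast C2 N2.4, where `∃ᶠ D` IS false.)
* **Workfile extras (`Cruxes/RoyThesis/Disproof.lean`, `Cruxes/RoyThesisTyped/Disproof.lean`; §5):** `crux_iff_schanuel` (RESISTANCE CERTIFICATE: a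
  disproof of the crux is a Schanuel counterexample — a `ℚ`-free `y ∈ ℂⁿ`, `n ≥ 2`, `trdeg ℚ(y, e^y) < n`; nothing about polynomials survives);
  `not_cruxNoDeriv` (small VALUES without `D`-derivatives do not force degeneracy: `(1,1)`, `P_N = X₁ − 1`); `not_cruxPartial0` (`∂/∂X₀` alone in place
  of `D = ∂₀ + X₁∂₁` — FALSE); `crux_false_without_P_ne_zero`, `crux_false_without_alphaNeZero`; the six "cheapest conceivable kills" all reduce to open
  transcendence statements (`not_crux_of_not_expOnePiAlgebraicIndependent`, `…_not_algIndepLogarithms`, `…_not_piI_logTwo`, `…_not_exp_expExp`,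
  `…_isAlgebraic_exp_exp`, `…_isAlgebraic_two_rpow_log_two`, `…_isAlgebraic_exp_pi_sq`); `royCriterion_two_iff_schanuelTwo` (first open rung = crux
  `SchanuelTwo`, C10).

### C2 · support `RoySmallValueDirichletGap` (`stmt-Schanuel-1050`; route `RoyCriterion`, rank-2 support) — Roy 2013 Thm 1.1 pushed to the Dirichlet edge
Statement: `∀ ξ η, η ≠ 0 → ∀ β τ ν, 1 ≤ τ → τ < 2 → τ < β → 2 + β − τ < ν → (∀ᶠ D, ∃ P ∈ ℤ[X₁,X₂] ∖ 0, deg P ≤ D, H(P) ≤ exp(D^β), |𝒟₁ⁱP(ξ, η)| ≤ exp(−D^ν)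
∀ i < 3⌊D^τ⌋) → IsAlgebraic ℚ ξ ∧ IsAlgebraic ℚ η` (`𝒟₁ = royD = ∂/∂X₁ + X₂·∂/∂X₂`, the operator written `D = ∂₀ + X₁∂₁` in 0-indexed variables in C1). Roy's PRINTED Thm 1.1 (threshold `2+β−τ+(τ−1)(2−τ)/(β+1−τ)`) is PROVED in tree
(`Literature.NumberTheory.Transcendental.roy2013_thm_1_1_holds`). Dir `Theorems/RoySmallValueDirichletGap/Negative/`; workfile `Cruxes/RoySmallValueDirichletGap/Disproof.lean`.

* **N2.1 `roySmallValueDirichletGap_iff_gap`, `roySmallValueDirichletGap_iff_nearEdge`** (`GapReduction.lean`). OPEN CONTENT = Roy's gap: the crux ⟺ its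
  restriction to `1 < τ < 2`, `2+β−τ < ν ≤ 2+β−τ+(τ−1)(2−τ)/(β+1−τ)` (width `≤ 1/4`), ⟺ its restriction to `ν ≤ 2+β−τ+ε` for any `ε > 0` (antitonicity).
  Kills: any line spending effort away from the corner `ν ↓ 2+β−τ`; the slice `τ = 1` is already Roy's theorem.
* **N2.2 `roySmallValueDirichletGap_false_below_edge`, `…_false_of_edge_lowered`** (`DirichletEdge.lean`, + `DirichletEdgeBoxLemmas.lean`). TIGHTNESS: for
  every `1 ≤ τ < 2`, `β > τ`, EVERY `ν < 2+β−τ` the crux-shaped implication fails at the transcendental point `(e, 1)` (Dirichlet box: `hyp_below_edge`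
  holds at EVERY point); lowering the window by any `δ > 0` gives a false statement. Kills: strengthenings reaching below the Dirichlet exponent.
* **N2.3 `roySmallValueDirichletGap_false_without_etaNeZero`** (`EtaNeZeroFalse.lean`). On the `𝒟₁`-invariant line `X₂ = 0`, `P_D = X₂` has all iterates
  vanishing: witness `(e, 0)`, `(β,τ,ν) = (2,1,4)`. Escape: `η ≠ 0` (the Darboux locus of `𝒟₁` is exactly `{η = 0}`: Disproof `eta_eq_zero_of_darboux_root`).
* **N2.4 `roySmallValueDirichletGap_false_with_frequently`, `roy2013_thm_1_1_false_with_frequently`** (`FrequentlyFalse.lean` + `FrequentlyFalseLiouville.lean`,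
  `ThueSiegelNonVacuity.lean`). UNIFORMITY IN `D` IS LOAD-BEARING: with `∃ᶠ D` in place of `∀ᶠ D` the crux is FALSE at `(0, η∞)`, `η∞ = Σ 2^{−2^{4ⁿ}}`
  (transcendental, `transcendental_eta`), `τ = 3/2, β = 2, ν = 13/5` INSIDE the gap; Thue–Siegel polynomials with exact `𝒟₁`-zeros at the rational
  points `(0, s_n)` (`hyp_at_zero_rat`) moved to `(0, η∞)`. Even Roy's PRINTED theorem is false with `∃ᶠ D` (`ν = 3`). Kills: any proof consuming the
  hypothesis only at sparse scales. Escape: `∀ᶠ D` — essentially consecutive scales, as Roy's descent uses. Disproof extras: POLYNOMIAL WINDOWS OF SCALES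
  DO NOT SUFFICE — `not_cruxOnWindows'` (`[N, N^λ]`, every `0 ≤ λ < 23/10`), printed theorem false on windows `λ < 2` (`roy2013_thm_1_1_false_on_windows'`).
* **N2.5 `roySmallValueDirichletGap_slice_false_of_tau_lt_one`, `…_false_without_oneLeTau`** (`TauLtOneAndCountLeDegreeFalse.lean`). Every slice `τ < 1`
  (`β > τ`, any `ν`) is FALSE at `(e, 1)` via `P = (X₂ − 1)^{3⌊D^τ⌋}` (`𝒟₁ⁱ(X₂−1)ⁿ ∈ (X₂−1)^{n−i}`), the elementary substitute for Roy's "τ ≥ 1 is crucial"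
  (Khintchine–Philippon points). Escape: `1 ≤ τ`.
* **N2.6 `roySmallValueDirichletGap_false_of_count_le_degree`, `…_false_with_unitCount`** (ibid.). STRENGTHENING REFUTED: replacing Roy's count `3⌊D^τ⌋`
  by any count eventually `≤ D` at some admissible `τ₀ ∈ [1,2)` (e.g. `⌊D^τ⌋`, `min(3⌊D^τ⌋, D)`) is FALSE (`(e,1)`, `P_D = (X₂−1)^{c(D)}`, `β = τ₀+1`,
  `ν = 5+τ₀`). Escape: a derivative count exceeding the degree.
* **Workfile extras (Disproof.lean §7, "CruxWithOp"):** THE DARBOUX CRITERION `not_cruxWithOp_of_darboux` — any `ℤ`-linear operator `Δ` with a non-zero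
  Darboux element (`Δ P₀ = c P₀`) vanishing at a point `∉ ℚ̄²` with `η ≠ 0` has a FALSE crux-analogue; instances: `∂/∂X₁` (`(e,1)`, `X₂−1`), `X₂∂₂` (`(0,e)`,
  `X₁`), `∂₁+∂₂` (`𝔾ₐ²`: `(e−1,e)`, `X₂−X₁−1`), Euler `X₁∂₁+X₂∂₂` (`𝔾ₘ²`: `(e,e)`, `X₂−X₁`), `X₁∂₁+2X₂∂₂` (`(e,e²)`, `X₂−X₁²`). Kills: transplanting the crux to
  other one-parameter subgroups / operators with algebraic leaves; only `𝒟₁` on `𝔾ₐ × 𝔾ₘ` (Darboux locus `{η = 0}`) survives. Junk-corner load-bearing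
  lemmas: `crux_false_without_nuBound` (`ν = 0`), `crux_false_without_tauLtBeta`, `crux_false_without_pNeZero`.
* **Dead / costume lines (drefute, `Cruxes/RoySmallValueDirichletGap/Drefute*.md`):** line `two-sided-absorption-transfer` v4: `stub_tangentialTowerEmptiness`
  with `RichBodies` ≡ crux (COSTUME, `DrefuteG2CostumeV4.lean`); `stub_richBodies` misstated (needs `τ < 2`); three other stubs PROVED (`stub_linksOfOrbits`,
  `stub_twoSidedAbsorption`, `stub_royRegime`) — the open content is the emptiness / richness alternative, i.e. the gap itself.

### C3 · crux `ApproximationProperty` (`stmt-Schanuel-6117`, rank 3; route `DiophantineDichotomy`) — pointwise affine form of Philippon's approximation property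
Statement: `∀ ι [Fintype ι] (θ : ι → ℂ) t, 1 ≤ t → trdeg ℚ(θ) ≤ t → ∃ c ≥ 1, ∀ Δ Y, c ≤ Δ → Δ ≤ Y → ∃ (γ : ι → ℂ) d H, [ℚ(γ):ℚ] ≤ d ∧ (∀ i, ∃ P ∈ ℤ[X] ∖ 0,
deg P ≤ d, |coeff| ≤ H, P(γᵢ) = 0) ∧ d ≤ (cΔ)ᵗ ∧ log H ≤ cYΔ^{t−1} ∧ ‖γ − θ‖ ≤ exp(−(log H·Δ + d·Y)/c)` (sup norm, naive height). In tree: the slices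
`t = 1` (`ApproximationPropertyDegOne`, PROVED) and `t = 2` (`slice_two`, unconditional, via `CycleAPIAt 2`) — the crux is reduced EXACTLY to the
0-cycle property `CycleAPIAt t`, `t ≥ 3` (line `orbit-interpolation-determinant`, siege on `CycleAPIAt 3` in progress, `Cruxes/ApproximationProperty/SIEGE-CycleAPIAt3.md`).
Dir `Theorems/ApproximationProperty/Negative/`; workfile `Cruxes/ApproximationProperty/Disproof.lean`.

* **N3.1 `false_without_pos_t`** (`Shape.lean`; Disproof `approximationProperty_false_without_pos_t`). At `t = 0` the degree budget `(cΔ)⁰ = 1` forces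
  rational approximants: absurd at `θ = i` (`ι = Fin 1`, trdeg 0). Escape: `1 ≤ t`.
* **N3.2 `false_with_uniform_constant`** (`Shape.lean`; Disproof `approximationProperty_uniform_false`). `∃ c` in front of `∀ ι θ t` is FALSE in the
  affine / naive-height / sup-norm normalisation: `θ = N ∈ ℕ`, `N ≥ e^{c²} + 2`, has no certified approximant at the first scale (Cauchy bound
  `‖γ‖ < H + 1`, `norm_lt_of_certificate`). Kills: Philippon-style uniform `c'(n)` transplanted verbatim to the affine chart. Escape: `c = c(θ) ≳ log⁺ max‖θᵢ‖`.
* **N3.3 `scaleExponent_false`, `scaleExponent_false_at_liouville`** (`ScaleExponentLiouville.lean`; Disproof `not_apScaleWith_liouville`,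
  `apScaleExponentDegOne_false`). The OUTPUT-INDEPENDENT accuracy `exp(−ΔY/c)` in place of `exp(−(log H·Δ + d·Y)/c)` makes the `t = 1` slice FALSE at every
  Liouville number (Laurent–Roy 1999 pp. 27–28 remark, sharpened to a pointwise constant); witness `Σ 2^{−k!}`. Kills: "scale-exponent" restatements. Escape:
  the exponent must be in the OUTPUT `(d, H)`.
* **N3.4 `approximationProperty_false_without_trdeg`, `exponent_sharp`, `approximationProperty_false_with_trdeg_succ`** (Disproof §6–§7, workfile-grade but
  sorry-free: `stage_not_apWith`, `not_apAt_one_radicalLiouvillePair`, `exists_tuple_trdeg_le_not_apAt`). Liouville repulsion near radicals (landed: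
  `radical_repulsion`, `RadicalRepulsion.lean`) forces: at the radical-Liouville pair the property with exponent `t = 1` FAILS for every `c`, and at every level
  `t` the radical-Liouville `(t+1)`-tuple (`trdeg ≤ t+1`) defeats exponent `t`. Kills: weakening `trdeg ℚ(θ) ≤ t` to `≤ t + 1`, i.e. budgets `(cΔ)ᵗ` below
  the transcendence degree. Escape: any proof must genuinely USE `trdeg ≤ t` (these tuples are mandatory test points in the open regime `t ≥ 3`).
* **N3.5 lever `OrbitClusterBound` (line `orbit-interpolation-determinant`, stub `stub_orbitClusterBound`): `orbitClusterBound_false_without_injective`,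
  `c₀_le_one_of_orbitClusterBoundWith`** (`OrbitClusterBoundShape.lean`) **and `orbitClusterBound_false_without_spanning`** (`OrbitClusterBoundSpanning.lean`).
  The bound `(c₀ k^{1+1/t} − k) log(1/r) ≤ C(δ h_K(1:β) + D log(D+1) + kδ log(2+‖x‖) + k log(δ+2))` on `k` DISTINCT conjugates of `β ∈ Kᵗ` within `r` of `x`:
  any admissible constant has `c₀ ≤ 1` (so the vacuity window `k ≤ c₀^{−t}` is forced: bounded clusters cost nothing); dropping `Function.Injective σ`
  (one embedding of `ℚ` counted `⌈2/c₀⌉` times) or the hypothesis "monomials of degree `≤ δ` in `β` SPAN `K`" (`K = ℚ(ζ_p)`, `β = 0`, all `p−1`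
  embeddings) makes it FALSE at `t = 1`. Escape: distinct embeddings AND `K = ℚ(β)` in degree `≤ δ`. Test family landed: Eisenstein orbits
  `(x₀^D + p x₁^D)` in Nesterenko's elimination language (`EisensteinOrbit.lean`: `one_div_le_projDist_pow`, `iabs_eis_le`, `iheight_eis_le`, `eis_interpolation`).
* **Dead / surviving lines (drefute `DREFUTE-orbit-interpolation-determinant{,-g2}.md`):** 0 stub-false, 0 misstated over 7 stubs of the picked line in two
  passes; `stub_cycleAPI_one` PROVED; `PICKED.md`: the crux "is reduced EXACTLY to `CycleAPIAt t`, `t ≥ 3`". Competing lines `cluster-killing-own-level`,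
  `arithmetic-chardin-philippon` have no landed stubs.

### C4 · support `EPiSimultaneousType` (`stmt-Schanuel-6118`, rank 4) and `EPiSimultaneousTypeEv` (`stmt-Schanuel-14975`; route `DiophantineDichotomy`) — the `(π, e)` simultaneous approximation measure
Statement (6118): `∃ a b C, a < 1 ∧ 0 < C ∧ ∀ d H (γ : Fin 2 → ℂ), [ℚ(γ):ℚ] ≤ d → (∀ i, ∃ P ∈ ℤ[X] ∖ 0, deg ≤ d, |coeff| ≤ H, P(γᵢ) = 0) → exp(−C(dᵃ log H + dᵇ))
≤ ‖γ − (π, e)‖`; 14975 = the EVENTUAL form `∀ d, ∃ H₀, ∀ H ≥ H₀, …`. These are EXACTLY the `s = (1, iπ)` instances of C5 (`khovanskiiApproxType_false_of_not_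
epiSimultaneousType`, `measureAt_one_I_pi_of_epiSimultaneousType`, `OfKhovanskiiApproxType.lean` + `LiftClause.lean`): a refutation of the pair kills the
general crux. With `EPiRace` (PROVED) each implies `e ⊥ π`. Dirs `Theorems/EPiSimultaneousType{,Ev}/Negative/`; workfile `Cruxes/EPiSimultaneousType/Disproof.lean`.

* **N4.1 Normal form (`crux_iff_normalised`, Disproof; `IrreducibleWitness.clause_irreducible` landed):** WLOG `0 ≤ a < 1`, `1 ≤ b`, `1 ≤ C`, and every
  annihilating `Pᵢ` irreducible of exact degree `[ℚ(γᵢ):ℚ]` at the price `log H ↦ log H + 3d`.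
* **N4.2 `epiSimultaneousType_false_with_neg_exponent`** (`NegExponentFalse.lean`): `a < 0` is FALSE (floor approximants `(⌊πN⌋/N, ⌊eN⌋/N)` at a level with
  `C dᵃ ≤ 1/2`). **`epiSimultaneousType_false_without_heightClause`** (ibid.): with the integer-polynomial clause deleted (only `[ℚ(γ):ℚ] ≤ d` kept) the measure is
  false for EVERY `(a,b,C)` (`d = 1`, `H = 0`, `Real.log 0 = 0`, rational points dense). Escape: `a ≥ 0`; the height clause.
* **N4.3 The window `1/2 ≤ a < 1`.** `a ≥ 1/2` is necessary MODULO Philippon's level-2 approximation property at `(π, e)` (a printed THEOREM, LNM 1752 Ch. 4 §4,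
  not yet vendored: `epiSimultaneousType_half_false_of_levelTwoAP`, `RaceHalfFalse.lean`, via the general race `epiSimultaneousType_race`: AP of level `t`
  contradicts every measure with `a < 1/t`), unconditionally INSIDE the route (`epiSimultaneousType_half_false_of_approximationProperty`: crux C3 refutes every
  witness with `a < 1/2`), independently MODULO Bugeaud 2003 + `e ∈ S` (coordinatewise linear approximability `hB`, inline hypothesis:
  `epiSimultaneousType_half_false_of_coordLinear`, `CoordinatewiseLinear.lean`; eventual form `epiSimultaneousTypeEv_half_false_of_coordLinear`), and
  UNCONDITIONALLY in the degree aspect: **`epiSimultaneousType_false_of_exponents_lt_half`** (`BoundedHeightHalf.lean`: height-3 β-expansion roots,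
  `BetaExpansion.lean`, admissible pairs at level `(n², 3)` within `16e^{−n}` of `(π, e)`) — no witness has `a < 1/2 ∧ b < 1/2`. Kills: the "generic
  exponent `1/n = 1/2`" sharpening of the pair crux (cf. C5 N5.4) is the floor, not slack; lines that would push single-variable thresholds below 1 are
  empty (`real_polyMeasure_false_of_exponent_lt_one`, `complex_polyMeasure_false_of_exponent_lt_one`, `DirichletPoly{,Complex}.lean`: NO complex number
  has a polynomial measure with degree exponent `a < 1` — Dirichlet's box; so `PolyMeasure π a₁`, `PolyMeasure e a₂` exist only for `a₁, a₂ ≥ 1`).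
* **N4.4 `epiSimultaneousType_false_without_fieldDegree_of_coordLinear`** (mod `hB`), **`…Ev_false_without_fieldDegree_of_coordLinear`**, and unconditionally
  **`epiSimultaneousType_false_without_fieldDegree_of_exponents_lt_one`**: the COMMON-FIELD clause `[ℚ(γ₁, γ₂):ℚ] ≤ d` is load-bearing (it is what squares the
  level: coordinatewise challengers at level `n`, not `n²`). **`epiSimultaneousType_false_firstCoordOnly_of_b_lt_one`**: the first-coordinate-only strengthening
  (`|γ₁ − π|` in place of the sup norm) is false whenever `b < 1`. Escape: the common field; the `dᵇ` term with `b ≥ 1`.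
* **N4.5 `epiSimultaneousType_false_at_liouvillePoint`, `epiSimultaneousType_shape_not_uniform`** (`LiouvillePointNoMeasure.lean`): at `(L, L)`, `L = Σ 2^{−k!}`,
  NO measure of the crux's shape holds for ANY `(a, b, C)`; the uniform-in-the-point strengthening ("at every point of `ℂ²` with transcendental coordinates")
  is FALSE. Escape: Diophantine input SPECIFIC to `π` and `e` — the statement is about their arithmetic, not about transcendence.
* **N4.6 `epiSimultaneousType_false_of_levelOneAP`** (kernel of support `EPiRace`): the level-1 AP at `(π, e)` refutes the crux — settles nothing (that
  hypothesis holds iff `trdeg ℚ(π, e) = 1` by Laurent–Roy 1999, i.e. iff `e, π` are algebraically DEPENDENT): the route's race, not a kill.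
* **Eventual form (14975):** every bounded-height witness against 6118 leaves the kill surface; the unbounded-height family (`hB`) does not (`EPiSimultaneousTypeEv/
  Negative/CoordinatewiseLinear.lean`).

### C5 · support `KhovanskiiApproxType` (`stmt-Schanuel-6116`) and crux `KhovanskiiApproxTypeEv` (`stmt-Schanuel-14972`, rank 2; route `DiophantineDichotomy`, target `KhovanskiiSchanuel` `stmt-6115`)
Statement (6116): for `n ≥ 2` and every FREE KHOVANSKII point `θ = (s, e^s) ∈ ℂ²ⁿ` (`s` a non-degenerate zero of an `n × n` exponential-polynomial system over `ℚ`)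
with `LinearIndependent ℚ s`: `∃ a < 1/(n−1), b, C > 0, ∀ d H γ` (field degree `≤ d`, coordinates roots of non-zero integer polynomials of degree `≤ d`, height
`≤ H`): `‖γ − θ‖ ≥ exp(−C(dᵃ log H + dᵇ))`; 14972: eventually in `H` (`∀ d ∃ H₀(d) ∀ H ≥ H₀`). Vocabulary `ApproxTypeAt`, `ApproxTypeEvAt`, `IsFreeKhovanskii`,
`CodimOneMeasure`, `SlotFloor`, `LWSmallHeight` in `Theorems/DiophantineDichotomyDefs.lean` / `…KhovanskiiApproxTypeEvDefs.lean`. Dirs `Theorems/KhovanskiiApproxType{,Ev}/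
Negative/`; workfiles `Cruxes/KhovanskiiApproxType{,Ev}/Disproof.lean`.

* **N5.1 THE ENGINE `not_approxTypeAt_const_one` / `not_approxTypeEvAt_const_one`** (`LoadBearing.lean` ×2): at `θ = (1,…,1, e,…,e)` Diaz's theorem (Bugeaud 2004
  Thm 8.11, PROVED in tree `Literature.NumberTheory.DiophantineApproximation.Bugeaud2004_thm_8_11_holds`) gives challengers `(1,…,1, α,…,α)` of quality
  `0.006(n log M(α) + deg α · log M)`, linear in the budget, beating every `a < 1` (eventually in `H` too). Consequences: **`khovanskiiApproxType_false_without_linIndep`**,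
  **`…Ev_false_without_linIndep`** (`s = (1, 1)`, non-degenerate zero of `z₁−1 = z₂−1 = 0`): ANY proof must use linear independence to produce TWO independent
  transcendental directions among the coordinates of `θ`; **`…_false_without_twoLe`** (`n = 0`), **`…_false_from_one`** (`1 ≤ n`: at `s = (1)` the typed bound is
  `a < 1/0 = 0` and Diaz beats every `a < 1` anyway). Escape: `2 ≤ n`, `LinearIndependent ℚ s`.
* **N5.2 `khovanskiiApproxType_false_without_khovanskii`** (Disproof.lean, workfile; pieces landed: `LiouvilleTower.lean`, `WithoutKhovanskiiStage.lean` (`stage`),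
  `WithoutKhovanskiiPieces.lean`; the assembly `Negative/WithoutKhovanskii.lean` referenced but not in tree at compile time): the Khovanskii-system hypothesis is
  load-bearing — at the `ℚ`-free Gel'fond–Schneider-type point `s = (log 2, r log 2)`, `r = Σ 10^{−t(j)}` an ultra-Liouville tower, challengers
  `(qα, pα, 2, 2^{p/q}) ∈ ℚ(α, 2^{1/q})` with `α` Diaz's approximation of `(log 2)/q` beat every `(a,b,C)`. For the EVENTUAL crux this is an open NEAR-MISS
  (`khovanskiiApproxTypeEv_false_without_khovanskii` sorried in `Cruxes/KhovanskiiApproxTypeEv/Disproof.lean`). Escape: non-degeneracy (`IsFreeKhovanskii`).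
* **N5.3 `not_khovanskiiApproxTypeUniform`, `not_khovanskiiApproxTypeEvUniform`** (`NonUniform.lean` ×2): `(a, b, C)` (and, eventually, the thresholds `H₀(d)`)
  cannot be uniform in the point — the Lambert family `s_k = (x_k, √2 x_k)`, `k x_k e^{x_k} = 1`, of free Khovanskii points accumulates at the ALGEBRAIC point
  `(0,0,1,1)`, an admissible challenger with `d = H = 1`. NOT refuted: uniform `(a,b,C)` with point-dependent thresholds `H₀(d, s)` (a refutation would need a
  family with unbounded intrinsic exponent at fixed degree — "the same unconstructed object as a kill of the crux"). Escape: `C = C(θ)` blowing up near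
  algebraic points.
* **N5.4 `khovanskiiApproxTypeEv_false_sharp`, `khovanskiiApproxType_false_sharp`** (`KhovanskiiApproxTypeEv/Negative/ConjugateFloor.lean`): the crux CANNOT be
  sharpened to `a < 1/n` — at `n = 2`, `s = (1+i, 1−i)` (LW point) no eventual type has `a < 1/2`: challengers `(1+i, 1−i, α, ᾱ) ∈ ℚ(i, α, ᾱ)`, `α` Diaz's
  approximation of `e^{1+i}`, budget `d = 2n²`, `|e^{1−i} − ᾱ| = |e^{1+i} − α|` (complex-conjugation trick, no approximation property needed). Same on the non-LW
  layer at `s = (log 2i, log(−2i))` (`not_approxTypeEvAt_conjLogPair`, `ConjugateFloorLog.lean`). Windows forced: `evLWTwo_window`, `evNonLWTwo_window` — IF the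
  line's layer statements `EvLWTwo` / `EvNonLWTwo` hold, their exponent at these points lies in `[1/2, 1)`. Kills: "generic exponent `1/n`" versions; any layer
  statement claiming `a < 1/2` at conjugation-symmetric points.
* **N5.5 Dirichlet floors (line `lw-small-height`): `codimOneMeasure_false_of_lt`, `lwSmallHeight_exponent_sharp`, `nonLWInputsTwo_window`** (`CodimOneDirichlet.lean`:
  multivariate box principle `exists_mvPoly_small_value`; no decoupled codimension-one measure with degree exponent `μ < m` at ANY `ω ∈ ℂᵐ`; the stub
  `NonLWInputsTwo`'s race window forces `1 ≤ A < 2`, `2 ≤ μ < 3`), **`slotFloor_false_of_lt_one`** (`SlotFloorDirichlet.lean`: no slot floor with `A < 1` at any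
  `ξ ∈ ℂ`, Bugeaud Lemma 8.1), **`lwSmallHeight_false_without_linIndep`, `lwSmallHeight_false_without_algebraic`, `no_lower_bound_at_root`, `lwSmallHeight_zero`**
  (`LWStubsLoadBearing.lean`: the LW inputs need `y` algebraic AND `ℚ`-free; at a root of a non-zero integer polynomial NO lower bound of any shape exists; the
  guard `1 ≤ m` is decoration). Kills: measures/floors with sub-Dirichlet exponents; LW-type inputs at transcendental or dependent `y`.

### C6 · crux `AclSubsetLogFreeCore` (A) (`stmt-Schanuel-0968`, rank 2; route `RigidCore`) — `acl^{ℂ_exp}(∅) ⊆ C_EA`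
Statement: every complex number lying in a FINITE `∅`-DEFINABLE subset of `(ℂ, +, ·, −, 0, 1, exp)` (`expAcl`) lies in the log-free core
`C_EA = logFreeCore := sInf {K : IntermediateField ℚ ℂ | K relatively algebraically closed, 2πi ∈ K, exp-closed}` (`= K_ω`, the explicit tower
`stage 0 = ℚ(2πi)^{ralg}`, `stage (n+1) = ℚ(Kₙ ∪ exp Kₙ)^{ralg}`: `logFreeCore_eq_Komega`). The converse inclusion `C_EA ⊆ acl(∅)` is PROVED (support
`LogFreeCoreSubsetAcl` `stmt-0972`, `logFreeCore_subset_expAcl`), so (A) ⟺ `acl(∅) = C_EA` (`aclSubsetLogFreeCore_iff_eq`): the bound cannot be improved.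
Dir `Theorems/AclSubsetLogFreeCore/Negative/` (21 files, objects in `LogFreeCoreObjects.lean`); workfile `Cruxes/AclSubsetLogFreeCore/Disproof.lean`.

* **N6.1 Equivalent forms (no kill; what the crux IS).** (A) ⟺ `dcl^{ℂ_exp}(∅) ⊆ C_EA` ⟺ every `∅`-definable REAL number lies in `C_EA`
  (`aclSubsetLogFreeCore_iff_expDcl`, `…_iff_real`, `AclSubsetLogFreeCoreIffReal.lean`: `∅`-definable sets are `conj`-stable, `dcl(∅) ⊆ ℝ`, symmetric
  functions of finite definable sets are definable points); ⟺ `acl(C_EA) = C_EA` (`aclSubsetLogFreeCore_iff_modelAcl_logFreeCore`, `AclIdempotent.lean`: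
  `acl` is idempotent, parameters from the core are FREE — `acl(P) ⊆ C_EA ⟺ (A) ∧ P ⊆ C_EA`, `modelAcl_pi_subset_iff`, `modelAcl_int_subset_iff`).
  Both sides are countable (`countable_expAcl`, `countable_logFreeCore`) and `conj`-stable (`conj_mem_logFreeCore`): no counting argument and no known
  automorphism separates them. A refutation must exhibit a pointwise `∅`-definable REAL outside `K_ω` (`not_crux_iff`, Disproof; both halves open).
* **N6.2 `aclSubsetLogFreeCore_false_without_finite`** (`LogFreeCoreCountable.lean`): `ℂ` is `∅`-definable, `C_EA` countable. **`…_false_with_params_univ`,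
  `…_false_with_params_real`, `…_false_with_one_real_param`**: parameters are fatal iff outside `C_EA` (`not_modelAcl_singleton_subset_of_not_mem`).
  Escape: FINITENESS (beyond countability, N6.5) and PARAMETER-FREENESS — any proof must see the difference between `ℂ_exp` and `(ℂ_exp, one real constant)`.
* **N6.3 `aclSubsetLogFreeCore_false_without_expClosed`, `…_false_without_period_and_exp`** (`ExpAclDefinability.lean`): with the `exp`-closure of the core
  dropped (core `ℚ(π)^{ralg} ∋ 2πi`) (A) fails at `e^π ∈ dcl(∅)` (Nesterenko: `exp_pi_not_mem_Kpi`); with both transcendental inputs dropped it fails at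
  `e ∈ dcl(∅)` (Hermite) — unlike the pure field, `acl^{ℂ_exp}(∅) ⊄ ℚ̄`; pointwise `π, e^π, e ∈ dcl(∅)` (KMO 2012 §2: `intSet = ℤ`, `kerGenSet = {±2πi}`,
  `piSet = {π}`). Escape: `exp`-closure and the period `2πi` in the core.
* **N6.4 `not_branchIndiscernibility`** (`BranchParity.lean`) — REFUTED STRENGTHENING of the route's slogan "`ℂ_exp` does not know which logarithm is real":
  the PARITY of a branch of `log 2` is `∅`-definable (`√2 = e^u + e^{−u}` with `8u` a kernel generator is pointwise definable, `sqrtTwoSet = {√2}`;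
  `branchParitySet ∋ ln 2 ∌ ln 2 + 2πi`). Kills: BI₂-type instance lemmas "every `∅`-definable set contains all `2πiℤ`-translates of a logarithm of 2" —
  they must be stated MODULO `4πi` (index-2 Kummer obstruction). The Kummer LADDER (`KummerLadder.lean`, `definable₁_branchClass_iff`): rung `n`
  ("`ln 2 + 2πinℤ` is `∅`-definable") ⟺ `2^{1/n} ∈ dcl(∅)`; rungs 1, 2 HOLD, rung 3 ⟺ KMO's OPEN question `2^{1/3} ∈ dcl^{ℂ_exp}(∅)` (predicted false,
  `Literature.ModelTheory.ExponentialFields.KMOTheoremTwoComplex`). Also refuted misreading `not_logFreeCore_subset_expDcl` (`C_EA ⊄ dcl(∅)`: `2πi` is not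
  pointwise definable, `two_pi_I_not_mem_expDcl`).
* **N6.5 Countable variant (A_ℵ₀) is NOT a route to (A)** (`CountableVariant.lean`): "every COUNTABLE `∅`-definable set lies in `C_EA`" forces `ln 2 ∈ C_EA`
  (`log_two_mem_logFreeCore_of_countableVariant`) and closure of `C_EA` under EVERY branch of log of its elements (`log_mem_logFreeCore_of_countableVariant`,
  `log_pi_mem_logFreeCore_of_countableVariant`) — SC-false (`K_ω` is the FREE EA-closure of `ℚ(2πi)`, not L-closed). Kills: replacing `ecl ∅` by `C_EA` in
  "countable definable sets lie in `ecl ∅`" (EAC + CCP). Escape: genuine finiteness.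
* **N6.6 Calibrations — (A) is not soft** (`LogTwoHub.lean`, `LogTwoBranchRelations.lean`, `LogTwoPolynomialRelations.lean`, `RealDefinableCalibration.lean`):
  the hub `T₂ ∩ acl(∅) ≠ ∅ ⟺ ln 2 ∈ dcl(∅) ⟺ ln 2 ∈ acl(∅)` (conjugation averaging); (A) at `T₂` is `ln 2 ∈ dcl(∅) → ln 2 ∈ C_EA`; (A) ⟹ `ln 2 ∈ C_EA`
  (SC-false) ∨ no branch of `log 3` is an integer polynomial in a branch of `log 2` (`logFree_or_noPolyRelation_of_crux`, UNCONDITIONAL, Hermite–Lindemann only;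
  already `ln 3 ∉ {m ln²2 + r}` is unknown); with Theorem L = support `TwoLogsBranchRelationFinite` (`stmt-0975`, now PROVED) (A) ⟹ `ln 2 ∈ C_EA ∨ (log 2 ⊥ log 3`
  in all branches`)` (`logFree_or_allBranchIndep_of_crux`); (A) ∧ `Def_∅(ℝ)` ⟹ `ln 2, ln π, ln ln π ∈ C_EA` (`log_log_pi_mem_logFreeCore_of_real_definable`), so
  (A) ∧ SC ⟹ `ℝ` is NOT `∅`-definable in `ℂ_exp` (Koiran / Zilber–Wilkie question, open). Symmetry ⟹ transcendence: ONE automorphism of `ℂ_exp` moving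
  `ln 2` settles (A)|_{T₂} and gives `ln 3 + 2πik ∉ ℤ[ln 2 + 2πij]` unconditionally (`noPolyRelation_of_equiv_apply_ne`). A refutation of (A) produces a real
  outside `C_EA` fixed by EVERY automorphism (`exists_fixed_real_not_mem_of_not`); a refutation compatible with EAC proves `ecl ∅ ⊄ C_EA` for an explicit number
  (`not_ecl_subset_logFreeCore_of_not_of_eac`) — no known transcendence theorem provides one. Kills: any "purely model-theoretic" proof or disproof of (A).
* **N6.7 Residue stubs of the two registered lines (`eac-extends-core-automorphisms`, `eac-homogeneity-collapse`; `Fix(Aut_E(C₀)) ⊆ C_EA`, `C₀ = ecl ∅`):**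
  `CoreAutConj.lean` (`conj` is a core automorphism, `Aut_E(C₀)` non-trivial, fixed elements are REAL: `coreFixedLogFree_iff_real`); `CoreAutRigidity.lean`
  (every core automorphism is `ℚ`-linear, respects the kernel, sends `2πi ↦ ±2πi`, `i ↦ ±i` with the same sign, FIXES `π, e, e^π, √2`, moves `ln 2` only
  by `4πiℤ`; `stubCoreFixedField_false_without_expClosed` (`e^π`), `…_without_period_and_exp` (`e`)); `CoreAutWild.lean` (TAME core automorphisms — mapping
  real elements to reals — are `id` or `conj`; if those are the only ones the residue stub ⟺ `ecl ∅ ⊆ C_EA`, SC-FALSE via the real root `x₀ = −Ω` of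
  `eˣ + x = 0` (`exists_real_exp_add_self_eq_zero_mem_ecl_empty`): `stubCoreFixedField_iff_of_rigid`; so the stub needs a WILD automorphism moving some real
  exponentially-algebraic number: `exists_real_moved_of_stub_of_not_mem`); `CoreFixedFieldForms.lean` ((i) ⟺ `A⁺`-form ⟺ "every real `x ∈ C₀ ∖ C_EA` is moved",
  `coreFixedFieldLogFree_iff_real_moved`). Kills: lines expecting the residue from `id`/`conj`-type symmetry or from order-preserving automorphisms.
* **N6.8 The doubling engine's fuel is Schanuel** (`DoublingCalibration.lean`): `GammaField.IsStrong (ℚ·2πi)` ⟺ `SchanuelProperty ℂ`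
  (`isStrong_span_two_pi_I_iff_schanuelProperty`, Bays–Kirby Thm 9.1); hence the base hypothesis `hX` of `stub_doubleModel` / `stub_realiseCopy` / `hullToCore`
  at the empty tuple IS the summit (`isStrong_doublingBase_nil_iff_schanuelProperty`) and holds under the line's standing `IsZilberField ℂ` only together with it.
  `DoubleInterface.lean`: `hlin` redundant in `stub_doubleBase`; the interface pins `τ = ±2πi` (`eq_or_eq_neg_of_doubleInterface`); kernel obstruction
  `sub_mem_zmultiples_of_doubleInterface` (an element of `W` whose exponential both copies agree on is moved only inside `ℤt` — kills the general-position
  clause for L-type elements). `CaseIIPeriodicity.lean`: polynomial with a non-zero period is constant; constant first difference ⟹ affine (for `stub_caseII`).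
  `StandardKernelTwistLinear.lean` (part 1 of "the standard-kernel axioms do not force (A)"; Hamel-basis extension lemma, `logKpi`; the twist assembly
  `Negative/StandardKernelTwist.lean` referenced, not in tree at compile time). Kills: reading line `eac-extends-core-automorphisms` as unconditional — it is a
  Zilber-conditional programme whose Case I at `U* = Λ₀` consumes SP itself.
* **Dead / costume lines (drefute gen 1–4, `Cruxes/AclSubsetLogFreeCore/Drefute*.md`):** `stub_zilber` = COSTUME (standing hypothesis containing the summit,
  gen 3); `stub_doubleModel` misstated (insert `hX`); `stub_doubleBase`, `stub_caseII` survived; `stub_logShift`, `stub_realiseCopy`, `stub_caseI` LANDED.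

### C7 · crux `MinimalCounterexampleInAcl` (S*) (`stmt-Schanuel-0969`, rank 3; route `RigidCore`; rank-`≥ 3` twin `MinimalCounterexampleInAclGeThree` `stmt-14744`; the rank-2 case follows from `SparsityTwo` by the PROVED glue `MinimalCounterexampleInAclOfSparsityTwo` `stmt-14765`)
Statement: `∀ n (x : Fin n → ℂ), LinearIndependent ℚ x → trdeg ℚ(x, eˣ) < n → (∀ r < n, SchanuelRank r) → ∀ i, ∃ s finite ∅-definable (L_exp), x i ∈ s` — a
FIRST FAILURE of Schanuel has all coordinates in `acl^{ℂ_exp}(∅)`. With C6 and `SchanuelOnLogFreeCore` (C8) the route's `closes` is a strong induction.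
Dir `Theorems/MinimalCounterexampleInAcl/Negative/`; workfile `Cruxes/MinimalCounterexampleInAcl/Disproof.lean` (gen 4).

* **N7.1 RESISTANCE: `minimalCounterexampleInAcl_of_schanuel`, `exists_firstFailure_of_not_schanuel`** (`LoadBearingHypotheses.lean`): the crux is IMPLIED by
  Schanuel and its antecedent is satisfiable iff Schanuel FAILS — irrefutable short of an explicit counterexample; every stub carrying `IsFirstFailure x` or
  `δ(span x') ≤ −1` is vacuously true under SC (`not_schanuelRank_of_predim_le_neg_one`, `LocusMates.lean`). Also `uniformVersion_iff_schanuel` (Disproof): the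
  uniform version is EQUIVALENT to Schanuel — not a usable strengthening.
* **N7.2 `not_withoutTrdeg`** (ibid.): drop `trdeg < n` ⟹ FALSE by counting (`acl(∅)` countable, `x = (c)` generic). **`not_schanuelRank_two_of_withoutLinIndep`,
  `not_schanuel_of_withoutLinIndep`**: drop LI ⟹ the constant triple `(c,c,c)` (`trdeg ≤ 2 < 3`) puts every `c` in the countable `acl(∅)` — the LI-free version
  REFUTES Schanuel while the crux is implied by it. **`withoutFirstFailure_defectLeOne`**: dropping `∀ r < n, SchanuelRank r` costs "defect `≤ 1` at every rank"
  (Schanuel-strength minus one, by padding). `withLe_…`: `≤` for `<` would put every branch of every `log α`, `α ∈ ℚ̄ˣ`, into `acl(∅)` (not refutable today).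
  Escape: all three hypotheses, with STRICT `<`.
* **N7.3 First-failure structure (support, PROVED):** `firstFailure_two_le` (rank `≥ 2`), `firstFailure_trdeg_eq` (defect EXACTLY one: `trdeg = n − 1`),
  `firstFailure_mem_ecl` (Kirby Prop. 7.2 in first-failure form: coordinates in `ecl ∅`; so `minimalCounterexampleInAcl_iff_eclVersion` and the crux follows from
  the open, Zilber-false-in-general inclusion `ecl ∅ ⊆ acl(∅)` — `minimalCounterexampleInAcl_of_ecl_subset_expAcl`) (`FirstFailureEcl.lean`); `firstFailure_khovanskii`
  (`KhovanskiiPoint.lean`: a first failure is a NON-DEGENERATE Khovanskii point of its own `ℚ`-locus, mates are isolated — Khovanskii dichotomy + Ax with its rank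
  term); `mate_firstFailure` (`MateTrdeg.lean`: locus mates of first failures are first failures); `isolationFree`, `definable_linearIndependent` (`IsolationFree.lean`:
  `ℚ`-linear independence is ONE `∅`-formula, `ℤ` being `∅`-definable; finitely many locus mates ⟹ coordinates `∅`-algebraic), hence
  **`minimalCounterexampleInAcl_of_firstFailureSparsity`**: the open content of (S*) is pure unlikely-intersection finiteness ("a first failure has only finitely
  many locus mates"), NOT model theory.
* **N7.4 `trdeg < n` is load-bearing in every registered stub of line `kernel-arithmetic-selection`** (`TrdegLoadBearing.lean`): `endgame_false_without_trdeg`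
  (`n = 1`, `x = (2πi)`: fibre of `{Y = 1}` is all of `ℂ`), `expImageFiniteOffLog_false_without_trdeg` (`x = (π)`, Nesterenko: locus = `ℂ²`, mates everything,
  infinitely many exponential images), `mateLocusEq_false_without_trdeg` (`x = (π)`, `x' = (1)`); and with `<` weakened to `≤`:
  **`expImageFiniteOffLog_false_withLe`** (`DefectZeroOffLog.lean`: the defect-ZERO pair `(πi, π)` — LI, `trdeg = 2` by Nesterenko, ranks 0,1 hold, `e^π` transcendental —
  has the mates `((2k+1)πi, (2k+1)π)` with pairwise distinct exponential images, via `AlgebraicIndependent.extendScalars` to `ℚ(i)`), while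
  `branchFiniteness_rankTwo_withLe_holds_at_piPair` (`BranchFinitenessDefectZero.lean`) records that the SAME witness does NOT refute the `≤`-weakening of the
  rank-2 branch-finiteness stub (only `k = (0,0), (−1,0)` are on the locus). **`finiteRankCase_false_without_firstFailure`** (`LocusMates.lean`): "mates confined to a
  finite-dimensional `ℚ`-space are finitely many" is FALSE for the defect-zero tuple `(2πi)` (mates `(2πik)`, all in `span{2πi}`) — isolation (`dim W < n`) is what
  every finiteness stub consumes. Escape: `dim W = trdeg < n` (isolation of graph points), not merely defect `≤ 0`.
* **Dead / surviving lines (drefute `DREFUTE{,-G2}-kernel-arithmetic-selection.md`):** 0 stub-false, 0 misstated; open stubs `stub_branchFiniteness_rankTwo`,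
  `stub_sweepToSubspace_higherRank` (no `_false_without_` lemma exists for it: the sweep consumes none of its hypotheses), `stub_expImageFinite_offLog`; every
  would-be witness at rank 2 is an open independence statement (`(1, 1+πi)` ⟺ `e ⊥ π`, `(πi, πi + log 2)` ⟺ `π ⊥ log 2`). Disproof gen 4: a refutation at rank 2
  needs an UNBOUNDED family of mates (`IsFirstFailure.exists_large_mate_of_infinite`); the non-isolated part of `𝒵_W` is `ℚ`-linearly dependent
  (`IsFirstFailure.not_linearIndependent_of_accumulation`).

### C11 · crux `TateLocusGPCOne` (`stmt-Schanuel-17406`, crux rank 9 — a support rung, NOT a binder of `closes`; route `TateNomes`; the binder `TateLocusGPC` `stmt-17404` is its several-nome version) — André's GPC for the non-CM Tate 1-motive, point by point (generation 2)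
Statement: `∀ τ : ℂ, 0 < Im τ → (∀ b c : ℚ, τ² + bτ + c ≠ 0) → 5 ≤ trdeg_ℚ ℚ(2πi, τ, q, P(q), Q(q), R(q))`, `q = e^{2πiτ}`, `P, Q, R` = Ramanujan's
`q`-series (`rfl`-equal to `Literature.Barriers.Schanuel.ramanujanP/Q/R`). IDENTITY OF THE STATEMENT (Disproof §0): with the lattice `ℤ + τℤ`,
`ℚ(2πi, τ, q, P, Q, R) = K(ω₁, ω₂, η₁, η₂, 2πi, log q)`, `K = ℚ(g₂, g₃, q)` = the field of periods of the 1-motive `M_τ = h¹(E_τ) ⊕ [ℤ → 𝔾_m; 1 ↦ q]`; for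
non-CM `τ` and non-torsion `q`, `dim G_mot(M_τ) = 5` EXACTLY — the crux is André's generalised period conjecture for `M_τ` at every admissible `τ`
(= Bertolin–Waldschmidt arXiv:2504.14048 Conj. 2.1 at `(s, n) = (1, 2)` = Nesterenko's Conj. 1.11 corrected + `2πi`), with NO slack anywhere on the domain.
Dir `Theorems/TateLocusGPCOne/Negative/` (4 files: `…LoadBearing` p143528, `…Calibration`, `…Generators`, `…AlgebraicNome`; namespace
`Summit.Schanuel.Schanuel.Theorems.TateLocusGPCOne.Negative`); workfile `Cruxes/TateLocusGPCOne/Disproof.lean` (re-exports them; verdict NO KILL, GPC-grade).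

* **N8.1 `tateLocusGPCOne_false_without_nonQuadratic`, `not_tateLocusGPCOne_four_without_nonQuadratic`, `tateLocusGPCOne_cm_calibration`** (`…LoadBearing.lean`,
  `…Calibration.lean`). Dropping "τ non-quadratic" is FALSE at `τ = i`: `R(e^{−2π}) = E₆(i) = 0`, `P(e^{−2π}) = 3/π` (`ramanujanP_at_I`, `ramanujanR_at_I`), so
  `trdeg ℚ(2πi, i, e^{−2π}, P, Q, R) = 3` EXACTLY (upper bound elementary, lower bound = Nesterenko `nesterenko1996_thm_1_1_holds`); even `4 ≤` fails without
  non-CM. The CM exclusion is worth TWO degrees (`dim GL₂ − dim T = 2`) — exactly the `τ` and `π` the crux asks for beyond Nesterenko's three. Escape: non-CM.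
* **N8.2 `tateLocusGPCOne_false_without_imPos`** (`…Calibration.lean`; `not_summable_sigma_mul_pow`, `one_le_norm_nome_tau1`). `0 < Im τ` is the CONVERGENCE
  hypothesis: at `τ₁ = −i·2^{1/4}` one has `|q| ≥ 1`, the `q`-series diverge, `tsum` returns the junk value `0`, `P = Q = R = 1` and `trdeg ≤ 2`. Kills: any
  Tate-locus crux quantified over `τ ∈ ℂ` (or `q ∈ ℂˣ`) without `|q| < 1` — checklist item 15.
* **N8.3 generator deletions: `tateLocusGPCOne_false_without_gen_twoPiI / _q / _P / _Q / _R`** (`…Generators.lean`, at the algebraic `τ₀ = i·2^{1/4}`: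
  `quartic_witness_nonQuadratic`, `quartic_witness_isAlgebraic`, five generators one of them algebraic ⇒ `≤ 4`) **and `tateLocusGPCOne_false_without_gen_tau`**
  (`…AlgebraicNome.lean`, at the ALGEBRAIC NOME `q = α = (3+4i)/10`, `τ_α = log α/2πi`: `tauAlpha_im_pos` (`Im τ_α = log 2/2π`), `tauAlpha_nonQuadratic` — a
  non-real quadratic has rational real part, and `Re τ_α ∈ ℚ` would make some `(3+4i)ⁿ` real, excluded by `(3+4i)ⁿ ≡ 3+4i (mod 5)`
  (`im_three_add_four_I_pow_ne_zero`), `isAlgebraic_alpha0`). Every one of the six numbers carries a full degree somewhere on the domain; in particular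
  "`5 ≤ trdeg ℚ(τ, q, P, Q, R)`" is FALSE (the right exp-free claim is Conj. 1.11-corrected's `4`). Escape: keep all six generators.
* **N8.4 tightness / non-vacuity: `not_tateLocusGPCOne_six`, `tateLocusGPCOne_hypotheses_satisfiable`** (`…LoadBearing.lean`, `τ₀`),
  **`trdeg_le_five_at_algebraic_nome`, `tateLocusGPCOne_hypotheses_at_algebraic_nome`** (`…AlgebraicNome.lean`). `6 ≤` is FALSE; on both the algebraic-`τ`
  fibre and the algebraic-nome fibre the claimed `5` is the maximum possible, so the crux predicts EXACT values there (full algebraic independence of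
  `π, q, P, Q, R`, resp. of `2πi, log α, P(α), Q(α), R(α)`). Certified test points with NO transcendence input: `τ₀ = i·2^{1/4}`, `τ_α`, the excluded CM point
  `τ = i` (value 3). The `(e, π)` fibre `τ = i/2π` needs `π² ∉ ℚ` for non-quadraticity (not in Mathlib; flagged for `EPiOfTateOne` 17301).
* **Workfile extras (Disproof §4, `StrategistSketch.lean`, `Lines/Sketch-dead.md`).** The strategist's additive split `NesterenkoTau ∧ PiRigidity` is an
  EQUIVALENT reformulation (glue both ways), not a strengthening; the line stub `TwoNomeS` (`6 ≤ trdeg ℚ(q, P, Q, R, q′, P′, Q′, R′)`, `q′ = e^{−2πi/τ}`, card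
  `s-dual-second-cusp`) is GPC for `h¹(E_τ) ⊕ [ℤ² → 𝔾_m]` (`dim 6`), STRONGER than the crux and equally unattackable — line `Sketch` DEAD at `stub_twoNomeS`; its
  only cheap boundary is the same CM collapse (`τ = i`: `q′ = q`). What a proof must deliver (so provers cannot close it cheaply either): `e ⊥ π` (`τ = i/2π`),
  `π ⊥ log α` for algebraic `0 < |α| < 1`, GPC for non-CM elliptic curves over `ℚ̄`, `π ⊥ e^{2πiτ}` for algebraic `τ` of degree `≥ 3`. Numerics attached to the item
  (PSLQ, no relation found): j022965, j025311, j024231, j025152, j025976 (`E₂*`-combinations at non-CM algebraic `τ`: GPC predicts no hit). Open disprover-wanted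
  (not a typed target): a METHOD no-go "linear cusp conditions at two multiplicatively independent nomes + finitely many algebraic relations ⇒ smallness
  exponent `≤ 4`" (card `cusp-budget-lemma`), i.e. a B5-type barrier for several nomes.

### C12 · crux `NomeHygiene` (`stmt-Schanuel-17298`, rank 3; route `TateNomes`) — CLOSED · PROVED (`Theorems/TateNomesNomeHygiene.lean` `NomeHygiene_proof` @ f9e000de57c3; line `integer_shift_rebase`, stubs `stub_shiftCoincidence` p157715, `stub_shiftedTateBasis` p157723) — load-bearing census of a theorem (generation 2)
Statement (informal): for `ℚ`-linearly independent `z : Fin n → ℂ` there are `k ≤ 3` auxiliary numbers `e` (each algebraic or with algebraic exponential)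
and a basis `w` of `span_ℚ(z, e)` in TATE POSITION (`2πi ∈ span w`, the nomes `e^{w_j}` pairwise `GL₂⁺(ℚ)`-inequivalent, `τ_j` non-quadratic …). No
counterexample exists; the entries record WHY each feature is needed — briefing for neighbouring items. Dir `Theorems/NomeHygiene/Negative/`
(`LoadBearing.lean`, `CubicTrap.lean`; namespace `…Theorems.NomeHygiene.Negative`); workfile `Cruxes/NomeHygiene/Disproof.lean`.

* **N9.1 `nomeHygiene_false_without_linIndep`** (`LoadBearing.lean`). The rigid count `w : Fin (n + k)` + `LinearIndependent ℚ w` + span equality forces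
  `dim span(z, e) = n + k`, false for `z = 0 : Fin 1 → ℂ`. Escape: `LinearIndependent ℚ z` (checklist item 1).
* **N9.2 `no_tatePosition_of_le_two`, `three_le_of_tatePosition`, `not_nomeHygiene_k_le_two`** (`LoadBearing.lean`). NO tuple of length `≤ 2` is in Tate
  position (`2πi ∈ span w` makes a nome rational for `m = 1`, or gives the affine `GL₂⁺(ℚ)`-relation `τ₁ = ατ₀ + β`, `α > 0` forced by `Im τ > 0`, for `m = 2`);
  hence every witness has `3 ≤ n + k` and the strengthening "`k ≤ 2` always suffices" is FALSE (`n = 0` needs `k = 3`): the proved line's `k ≤ 3` is SHARP.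
* **N9.3 `nomeHygiene_false_without_expOption`** (`LoadBearing.lean`; Lindemann `transcendental_two_pi_I`). With only ALGEBRAIC auxiliaries `e`, `span(z, e) ⊆ ℚ̄`
  for `n = 0`, so `2πi ∉ span`. Escape: the disjunct `IsAlgebraic ℚ (exp (e i))` (the line adjoins `e = −1`-type logarithms).
* **N9.4 `cubicTrap`, `nomeHygiene_false_without_enlargement`, `not_finite_shift_coincidences`** (`CubicTrap.lean`). If `τ³ ∈ span_ℚ(1, τ, τ²) =: K` (a cubic
  field) then ANY two points of `K ∩ ℍ` are `GL₂⁺(ℚ)`-related (`1, x, y, xy` dependent in the 3-dimensional algebra `K`; sign of the determinant from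
  `Im y·|cx+d|² = det·Im x`). Hence the `k = 0` form (re-base `span z` itself, no enlargement) is FALSE even with `2πi ∈ span z`, `n = 3`: cell
  `z = 2πi·(1, τ₀, τ₀²)`, `τ₀ = ∛2·e^{iπ/3}` (`τ₀³ = −2`, `minpoly_eq_of_cube`, `linearIndependent_one_self_sq`); and "at most two `t ∈ ℕ` make `u + t·v`
  equivalent to a given point" is FALSE for an ALGEBRAIC shift direction (`v = τ₀²`, `u = τ₀`: EVERY `t` is a coincidence). Kills: un-enlarged re-basing;
  shift arguments along algebraic directions. Escape (= the proved line): ENLARGE by one algebraic direction and shift along the transcendental `1/2πi`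
  (Key Lemma `stub_shiftCoincidence`: three coincidences on one line force `1/2πi` algebraic of degree `≤ 3`). No arithmetic of the `zᵢ` is ever consulted, so
  no configuration of `z` is adversarial — the only rigid constraints are the dimension count and Lindemann.

### C13 · crux `NomeTransfer` (`stmt-Schanuel-17405`, rank 9; route `TateNomes`) — CLOSED · PROVED (`Theorems/TateNomesNomeTransfer.lean` `NomeTransfer_of` @ dba8bbe5863b; line `trdeg-bookkeeping`, stubs `stub_envelopeCount`, `stub_spanDescent` p157988, `stub_algPairCost`) — which hypotheses carried the proof, and the summit hiding in the others (generation 2)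
Statement (informal): transfer of a transcendence-degree lower bound from the nome ENVELOPE `ℚ(w, e^w, P(e^{w}), Q, R)` of an admissible basis `w` of
`span(z, e)` back to Schanuel's inequality for `z`, with threshold `n + k + 3m`. Dir `Theorems/NomeTransfer/Negative/` (`CoreThresholdTight.lean` p159144;
namespace `…Theorems.NomeTransfer.Negative`); workfile `Cruxes/NomeTransfer/Disproof.lean` (verdict NO KILL — the crux is TRUE in a stronger form).

* **N10.1 `nomeTransferCore_false_below_threshold`** (`CoreThresholdTight.lean`; Disproof `not_nomeTransferCoreMinusOne`, `three_le_trdeg_ramanujan_half`).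
  The opaque core `NomeTransferCore` (no `LinearIndependent`, only `span ⊆`, the `3m` adjoined values ARBITRARY, `m` decoupled from `n + k`) holds with
  threshold `n + k + 3m` (`nomeTransferCore_holds`, composition of the three LANDED stubs) and that threshold is SHARP: witness `m = n = 1`, `k = 0`,
  `w = z = ![0]`, `(f, g, h) = (P, Q, R)(1/2)` — three algebraically independent numbers by Nesterenko — envelope trdeg `= 3 = n + k + 3m − 1` but
  `t(z) = 0 < n`. Kills: any sharpening of the constant (`4` per nome) by bookkeeping; it must look INSIDE `P, Q, R` (modular relations). Information for
  provers: `LinearIndependent ℚ z`, `span ⊇`, the `q`-series and the coupling `m = n + k` were NOT load-bearing.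
* **N10.2 `nomeTransfer_false_without_linIndep_and_envelope`** (`CoreThresholdTight.lean`; Disproof §2 `nomeTransferWithoutEnvelope_iff_schanuel`). Dropping the
  envelope hypothesis ALONE makes the crux literally Schanuel (`k = 0`; E6); dropping it together with `LinearIndependent` makes it FALSE (`z = ![0]`,
  `t(z) = 0 < 1`). Likewise (workfile §4–§5) dropping the span hypothesis or admissibility is Schanuel-equivalent modulo RICH NOME TUPLES (`RichNomeTuples c m`:
  `∃ w : Fin m → ℂ` with `c·m ≤ trdeg Env(w)` — TRUE by Mahler's functional independence `Mahler1969_ramanujan_algIndep_holds` + genericity, but the passage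
  functions → generic values is not in the tree and at every EXPLICIT nome only `3` is known, `three_le_trdeg_env_single` / `hypotheses_satisfiable_zero`).
  Kills: "NomeTransfer minus one hypothesis" as a new crux — it is either still a theorem, or the summit, or false.

### C14 · crux `CountingGapHigher` (`stmt-Schanuel-16237`, rank 2; route `RelationCounting`; siblings `CountingGapPair` 16238 (`k = 1`), `Amplification` 16239, support `FirstFailurePresentation` 16240) — Schanuel IMPLIES the crux: counted points are counterexamples (generation 2)
Statement (informal): an exponent GAP in the count of points carrying `k + 2` independent integer relations of bounded degree/height near a first-failure
presentation (o-minimal relation counting in the degree aspect, Bombieri–Pila / Pila–Wilkie / Binyamini–Novikov–Zak). Dir `Theorems/CountingGapHigher/Negative/`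
(`CountedPoints.lean`; namespace `…Theorems.CountingGapHigher.Negative`); evidence file `SchanuelImpliesCountingGapHigher.lean` attached to the item, not landed.

* **N11.1 `natCast_add_le_card_of_jacobian`, `not_schanuel_of_counted`** (`CountedPoints.lean`). JACOBIAN CRITERION: `s` integer polynomial relations at a point
  of `ℂ^σ` whose gradients are `ℂ`-linearly independent force `trdeg + s ≤ #σ`; hence a COUNTED point of the crux (a `ℚ`-free `n`-tuple with `k + 2` relations
  among `(x, eˣ)` with independent gradients, in the crux's normalisation) has `trdeg ℚ(x, eˣ) < n` and REFUTES Schanuel. So `Schanuel ⟹ CountingGapHigher`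
  (all counted sets are empty; constants `M = k + 2`, `κ = 0`, `C = 0` work): the route's kill criterion (i) is SETTLED NEGATIVE and the crux is irrefutable short
  of `¬SC` — exactly the C7 / C8 situation. Kills: refutation attempts by exhibiting counted points; "the count is non-trivial" heuristics. Escape / open
  content: an UNCONDITIONAL count with exponent governed by the deficit `k` (the bet of the route), for which B11's first-failure structure and B3 (no lower
  bound for `|P|` needed in counting) are the relevant placements.

### C15 · crux `TwistedSymmetry` (`stmt-Schanuel-17222`, rank 2; route `TwistedConjugacy`, DRAFT; supports `TwistImpliesEPi` 17226, `TwistImpliesLogHomogeneity` 17229, `TwistImpliesTowerPi` 17225 …) — forced values and wildness of any exponential twist (generation 2)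
Statement: `∃ μ : ℂ, IsAlgebraic ℚ μ ∧ ‖μ‖ = 1 ∧ (∀ n ≥ 1, μⁿ ≠ 1) ∧ ∃ σ : ℂ →+* ℂ, (σ fixes ℚ̄) ∧ ∀ z, σ (exp z) = exp (μ · σ z)` — a char-0 analogue of
Denis's twisted Frobenius symmetry of the Carlitz exponential. Dir `Theorems/TwistedSymmetry/Negative/` (`ForcedValues.lean` p146597, `NoMeasurableTwist.lean`
p171029; namespace `…Theorems.TwistedSymmetry.Negative`); census `Cruxes/TwistedSymmetry/STRATEGY-CENSUS.md` (verdict `no-strategy`: TS is Zilber's conjecture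
in costume on the part the route uses — `(SC ∧ SEAC) ⟹ ℂ_exp ≅ 𝔹 ≅ (ℂ, exp∘(μ·))` by categoricity — and exceeds the summit on the rest; `S → TS` unknown).

* **N12.1 forced values: `twist_log_scaling`, `twist_two_pi_I`, `twist_pi`, `twist_fixes_exp_pi`, `twist_exp_one`, `twist_fixes_exp_alg_mul_log`,
  `forced_values_of_twistedSymmetry`** (`ForcedValues.lean`). Any twist `(μ, σ)` satisfies `μ·σ(ℓ) = ℓ` for EVERY logarithm `ℓ` of an algebraic number
  (`eq_zero_of_forall_int_multiple`: `σ(ℓ) − ℓ/μ` has all integer multiples in the discrete kernel direction), hence `σ(2πi) = 2πi/μ`, `σ(π) = π/μ`,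
  `σ(e^π) = e^π`, `σ(e^{aℓ}) = e^{aℓ}` for algebraic `a` (so `σ` FIXES `2^{√2}`, `e^π`, …) and `σ(e) = e^μ`: the twist rescales `𝓛 = exp⁻¹(ℚ̄)` by `1/μ` and
  moves `e` to `e^μ` — every consequence the route wants (`e ⊥ π` via `TwistImpliesEPi`, log-homogeneity, tower statements) is read off these identities +
  Lindemann–Weierstrass / Gel'fond–Schneider at the manufactured algebraic points `μ^k·α`. Kills: twists normalised differently (e.g. "σ fixes π" or "σ fixes
  e" is inconsistent with `μ ≠ 1`).
* **N12.2 `twist_ne_id`, `twist_ne_conj`, `twist_not_continuous`, `not_twistedSymmetry_continuous`; `twistedSymmetry_dropRootOfUnity_trivial`,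
  `twistedSymmetry_mu_ne_one`, `admissible_mu_exists`** (`ForcedValues.lean`). A twist is neither the identity nor complex conjugation, hence DISCONTINUOUS
  (the only continuous ring endomorphisms of `ℂ`); the CONTINUOUS version of the crux is FALSE; dropping "μ not a root of unity" trivialises it (`μ = 1`,
  `σ = id`), and `μ ≠ 1` is forced; admissible `μ` exist (`μ₀ = (3+4i)/5`: algebraic, norm 1, not a root of unity — `μ₀_pow_ne_one`), so the hypotheses on
  `μ` are satisfiable and not the obstruction.
* **N12.3 `twist_not_measurable`, `not_twistedSymmetry_measurable`, `twistedSymmetry_witness_not_measurable`** (`NoMeasurableTwist.lean`; Steinhaus–Pettis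
  automatic continuity `MeasureTheory.Measure.AddMonoidHom.continuous_of_measurable`). Any witness `σ` is NON-MEASURABLE: Denis's twist in characteristic `p`
  is continuous, its char-0 analogue can only be a wild automorphism-type map (choice), so NO explicit / analytic / definable construction of `σ` exists and
  every "construct the twist" line is dead on arrival; existence can only come from abstract model theory (categoricity of `𝔹` — i.e. through Zilber's
  conjecture H1, which CONTAINS the summit). Kills: constructive, topological, measurable, Baire or definable twists; transfers of Denis's proof that use
  continuity. Escape: none cheaper than `SC ∧ SEAC`; the census recommends re-targeting to the provable-now supports (`TwistImplies…`) as conditional content.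

---

## 5. Standing-disprover workfile findings for cruxes without a `Negative/` directory, and the dead-line ledger

Workfiles `Cruxes/<Crux>/Disproof.lean` elaborate on the farm (`sorry` only inside theorems marked NEAR-MISS); they are NOT gate proposals. Re-check a
theorem before importing its content into a route; many have twins already landed under `Theorems/…` (§4).

### C8 · crux `SchanuelOnLogFreeCore` (R) (`stmt-Schanuel-0970`, rank 4; route `RigidCore`) — Schanuel for `ℚ`-free tuples from `C_EA`
Workfile `Cruxes/SchanuelOnLogFreeCore/Disproof.lean` (60 decls, 0 sorry):
* RESISTANCE: `crux_of_schanuel` (a refutation refutes Schanuel); `crux_of_schanuelOnEcl` ((R) sits below the closed route `EclCore`'s thesis); ranks 0, 1 of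
  (R) are theorems (`rank_one`, without the core hypothesis); rank 2 through `π` is Nesterenko (`rank_two_through_pi`); but (R) ⟹ `e ⊥ π`
  (`expOnePiAlgebraicIndependent_of_crux`, `(1, πi) ∈ C_EA²`) and ⟹ `e^{π²}` transcendental (`transcendental_exp_pi_sq_of_crux`, `(πi, π²)`): the core
  restriction removes NO classical open instance. B7 applies verbatim (`eDerivation_apply_eq_zero_of_mem_core`, `not_isQLinearIndependentMod_of_core`).
* LOAD-BEARING: `false_without_linIndep` (`x = 0`), `false_without_linIndep_injective` (`(2πi, 4πi)`), `false_without_linIndep_pairwise` (`(1, πi, 1+πi)`):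
  linear independence, not injectivity or pairwise independence. `withoutCore_iff_schanuel` (dropping the core = the summit); `forallMember_iff_schanuel`
  (replacing `sInf` by "every member of the family" = the summit, since `⊤` is a member: the intersection is what makes (R) a restriction).
* REFUTED STRENGTHENINGS / SHAPES on the core: `not_strict` (`n+1 ≤ trdeg` fails at `(2πi)`), `not_double` (`2n ≤`), `not_expOnly` (LW shape `n ≤ trdeg ℚ(eˣ)`:
  `(2πi)`), `not_logOnly` (`n ≤ trdeg ℚ(x)`: `(1)`), `not_algIndep_x`, `not_algIndep_exp` (`(1, πi)`): on the core the two transcendentals may sit entirely on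
  either sort. TIGHT: `tight_at_two_pi_I`, `trdeg_eq_of_isAlgebraic` (bound attained on every algebraic `ℚ`-free tuple).
* First-failure form ⟺ crux at rank 2 (`firstFailureForm_rank_two_iff`): the weakening does not remove `e ⊥ π`. Target A of the lines (`stubA_of_crux`,
  SC on the kernel-free core `M = sInf{exp-closed, r.a.c.}` = Macintyre's free `ℚ^{EA}`) forces the transcendence of `e^e` at its first open instance
  (`transcendental_exp_exp_one_of_stubA`; not even irrationality of `e^e` is known).
* DEAD LINES (lead c3, 2026-08-16; `Lines/*-dead.md`): `generic-period-fibre` — built out (18 `Theorems/RigidCoreSchanuelOnLogFreeCore*.lean` files), residue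
  kernel-certified crux-EQUIVALENT `(R) ⟺ A ∧ B` (`stub_splitExact`); `kernel-tower-relative-lw` — built out, residue `(R) ⟺ RelLW₀ ∧ ∀ m RelLW_{m+1}`
  (`Theorems/RigidCoreSchanuelOnLogFreeCoreRelLWExact.lean`), first open instance of `stub_relLWZero` at `r = 1, u = (1)` is `e` transcendental over
  `stage 0 = ℚ(2πi)^{ralg}`, i.e. `e ⊥ π`; `Sketch` dead. Drefute: stubs A (`stub_schanuelOnKernelFreeCore`), B (`stub_periodGenericOverCore`), C (`stub_termGerm`)
  survived, all irrefutable short of `¬SC`. **Lesson:** every decomposition of (R) tried so far relocates `e ⊥ π` into one stub; a line on (R) must name the new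
  transcendence input for the pair `(1, πi)` or `(1, e)` explicitly.

### C9 · crux `SparsityTwo` (`stmt-Schanuel-0971`, rank 5; route `RigidCore`; it implies `MinimalCounterexampleInAcl` at rank 2, `stmt-14765` PROVED)
Statement: for every `ℚ`-defined Zariski-closed `W ⊆ ℂ⁴` (coordinates `x₁, x₂, y₁, y₂`) of dimension `< 2`, the set `indepExpPoints W` of `ℚ`-linearly
independent `x ∈ ℂ²` with `(x, eˣ) ∈ W` is FINITE. Workfile `Cruxes/SparsityTwo/Disproof.lean` (38 decls, 0 sorry):
* RESISTANCE: `sparsityTwo_of_schanuel`, indeed `indepExpPoints_eq_empty_of_schanuel` and `schanuelRank_two_iff_emptiness` (SC(2) ⟺ the EMPTINESS version);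
  `not_schanuel_of_not_sparsityTwo`; `sparsityTwo_iff_finitely_many_counterexamples_per_curve` (the crux says: every `ℚ`-curve carries finitely many SC(2)
  counterexamples); `wStubs_of_schanuelRank_two` (the `W`-quantified stubs E, H, ★ of the picked line are theorems of SC(2) — no unconditional stub-false possible;
  drefute g2 `DrefuteG2StubsUnderSC.lean` kernel-checks this on the VERBATIM registered signatures). WLOG `W` is `ℚ`-irreducible (`sparsityTwo_iff_prime`).
* LOAD-BEARING: `sparsityTwo_false_without_definedOverQ` (the line `{x₂ = 1, y₁ = 1, y₂ = e}` over `ℚ(e)` carries `(2πi(k+1), 1)`; no field-of-definition larger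
  than `ℚ̄`), `sparsityTwo_false_without_dimBound` (`W = ℂ⁴`), `sparsityTwo_false_with_dim_lt_three` (TIGHT in the dimension: the `ℚ`-plane `{x₂ = 1, y₁ = 1}` carries
  `(2πi(k+1), 1)`; Zilber's SEAC predicts the same for every free rotund `ℚ`-surface), `sparsityTwo_false_without_linIndep` (the `ℚ`-line `{y₁ = y₂ = 1, x₂ = 2x₁}`
  carries `(2πi(k+1), 4πi(k+1))`).
* CONSEQUENCES (what any proof re-proves): `sparsityTwo_imp_exp_rat_ne_rat`, `…_imp_hermiteLindemann_real` (`e ∉ ℚ̄` again), `…_imp_shapiroModel_finite`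
  (NOT an open instance), `…_imp_rootChain_finite`, `…_imp_cubicCayley_finite`, `…_imp_cbrtTwoCayley_finite` (the crux settles the cubic / ∛2-Cayley atoms);
  emptiness on the `e`-tower lines `L_{a,b}` is `e^e ≠ a·e + b` (`indepExpPoints_eTowerLine_eq_empty_iff`; for `a = 0`: irrationality of `e^e`, OPEN) while
  FINITENESS there is free (`indepExpPoints_eTowerLine_finite`) — finiteness, not emptiness, is the right crux.
* LINE `cusp-germ-schneider-sparsity` (picked): `stubS_false_without_transcendence` (stub S is FALSE without its transcendence hypothesis — SHARPLY: witness the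
  golden germ `goldenGerm`, algebraic `X₀X₁² + √5·X₁ − X₀`, Fibonacci hits; `rationalJetRunge_false_with_real_jet` in drefute's `PellTightness.lean`: stub R with
  `q ∈ ℚ[X]` relaxed to `A ∈ ℝ[X]` is FALSE via the golden-ratio Pell germ); rigidity of hit sets re-exported from Literature
  (`eventually_zero_of_frequently_geometric_hits` p75707, `golden_rigidity` p75995). Drefute (gen 0, g2): 0 stub-false, 0 misstated, E/H/★ SC-implied, S the only
  field-blind (cheaply refutable) open stub.

### C10 · crux `SchanuelTwo` (`stmt-Schanuel-0069`, rank 3; routes `RoyCriterion`, formerly `EclCore`) — Schanuel's conjecture for `n = 2`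
Statement: `∀ x : Fin 2 → ℂ, LinearIndependent ℚ x → 2 ≤ trdeg ℚ(x, eˣ)` (`= SchanuelRank 2`, `schanuelTwo_iff_schanuelRank_two`; the first open rung of C1,
`royCriterion_two_iff_schanuelTwo`). Contains `e ⊥ π`, `π ⊥ log 2`, `e ⊥ e^e`, `log 2 ⊥ 2^{√2}`. Workfile `Cruxes/SchanuelTwo/Disproof.lean` (62 decls, 0 sorry):
* LOAD-BEARING: `schanuelTwo_false_without_linIndep` (`x = 0`), `schanuelTwo_false_with_nonzero_injective` (`(1, 2)`: non-degeneracy is not independence).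
* TIGHT / REFUTED STRENGTHENINGS: `schanuelTwo_tight` (`(1, √2)`: trdeg exactly 2, LW), `not_schanuelTwoThree`; `not_schanuelTwoExpPart` (`1 ≤ trdeg ℚ(e^{x₁}, e^{x₂})`
  fails at `(iπ, log 2)`), `not_schanuelTwoBasePart` (`1 ≤ trdeg ℚ(x)` fails at `(1, √2)`), `not_schanuelTwoSplit` (at `(iπ, π)` NEITHER sort is independent while
  `SchanuelTwo` holds there by Nesterenko — splitting the conclusion between arguments and values is false); `not_schanuelTwoBaseTwo` (base 2 in place of `e`:
  `x = (1, πi/log 2)`, `2^x = (2, −1)` — the statement is specific to `exp` with its period).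
* SOFT MODELS: `not_schanuelTwoIn_of_kernel_relation`, `exists_isSoftZilberField_not_schanuelTwoIn` (B8 specialised: `SchanuelTwo` FAILS in a Bays–Kirby soft
  Zilber field with `P = x − y`) — any proof of the rank-2 slice already needs non-soft input.
* DEAD LINES (2026-08-16, `Lines/*-dead.md`): `Sketch` (idea `hl-collapse-line-purity`: its one load-bearing stub is the crux); `CardA_BW` (idea
  `bw-log-rich-planes`) and `CardB_Scale` (`cm-level-set-period-scale`, absorbed as `stub_periodSector`) — dead at `stub_rest`: EVERY engine of the tree that outputs
  `trdeg ≥ 2` (HL-collapse, Lindemann–Weierstrass `…StubPurityAlgebraic`, log-rich, grid-rich, Nesterenko planes, modular, gridExp, period sectors — 7 of 8 stubs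
  LANDED as `Theorems/RoyCriterionSchanuelTwoStub*.lean`, `…SchanuelTwoOnPeriodLattices`) became a sector stub, and the complement `stub_rest` is kernel-checked
  equivalent to the crux off that atlas and implies `e ⊥ π`. **Lesson:** the sector atlas at `n = 2` is exhausted by B1–B5; a new line must bring an engine whose
  output at `(1, πi)` is not in the atlas.

### Other crux items with workdirs but no negative knowledge yet
`NguyenRoySmallValueTranslates` (`stmt-1051`, support of `RoyCriterion`; stub F `stub_noTranslateInConj` PROVED, `Theorems/RoyCriterionNguyenRoySmallValueTranslatesStubNoTranslateInConj.lean`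
— a positive lemma), `MinimalCounterexampleInAclGeThree` (`stmt-14744`), `PolarLindemann`/`CheapCertificates`/`TraceZeroEstimate`/`Assembly` (moot items of the refuted
route `PolarPhantoms`).
Generation 2: `TateLocusGPCOne`, `NomeHygiene`, `NomeTransfer`, `CountingGapHigher`, `TwistedSymmetry` acquired `Negative/` directories (C11–C15, §4); new crux
workdirs WITHOUT negative knowledge yet: `TateLocusGPC` 17404 (census only), `Amplification` 16239, `CountingGapPair` 16238, `RelSchanuelOverTowerPi` 17223,
`TwistImpliesTowerPi` 17225, `BenfordFamily` 11400 and the forward-rung birth skeletons (`Cruxes/*/Lines/birth.lean` of `ToricSchanuel`, `TowerSchanuel`,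
`TowerStrong`, `SchanuelUnderTH`, `THOnExpAlgebraic`, `TransferModP`, `TransPartRigidity`, `SlidingRigidity`, `MovingDescent`, `DilationRigidity`,
`FermatQuotientGenericity`, `FirstFailureIsToric`, `QbarRankGradedSchanuel`, `PrimeLogSector`, `OffLogSector`, `Off*`, `MisiurewiczSector`, `CoprimeExpPolynomials*`).

### Dead-line ledger (all cruxes; one line each — crux-ideate seats receive these as `dead_lines`)
| crux | line / idea | verdict | died at |
|---|---|---|---|
| `RoyThesisTyped` 0463 | `Sketch-ideator1-r1` (`liouville-window-ladder`) | COSTUME | diagonal rung `Rung l (l−1)` ≡ crux (`LadderDiagonal.lean`, N1.6) |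
| `RoyThesisTyped` 0463 | `SketchIdeator5R2` (`cm-tau-companion-rank-three`), `CruxPlanTorsionCompanionSector` (`torsion-companion-period-sector`), `Sketch` (ideator 3: `identity-exact-window`) | no-skeleton (L0) | no `RoyThesisTyped_of`; every concluding composition needs `∀ n, RoyCriterion n ⟺ Schanuel`; levers decide only a rank-2 period sector |
| `RoySmallValueDirichletGap` 1050 | `two-sided-absorption-transfer` v4 | COSTUME at `stub_tangentialTowerEmptiness` (+ `stub_richBodies` misstated: needs `τ < 2`) | TTE with `RichBodies` ≡ crux; 3 stubs proved |
| `ApproximationProperty` 6117 | `orbit-interpolation-determinant` | ALIVE (picked; reduced to `CycleAPIAt t`, `t ≥ 3`; siege on `t = 3`) | — |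
| `AclSubsetLogFreeCore` 0968 | `eac-extends-core-automorphisms` (skeleton 46b227c7) | `stub_zilber` COSTUME; `stub_doubleModel` misstated (insert `hX`); `stub_doubleBase`, `stub_caseII` open | fuel of the doubling engine is SP (N6.8) |
| `MinimalCounterexampleInAcl` 0969 | `kernel-arithmetic-selection` (f7f45f09), `span-growth-dichotomy` | ALIVE; 3 stubs open, all rank-2 witnesses are open independence statements | — |
| `SchanuelOnLogFreeCore` 0970 | `generic-period-fibre`, `kernel-tower-relative-lw`, `Sketch` | DEAD (built out; residue ≡ crux) | `e ⊥ π` relocated into `stub_schanuelOnKernelFreeCore` / `stub_relLWZero` |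
| `SparsityTwo` 0971 | `cusp-germ-schneider-sparsity` | ALIVE; E/H/★ SC-implied, S field-blind open | — |
| `SchanuelTwo` 0069 | `Sketch` (`hl-collapse-line-purity`), `CardA_BW` (`bw-log-rich-planes`), `CardB_Scale` (`cm-level-set-period-scale`) | DEAD | `stub_rest` ≡ crux off the sector atlas |
| `KhovanskiiApproxType{,Ev}` 6116/14972, `EPiSimultaneousType` 6118 | `lw-small-height`, `height_window_compactness`, `compositum-defect-split` | ALIVE with forced windows (N4.3, N5.4, N5.5) | — |
| `AclSubsetLogFreeCore` 0968 | `eac-extends-core-automorphisms` — UPDATE 08-16 (lead c2) | DEAD as a closing line: complete modulo ONE sorry `stub_zilber : IsZilberField ℂ` = Zilber's conjecture ⊇ summit (H1) | the doubling engine's fuel is SP (N6.8) |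
| `KhovanskiiApproxTypeEv` 14972 | `Sketch`, `SketchIdeatorR1K2`, `SketchIdeatorR2K5`, `line-lambert-liouville-kill`, `line-rare-field-species` (leads a2, a4, c6–c8 re-certified) | DEAD for the crux (ineligible / complete-without-transfer: support skeletons fully landed, no `KhovanskiiApproxTypeEv_of`); leads c9–c13 `blocked-on Literature.NumberTheory.Transcendental.ExpOnePiAlgebraicIndependent` | strategist p1: typed split BY NATURE `LWLayerRankThreeUp ∧ NonLWLayerRankTwo ∧ NonLWLayerRankThreeUp` (glue + converse PROVED, `Cruxes/KhovanskiiApproxTypeEv/Split.lean`; route edit not filed); the `(π, e)` layer stays `e ⊥ π`-hard |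
| `MinimalCounterexampleInAcl` 0969 | `kernel-arithmetic-selection`, `span-growth-dichotomy`, `sweep-below-rank` (lead c17, 08-17) | DEAD as closing lines (L5 third clause): every provable stub is a tree theorem (84 `--supports` files); open stubs are named research statements (first-failure sparsity `R₃`, `stub_expImageFinite_offLog`, locus-defect boundedness) | strategist p1: decomposition into three leaf residues prepared (`PureGenericRankTwoInAcl` …), line `ominimal-height-split` REGISTERED (5 stubs O / PH′ / TALL* / R₃ / S7′) |
| `SchanuelOnLogFreeCore` 0970 | `sector-split` v22–v27 (leads c4–c12) | PARKED: kernel-exact `(R) ⟺ PiFreeOverLWField ∧ CoreRel∣core` (p138589); open stubs = items 9545 / 9548-core, served_by 0 | strategist Part I + II: `no-strategy-short-of-summit` |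
| `SchanuelTwo` 0069 | `GridTwoTwo` (fwd-ladder, 08-17: `SchanuelTwo ↔ Rung 1 2 ↔ Rung 2 1` PROVED; stubs `stub_oneAlgExp`, `stub_allTranscExp`, `stub_descent`) | REGISTERED ladder line; next rung = the `(2,2)` grid cell = Waldschmidt Conj. 2.3 at `d = ℓ = 2` | strategist p1: `no-strategy-short-of-summit` (human to decide on the sector split) |
| `RoyThesisTyped` 0463 | — (08-17) | strategist: `no-strategy-short-of-summit` (`Cruxes/RoyThesisTyped/StrategyCensus.lean`: crux ⟺ summit rank by rank and point by point) | E4 |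
| `ApproximationProperty` 6117 | `orbit-interpolation-determinant` v27b–v28b (leads c5–c14, `KERNEL-c*.md`) | ALIVE; `Q₂`-normal form of the mid-low-small kernel LANDED; c14: "no interpolation lever can close the residual (the α-principle)", three levers retired | siege on `CycleAPIAt 3` continues (`STUB-PLAN-CycleAPIAt3.md`) |
| `SparsityTwo` 0971 | `cusp-germ-schneider-sparsity` (lead c4 PROMOTE) | complete modulo three residual ATOMS (open exact-coincidence problems, SC(2)-implied; A3 depth-capped by the Nesterenko–Waldschmidt π-measure) | `promote-stub` stands |
| `TateLocusGPCOne` 17406 | `Sketch` (`s-dual-second-cusp`), `ideator1_sketch` | DEAD at `stub_twoNomeS` (= GPC for `h¹(E_τ) ⊕ [ℤ² → 𝔾_m]`, dim 6, stronger than the crux) | strategist b1: `no-strategy-short-of-summit`; C11 |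
| `TateLocusGPC` 17404 | — | strategist b1: `no-strategy-short-of-summit` (no Disproof, no lines yet) | GPC-strength (C11 several nomes) |
| `NomeHygiene` 17298 · `NomeTransfer` 17405 | `integer_shift_rebase` · `trdeg-bookkeeping` | PROVED — cruxes CLOSED (C12, C13) | — |
| `TwistedSymmetry` 17222 | `birth` (CoreTwist ∧ CoreTwistExtends, vetted PASS) | strategist r1: `no-strategy` — TS is Zilber-strength (categoricity), `S → TS` unknown; split passes (a)–(c), FAILS (d) | C15; H1 |
| `LogSector` 4310 | `grading_split` (REGISTERED: `stub_homDetRep`, `stub_freshLog` …), `hom_structural_rank`, `loghom_scaling` | strategist r1: redirect `LogSector ⇐ HomLogSector ∧ LogHomogeneity` DELIVERED (light seam; route edit `--split` pending) | B1 audit (structural rank = homogeneous part only) |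
| `RankLeTrdeg` 3486 | `LogSector_birth`, `OffLogSector_birth` | strategist r1: redirect `RankLeTrdeg ⇐ LogSector ∧ OffLogSector` DELIVERED (`Split.lean`; edit bounced "final cycle only") | E2/E3 |
| `MixedTripleIndependent` (GaussianStokesSector) | `schanuel_split` | DECOMPOSED → `EPiAlgIndependent`, `GaussValueRelTranscendental` (glue `MixedTripleOfSchanuelSplit`, assembly PROVED ≈ 230 lines; piece probes failed 2/2) | — |
| `BenfordFamily` 11400 (BenfordTowers) | `DictionarySplit` (`HomPrimeLogSector_birth`, `BenfordOfHom_birth`, `LevelZero`, `TwoPrimes`, `SpecialCases`) | strategist r1: dictionary decomposition `BenfordFamily ⇐ HomPrimeLogSector ∧ (Hom → Benford)` | — |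
| `PiFreeOverLWField` 9545 · `RelSchanuelOverPiLWField` 9548 · `RealLogSector` 11767 · `OffPrimeLogSector` 7090 · `RecursiveSchanuel` 12193 · `ComputableSchanuel` 4023 | — (redirect strategists r1, 08-17) | `no-decomposition` · `no-strategy` (E1) · `no-strategy` (dominated by `LogSector`, E2) · `no-strategy` (residual conjunct, E2) · `no-strategy` (E6) · NO-DECOMPOSITION (E5) | each census lists the typed splits tried and which of (a)–(d) failed |

### Strategist-census ledger (generation 2; `Cruxes/<Crux>/STRATEGY-CENSUS.md`, all dated 2026-08-17 — read the file before seating another strategist on the same crux)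
Nineteen censuses exist: `ComputableSchanuel` (NO-DECOMPOSITION, `Census4023.lean`), `KhovanskiiApproxTypeEv` (split by
nature delivered, `Split.lean`), `LogSector` (grading split delivered), `MinimalCounterexampleInAcl` (three leaf residues; line `ominimal-height-split`),
`MixedTripleIndependent` (DECOMPOSED), `NomeHygiene` (line with teeth → PROVED), `NomeTransfer` (line with teeth → PROVED), `OffPrimeLogSector` (no-strategy:
residual conjunct), `PiFreeOverLWField` (no-decomposition; `EQUIVALENCE-AUDIT.md`, `COVARIANCE-CHECK.md`, `SiblingAudit.lean`), `RankLeTrdeg` (sector redirect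
delivered), `RealLogSector` (no-strategy; `Calibration.lean`), `RecursiveSchanuel` (no-strategy; `StrategyCensus.lean`, BC7 CLEAN), `RelSchanuelOverPiLWField`
(no-strategy; `StrategistCalibration.lean`), `RoyThesisTyped` (no-strategy-short-of-summit; `StrategyCensus.lean`), `SchanuelOnLogFreeCore` (Parts I–II,
no-strategy-short-of-summit; `StrategistBWBridge.lean`, `StrategistSplitSketch.lean`), `SchanuelTwo` (no-strategy-short-of-summit; `SplitTrichotomy.lean`,
`LADDER-SchanuelTwo.md`), `TateLocusGPC` and `TateLocusGPCOne` (no-strategy-short-of-summit; `StrategistSketch*.lean`), `TwistedSymmetry` (no-strategy).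
**Pattern (the generation-2 lesson):** every `no-strategy` verdict has the same shape — the crux is either kernel-equivalent to `S` (E3–E5), a conjunct of a
kernel split of `S` whose partner is summit-type (E1, E2), or dominated by a registered strong hypothesis (H1) — and every DELIVERED decomposition cuts
along a landed structural theorem (sector split E2, grading `P = Σ P_d`, LW-layer vs non-LW layer, Stokes identity, integer-face dictionary). New routes
should start from such a cut, not rediscover it under the tribunal.

---

## 6. Cross-index

### 6.1 Typing checklist for Schanuel cruxes (every item below has a kernel-checked witness above; run it over each signature before `route open` / `workitem add`)
1. **`LinearIndependent ℚ x` cannot be dropped or weakened** to injectivity, non-vanishing or pairwise independence — constant / zero / collinear tuples kill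
   every crux that drops it (N1.1, C8 `false_without_linIndep_injective`/`_pairwise`, C10 `schanuelTwo_false_with_nonzero_injective`, N5.1 `s = (1,1)`, N7.2 `(c,c,c)`,
   C9 `{x₂ = 2x₁}`), and LI-free versions of definability cruxes even REFUTE Schanuel (N7.2).
2. **Strict `<` in transcendence-degree hypotheses** (`trdeg ℚ(x, eˣ) < n`, `dim W < n`): the defect-ZERO tuples `(2πi)`, `(πi, π)` (Nesterenko) kill the
   `≤`-weakenings and every finiteness stub that does not consume isolation (N7.4, C9 `…_with_dim_lt_three`); `trdeg ≤ t` in approximation properties cannot be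
   relaxed to `≤ t+1` (N3.4).
3. **No constants uniform in the point** (`∃ c ∀ θ`): integer points + Cauchy's bound (N3.2), Lambert degenerations to algebraic points (N5.3), Liouville
   points (N4.5) — constants must depend on `θ` and blow up near `ℚ̄`.
4. **`∀ᶠ` (all large scales) vs `∃ᶠ` (infinitely many scales)**: fast Liouville numbers make `∃ᶠ`-hypotheses satisfiable at transcendental points (N2.4: false
   even for Roy's printed theorem; polynomial windows `[N, N^λ]`, `λ < 23/10`, do not suffice); in Roy's rank-one criterion the `∃ᶠ N` mutation is instead TRUE
   modulo Baker (N1.9) — check which regime you are in.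
5. **Exponent windows are pinned by box principles**: single-variable polynomial measures need degree exponent `a ≥ 1` (Dirichlet: N4.3 `DirichletPoly`), slot
   floors `A ≥ 1` (N5.5), decoupled codimension-one measures in `m` variables `μ ≥ m` (N5.5), simultaneous measures for pairs in a COMMON field `a ≥ 1/2`
   (conjugation trick / β-expansions / AP2: N4.3, N5.4), and an approximation property of level `t` is incompatible with any measure with `a < 1/t` (the race,
   N4.3); Roy's small-value gap lives in `2+β−τ < ν ≤ 2+β−τ+(τ−1)(2−τ)/(β+1−τ)` with `1 ≤ τ < 2`, count `3⌊D^τ⌋ > D`, `η ≠ 0` (C2). A crux with a hand-picked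
   exponent outside these windows is false or vacuous; state `∃ a` in the forced window.
6. **Accuracy exponents must be in the OUTPUT `(d, H)`**, not only in the scale (N3.3 Laurent–Roy remark; Liouville numbers).
7. **Operators: only the invariant derivation `D = ∂₀ + X₁∂₁` of `𝔾ₐ × 𝔾ₘ` works** — `∂₀` alone, values without derivatives, Euler / `𝔾ₐ²` / `(t, t²)`
   analogues all have algebraic Darboux leaves through transcendental points (N1 extras `not_cruxPartial0`, `not_cruxNoDeriv`; C2 Darboux criterion). State
   side conditions excluding the Darboux locus (`η ≠ 0`, `α_j ≠ 0`).
8. **Exp-free "for every point of trdeg `< n`" certificate / exactness statements die by specialisation** (R1, R2): any point whose coordinate ring has a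
   place collapsing Roy's multi-orbit is a witness; restricting to exponential points makes the statement Schanuel itself.
9. **Reformulations equivalent to (or containing) the summit are not theses** (S1–S3: `ecl ∅` localisation, toric GPC, Zilber's conjecture; N1.6/N1.7: rank
   ladders, cofinal ranks; C8/C10: residues `stub_rest`, `A ∧ B` kernel-certified ≡ crux): the gate retires them `not-a-thesis`, drefute grades them COSTUME.
10. **Soft / functional / first-order / axiomatic derivations of SP are refuted by explicit models** (B7 `exp = 1` on `ℚ` and every exponential field's weak SP;
    B8 `𝔹_P`; B9 ultrapowers; C10 soft Zilber field at rank 2; N6.8 the doubling engine's base strongness IS SP): a line must name its non-soft input —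
    archimedean/analytic structure of `ℂ_exp`, arithmetic of specific numbers, or an explicit transcendence theorem.
11. **Definability cruxes (C6): finiteness and parameter-freeness are load-bearing; `exp`-closure and `2πi` in the core are load-bearing; "countable" for
    "finite" is SC-false; branch statements modulo `4πi`** (Kummer parity); `(A)` is not soft (it decides `ln 3 ∉ ℤ[ln 2 + 2πij] + 2πik` or puts `ln 2` in `K_ω`).
12. **Classical-method outputs (what NOT to promise from them):** linear independence / `r ≤ s ≤ 2r` from Baker–LST (B1, B2); `t ≈ dℓ/(ℓ+d)` under (T.H.),
    `t₂ ≥ 2` without it (B3); independence only at algebraic arguments from `E`-functions (B4); `trdeg ≥ 3` at one `q` from the modular method (B5); statements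
    about `𝓛 ∌ 1` from period conjectures over `ℚ̄` (B6). The pair `(1, πi)` — `e ⊥ π` — is outside every one of these outputs and inside `ecl ∅` (B7); every built-out
    line on the summit so far (C8, C10, N7 rank 2) has died by relocating exactly this pair into its last stub.
13. **(gen 2) Ax / Ax–Schanuel AT the minimal counterexample is vacuous for ANY derivations** (B11): a crux or stub of the form "at a first failure `x`, some
    derivation `D` with `D e^{xᵢ} = e^{xᵢ} D xᵢ` has `D x ≠ 0` / Ax's rank term positive" is FALSE-by-theorem (`not_isQLinearIndependentMod_of_firstFailure`,
    `firstFailure_rank_eq_zero`); Ax must be applied at OTHER tuples, leaving a finiteness statement (C7), or replaced by non-derivation input.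
14. **(gen 2) Jacobian criterion ⇒ "counted points" are Schanuel counterexamples** (N11.1): any crux asserting a bound on points carrying `≥ codim + 1`
    independent integer relations is IMPLIED by Schanuel (the set is empty) — file it knowing it is irrefutable short of `¬SC` and that its content is the
    unconditional bound, not the existence of a gap; state gradients' independence explicitly or the Jacobian step fails.
15. **(gen 2) `tsum` junk values on the Tate locus** (N8.2): `q`-series cruxes need `0 < Im τ` / `‖q‖ < 1` as a hypothesis — at `|q| ≥ 1` Lean's `P = Q = R = 1`
    makes every lower bound `≥ 3` false; likewise EVERY listed generator of a period field is load-bearing (N8.3: deleting any one of `2πi, τ, q, P, Q, R` drops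
    the truth by one at an explicit algebraic-`τ` or algebraic-nome point) and the non-CM clause is worth exactly two degrees (N8.1) — do not file "`5` without
    `2πi`" or "`4` for all `τ`"; exclude the `SL₂(ℤ)`-orbits of `i` and `ρ` whenever `R` or `Q` is claimed independent (L2).
16. **(gen 2) Re-basing spans of logarithms needs ENLARGEMENT and a TRANSCENDENTAL shift direction** (N9.4 cubic trap; N9.2 `n + k ≥ 3`, `k ≤ 3` sharp): "some
    basis of `span z` itself is in general position" is false in cubic fields; coincidence-finiteness along an algebraic direction is false.
17. **(gen 2) "Crux minus one hypothesis" is rarely a new crux** (N10.2, E6; also N6.*, C8): on this summit dropping a hypothesis from a proved or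
    summit-implied transfer statement yields, in every recorded case, either a theorem again, the summit verbatim, or a one-line falsity — run the three
    checks (`… ↔ Schanuel` by `k = 0` / empty tuple; trivial witness `z = ![0]`; composition of landed stubs) before filing the mutation.
18. **(gen 2) Symmetry / automorphism cruxes must say where the map comes from** (N12.2–N12.3): a ring endomorphism of `ℂ` twisting `exp` is discontinuous and
    non-measurable, so "construct σ" lines are dead and "∃ σ" can only come from categoricity (Zilber-strength, H1); the continuous / measurable / definable
    versions are FALSE — state the crux so that its use of `σ` survives `σ` being wild, or do not file it.

### 6.2 Recurring witness kit (re-use before filing; each is already formalised in the files cited)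
`x = 0`, `(c, c, c)`, `(1, 2)`, `(2πi, 4πi)`, `(1, πi, 1+πi)` (dependence) · `(2πi)`, `(πi, π)` + odd multiples, `(2πik)` (defect zero / kernel) · `(1, e)`, `(1, √2)`,
`(iπ, log 2)`, `(iπ, π)`, `(1, πi/log 2)` (tightness / shape splitting) · `(e, 1)`, `(e, 0)`, `(0, e)`, `(e, e)`, `(e, e²)`, `(e−1, e)` with `P = X₂−1, X₂, X₁, X₂−X₁, X₂−X₁², X₂−X₁−1`
(Darboux leaves) · `(0, η∞)` with `η∞ = Σ 2^{−2^{4ⁿ}}`, `Σ 2^{−k!}`, `(L, L)`, radical-Liouville tuples, ultra-Liouville tower `Σ 10^{−t(j)}` (sparse scales /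
Liouville) · Diaz approximations of `e` at `(1,…,1,e,…,e)`, `(1,1,α,α)`, conjugate pairs `(1±i, e^{1±i})`, `(log(±2i), ±2i)`, Lambert family `(x_k, √2x_k)`,
`kx_ke^{x_k} = 1` (approximation types) · `θ = N ∈ ℕ`, `θ = i`, `K = ℚ(ζ_p)` with `β = 0` (shape) · `y = (π, π²), α = (1+π, 1−π)`; `y = (1, e), α = (e, 1)`
(specialisation) · trivial exponential `exp = 1` on `ℚ`, `𝔹_{x−y}`, `ℂ^ℕ/𝒰` with `r = ω = [(0,1,2,…)]`, kernel triple `(rt, r²t, r³t)` (soft models) · `√2 = e^u + e^{−u}`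
(`8u` kernel generator), `x₀ = −Ω` (`e^{x₀} = −x₀`), `e^π ∉ ℚ(π)^{ralg}` (definability).
Generation-2 additions: `τ = i` (`R(e^{−2π}) = 0`, `P(e^{−2π}) = 3/π`: CM collapse, value 3) · `τ₀ = i·2^{1/4}` (algebraic non-quadratic `τ`, certified) ·
`τ_α = log((3+4i)/10)/2πi` (algebraic nome, non-quadratic via `(3+4i)ⁿ ≡ 3+4i mod 5`) · `τ₁ = −i·2^{1/4}` (`|q| ≥ 1`, `tsum` junk) · `q = 1/2` with
`(P, Q, R)(1/2)` (Nesterenko, threshold tightness) · `τ₀ = ∛2·e^{iπ/3}`, cell `2πi·(1, τ₀, τ₀²)` (cubic trap) · `z = ![0]` (double hypothesis drops) ·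
`y = (π, π², …)`, `α = (1+π, 1+π², …)` and every polynomial point `Y(0) = 0, A(0) = 1` (specialisation collapse, all ranks) · `μ₀ = (3+4i)/5` (admissible twist
parameter) · Steinhaus–Pettis (`AddMonoidHom.continuous_of_measurable`) against measurable twists · first-failure tuples as non-degenerate Khovanskii points
(`firstFailure_exists_khovanskiiSystem`) against Ax-at-the-tuple.

### 6.3 Barrier → open routes that must answer it (generation 1 as of 2026-08-16, generation-2 additions below; from the routes' own BARRIERS sections)
B1: all open routes except `CyclotomicRigidity`, `GaussianStokesSector` · B2: `LogPatterns`, `GeodesicRealLogs`, `MatrixCoefficients`, `ToricSector`,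
`DilateIntersection`, `PowerMapCalibration`, `AdelicLogSector`, `BenfordTowers`, `CapacityLadder`, `AlgIndepMethod`, `MisiurewiczField`, `SheetDescent`, `RoyCriterion` ·
B3: `AlgIndepMethod`, `CapacityLadder`, `DiophantineCore`, `DilateIntersection`, `CoprimeExpPolynomials`, `DiophantineDichotomy`, `PowerMapCalibration`,
`ArithmeticalComplexity`, `LogPatterns`, `AdelicLogSector`, `BenfordTowers`, `GeodesicRealLogs`, `MisiurewiczField`, `SheetDescent`, `GaussianStokesSector`,
`MatrixCoefficients`, `RoyCriterion` · B4: `GaussianStokesSector`, `CyclotomicRigidity`, `CoprimeExpPolynomials`, `DiophantineCore`, `DiophantineDichotomy`, `ToricSector`,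
`RoyCriterion` · B5: `AlgIndepMethod`, `CapacityLadder`, `CoprimeExpPolynomials`, `DiophantineCore`, `GaussianStokesSector`, `RoyCriterion` · B6: `AdelicLogSector`,
`BenfordTowers`, `LogPatterns`, `GeodesicRealLogs`, `GaussianStokesSector`, `MatrixCoefficients`, `RoyCriterion` · B7: `RigidCore`, `ExpMordellWeil`, `SheetDescent`,
`MisiurewiczField`, `DiophantineCore`, `CyclotomicRigidity`, `RecursiveCore`, `ArithmeticalComplexity`, `PowerMapCalibration`, `BenfordTowers`, `CapacityLadder`,
`MatrixCoefficients`, `RoyCriterion` · B8: `RigidCore`, `CyclotomicRigidity`, `ExceptionalSubspaces`, `RecursiveCore`, `ExpMordellWeil`, `ArithmeticalComplexity`,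
`PowerMapCalibration`, `CapacityLadder`, `RoyCriterion` · B9: `ArithmeticalComplexity`, `RigidCore`, `CyclotomicRigidity`, `ExceptionalSubspaces`, `RecursiveCore`,
`MisiurewiczField`, `CapacityLadder`, `RoyCriterion`.
Open cruxes directly under crux-level negative knowledge: `RoyCriterion` {`RoyThesisTyped` 0463, `SchanuelTwo` 0069, supports 1050/1051}, `PowerMapCalibration`
{`RoyConjectureTwo` = 0078}, `DiophantineDichotomy` {`KhovanskiiApproxTypeEv` 14972, `ApproximationProperty` 6117, target `KhovanskiiSchanuel` 6115}, `RigidCore`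
{0968, 0969, 0970, 0971, 14744}.
Generation-2 additions (routes opened 08-16/17, from their own BARRIERS sections): B1: `RelationCounting` (relocated to `CountingGapHigher` at `k = 3`),
`SingularModulusScaling` (conceded inside `RelSchanuelOverPiLWField`), `SurplusLinkage` (conceded on the `b = 0` face `stub_logLayer`), `TateNomes` (fibre
`q ∈ ℚ̄` of `TateLocusGPCOne`) · B2: `SurplusLinkage` · B3: `RelationCounting` (counting needs no lower bound for `|P|`; Philippon-criterion fallback re-enters),
`TateNomes` (several-nome cusp schemes lose a degree per variable), `SurplusLinkage` (mixed face at `n ≥ 4`, T.H.-free zero estimate `LargeTrdegWithoutTH` 10491) ·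
B4: `SingularModulusScaling` (all arguments algebraic; `π` as a G-value), `TwistedConjugacy` (LW only at manufactured algebraic points) · B5: `TateNomes` (output
conceded, scope bet; L2 excluded by non-quadraticity), `SingularModulusScaling` (CM input at infinitely many points) · B6: `TateNomes` (`M_τ` over a
transcendental base) · B7/B11/B12: `TwistedConjugacy` (Ax only after the twist makes the relation functional; non-soft input = TS, which fails in `𝔹_P`),
`RelationCounting` (first-failure presentation, Jacobian), `TateNomes` (Mahler + Ax functional analogue is true and silent on values) · B8/B9: `TwistedConjugacy`
(TS is second-order about one field; not a consequence of Zilber's axioms minus SP) · B10: any certificate / dual-witness card on Roy boxes · H1: `TwistedConjugacy`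
(TS ⇐ ZC by categoricity), `RigidCore` (`stub_zilber`).
Open cruxes directly under crux-level negative knowledge (generation 2 additions): `TateNomes` {`TateLocusGPCOne` 17406, `TateLocusGPC` 17404; `NomeHygiene`
17298 and `NomeTransfer` 17405 PROVED}, `RelationCounting` {`CountingGapHigher` 16237}, `TwistedConjugacy` {`TwistedSymmetry` 17222}.

---

## 7. Provenance and refresh notes
* Counts (generation 2): §1 12 barrier declarations (B1–B12) + 2 refuted renderings (L1–L2) + 3 audit addenda; §1′ 3 registered strong hypotheses (H1–H3);
  §2 2 refuted items (R1–R2, unchanged); §3 3 closures + 15 retirements (S1–S4) + the status snapshot S5 + 6 equivalence / conjunct-split entries (E1–E6);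
  §4 12 crux blocks (C1–C7, C11–C15) over 83 landed `Negative/` files (entries N1.1–N7.4 and N8.1–N12.3); §5 3 workfile-only cruxes (C8–C10) + dead-line
  ledger (12 generation-1 lines + 17 generation-2 rows) + strategist-census ledger (19 censuses).
  **Entries with an id: generation 1's 63 (11 B/L + 2 R + 4 S + 43 N + 3 C8–C10) + generation 2's 27 (3 B + 3 H + 1 S + 6 E + 14 N) = 90.**
* Everything quoted was read from the tree on 2026-08-17 (`lean/` at the hub's HEAD, ≈ 18:10Z); theorem names are verbatim (each new name was grepped in its
  file); informal statements paraphrase the Lean signatures printed in the files' docstrings — check the signature before citing in a `closes` / skeleton.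
  Workfile theorems (`Cruxes/**`) are farm-elaborated but not gate-landed and are marked as such.
* Not compiled: `run/shared/priority/refutations.json` (absent on this hub); proposals still pending at compile time; other summits' barrier directories
  (`Literature/Barriers/KontsevichZagierPeriods/*` is the natural companion for B6 and C11); the content of `Cruxes/*/Ideas/*.md` (crux idea cards are not
  negative knowledge). The generation-1 note on `Negative/WithoutKhovanskii.lean` / `Negative/StandardKernelTwist.lean` stands: still not in tree.
* Refresh procedure for the next generation: re-run `ledger negatives --problem Schanuel`; diff `ls Theorems/*/Negative/` (15 dirs / 83 files now) and
  `grep -l "BARRIER (D-0021)" Literature/Barriers/Schanuel/*.lean` (12 now) against the lists above; `find Cruxes -newer <this file>` for new `Disproof.lean`,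
  `STRATEGY-CENSUS.md`, `*-dead.md`; grep new `Theses/*.lean` headers for `status:`; append entries, never renumber existing ids.
* Landing note: the payload asks for `lean/Summits/Schanuel/BARRIERS.md`; the gate (2026-08-17) has no markdown kind and its target regex refuses
  `Summits/Schanuel/BARRIERS.{md,lean}` (`Summits/<P>/Statement.lean | Summits/<P>/<Sub>/Theorems/<Name>.lean` only), so — as for generation 1 — the in-tree
  carrier is the module docstring of `Literature/Barriers/Schanuel/BARRIERS.lean` (verbatim this markdown); payload injectors should point at that path.

## About this Lean file

`Literature/Barriers/Schanuel/BARRIERS.lean` is the in-tree carrier of the Schanuel barrier catalogue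
(`Summits/Schanuel/BARRIERS.md`, barrier-catalogue mode, D-0021): the gate has no markdown kind and its target regex refuses
`Summits/Schanuel/BARRIERS.{md,lean}` (re-checked 2026-08-17 with `ledger propose --dry-run`), so the catalogue is this MODULE DOCSTRING
(markdown above, verbatim the compiled generation-2 `BARRIERS.md`), and the file's two declarations machine-check the catalogue's claim that
every Literature-side barrier declaration of §1 is a THEOREM of the tree: `barrierCatalogue_holds` (generation 1: B1–B9 and the refuted
printed rendering L2) and `barrierCatalogue_gen2_holds` (generation 2: B10 `SpecialisationCollapseBarrier`, B11 `AxLocalDerivationsBlind`,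
B12 `AxSchanuelFunctionalNotNumericalNarrow`). Nothing new is asserted; no definitions. Refresh = re-propose this file with the regenerated
markdown (and one more conjunction if new barrier declarations landed).
-/

namespace Literature.Barriers.Schanuel

/-- **The Schanuel barrier catalogue, §1, is discharged in tree (generation 1, 2026-08-16).** The nine catalogue
declarations carrying a `BARRIER (D-0021)` block for the summit `Schanuel` — the functional (Ax–Kirby), axiomatic
(Bays–Kirby) and first-order (Kirby–Zilber) no-goes, the strength marker `Schanuel → AlgIndepLogarithms`, Roy's
linear-embedding no-go, Diaz's large-transcendence-degree theorem under the Technical Hypothesis, Siegel–Shidlovskii,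
Nesterenko's Theorem 1.1 and the toric period-conjecture bookkeeping — all hold, and Nesterenko's Conjecture 1.11 is
false as printed (`τ = ρ`). Pure conjunction of the landed discharges `axSchanuelFunctionalNotNumerical_holds`,
`axiomsDoNotForceSchanuel_holds`, `schanuelPropertyNotFirstOrder_holds`, `algebraicIndependenceOfLogarithms_holds`,
`linearSubgroupMethodLimit_holds`, `LargeTranscendenceDegree_holds`, `EFunctionValuesAtAlgebraicPoints_holds`,
`NesterenkoModularScope_holds`, `periodConjectureOverQbarScope_holds`, `NesterenkoConjecture_1_11_false`; it is the
index anchor of the catalogue in the module docstring (entries B1–B9, L2). [cite: Kirby2010, Thms. 1.1-1.2 and Prop. 7.2]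
[cite: BaysKirby2018ANT, §9.2] [cite: KirbyZilber2014, §2.1] [cite: Roy1995, Theorem 3.4]
[cite: NesterenkoPhilippon2001, Ch. 3 Theorem 1.1; Ch. 14 Theorem 2.7] [cite: Rivoal2024, Théorème 5.10]
[cite: Bertolin2002, Cor. 1.3] -/
theorem barrierCatalogue_holds :
    AxSchanuelFunctionalNotNumerical ∧ AxiomsDoNotForceSchanuel ∧ SchanuelPropertyNotFirstOrder ∧
      AlgebraicIndependenceOfLogarithms ∧ LinearSubgroupMethodLimit ∧ LargeTranscendenceDegree ∧
      EFunctionValuesAtAlgebraicPoints ∧ NesterenkoModularScope ∧ PeriodConjectureOverQbarScope ∧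
      ¬ NesterenkoConjecture_1_11 :=
  ⟨axSchanuelFunctionalNotNumerical_holds, axiomsDoNotForceSchanuel_holds, schanuelPropertyNotFirstOrder_holds,
    algebraicIndependenceOfLogarithms_holds, linearSubgroupMethodLimit_holds, LargeTranscendenceDegree_holds,
    EFunctionValuesAtAlgebraicPoints_holds, NesterenkoModularScope_holds, periodConjectureOverQbarScope_holds,
    NesterenkoConjecture_1_11_false⟩

/-- **The Schanuel barrier catalogue, §1 generation-2 additions, are discharged in tree (2026-08-17).** The three
catalogue declarations appended as B10–B12 — the specialisation-collapse no-go for exp-free certificate theses on Roy's box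
(every rank `n ≥ 2`), the vacuity of Ax's theorem at a first failure of Schanuel for arbitrary derivations exponential on the
tuple, and the narrowing of the functional-not-numerical barrier to exponential-field-uniform arguments (with the proved
residue points) — all hold. Pure conjunction of the landed discharges `specialisationCollapseBarrier_holds`,
`axLocalDerivationsBlind_holds`, `axSchanuelFunctionalNotNumericalNarrow_holds`; index anchor of entries B10–B12 of the
module docstring. [cite: Roy2001, §5 (2°)] [cite: Kirby2010, Prop. 4.7, Lemma 4.8 and Prop. 7.2] [cite: Ax1971, Thm. 3]
[cite: NesterenkoPhilippon2001, Ch. 3 Theorem 1.1 and Corollary 1.2 (p. 27)] [cite: Baker1975, Theorem 1.4] -/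
theorem barrierCatalogue_gen2_holds :
    SpecialisationCollapseBarrier ∧ AxLocalDerivationsBlind ∧ AxSchanuelFunctionalNotNumericalNarrow :=
  ⟨specialisationCollapseBarrier_holds, axLocalDerivationsBlind_holds, axSchanuelFunctionalNotNumericalNarrow_holds⟩

end Literature.Barriers.Schanuel
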